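import Literature.NumberTheory.Automorphic.AsgariRaghuramExteriorSquareCuspidal
import Literature.NumberTheory.Automorphic.AsgariRaghuramExteriorSquareCuspidality
import Literature.NumberTheory.Automorphic.AsgariRaghuramWedgeTwoCuspidality
import Literature.NumberTheory.Automorphic.AutomorphicRepsGLSatakeFlathProofs
import Literature.NumberTheory.Automorphic.AutomorphicRepsGLOneHeckeCharacter
import Literature.NumberTheory.Automorphic.AutomorphicRepCentralCharacter
import Literature.NumberTheory.Automorphic.GLnAdelicStructureProofs
import Literature.NumberTheory.Automorphic.IsobaricRigidityRepData
import HarnessLib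

/-!
# Asgari–Raghuram 2007, Theorem 1 (i) ⇒ (iii): the three Satake renderings of the tree agree

Sibling proof file (theorems only: no definition, no named fact, no `sorry`) of
`Literature.NumberTheory.Automorphic.AsgariRaghuramExteriorSquareCuspidal`, whose named fact
`AsgariRaghuram2007_selfDual_or_selfTwist_of_wedgeTwo_not_cuspidal` renders M. Asgari,
A. Raghuram, *A cuspidality criterion for the exterior square transfer of cusp forms on GL(4)*,
Clay Math. Proc. 13 (2011) 33–53 = arXiv:0712.4315 [AsgariRaghuram2007], **Theorem 1,
(i) ⇒ (iii)** (p. 3 of the arXiv text; proof §4, Props. 11–12, p. 10): *if `∧²Π` is not cuspidal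
then `Π ≅ Π̃ ⊗ χ` for some Hecke character `χ`, or `Π ≅ Π ⊗ χ` for some `χ ≠ 1`*, on Satake
parameters at almost all finite places.

The same printed implication is vendored THREE times in the tree, in three dialects of the
`GL_n` vocabulary (`AutomorphicRepsGL`):

* `AsgariRaghuram2007_selfDual_or_selfTwist_of_wedgeTwo_not_cuspidal` (this file's parent;
  conclusions through a Hecke character `χ` and its values `χ(ϖ_v)`,
  `HeckeCharacter.valueAtUniformizer`);
* `AsgariRaghuram2007_notCuspidal_wedgeTwo_imp` (`AsgariRaghuramExteriorSquareCuspidality`;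
  conclusions through a cuspidal datum `η` on `GL(1, 𝔸_F)` and its Satake parameters `{e}`;
  consumed by the crux `InducedSquareAscent` of summit Langlands);
* `AsgariRaghuram_wedgeTwo_notCuspidal_GL4` (`AsgariRaghuramWedgeTwoCuspidality`; conclusions
  as `HasSatakeParamAt`-transport of the twisted / dualised parameter, `IsSatakeSelfTwist`).

## What is proved here

The three named facts are **equivalent** (`…_iff_notCuspidal_wedgeTwo_imp`,
`…_iff_wedgeTwo_notCuspidal_GL4`), by theorems of the tree only:

* uniqueness of Satake parameters of an automorphic representation datum
  (`AutomorphicRepData.hasSatakeParamAt_unique_holds`; Flath 1979, Thm. 3) — turns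
  "`π` has parameter `χ(ϖ_v)·α⁻¹` at `v`" into the multiset identity `{αᵢ⁻¹} = {χ⁻¹(ϖ_v) αᵢ}` and
  back;
* the rank-one dictionary "automorphic representations of `GL(1)` = idèle class characters"
  (Borel–Jacquet 1979, 4.6; Gelbart 1975, §2.A), proved in the tree in both directions:
  `AutomorphicRepData.exists_heckeCharacter_glOne` with
  `AutomorphicRepData.eventually_hasSatakeParamAt_glOne` (a datum `η` on `GL(1, 𝔸_F)` has Satake
  parameter `{χ_η(ϖ_v)}` almost everywhere), and `exists_automorphicRepData_detTwist_glOne` with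
  `AutomorphicRepData.hasSatakeParamAt_detTwist_glOne` (the line `ℂ·(χ∘det)` realises `χ`);
* rigidity of Hecke characters (`HeckeCharacter.ext_of_eventually_valueAtUniformizer_eq`,
  Cassels–Fröhlich VII Prop. 4.1): "`χ(ϖ_v) = 1` for almost all `v`" is "`χ = 1`", which matches
  the clause "`ξ` is not unramified-trivial almost everywhere" of the `GL(1)`-datum rendering with
  "`χ ≠ 1`" of the other two;
* the discharged standing fact `isCompact_glFiniteIntegralLevel_holds` (compactness of
  `GL_m(𝒪̂_F)`), to pass between the binder shapes `(hF : ∀ m, …)` and `(h1) (h4) (h6)`.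

Consequently a discharge of any one of the three facts discharges the other two in one line
(`…_of_notCuspidal_wedgeTwo_imp`, `…_of_wedgeTwo_notCuspidal_GL4` and the `.mpr` directions).

## Status of the discharge `AsgariRaghuram2007_selfDual_or_selfTwist_of_wedgeTwo_not_cuspidal_holds`
## (triage: XL — a theory); what this file proves of the printed proof

The printed proof (§4, p. 10) is: Kim's theorem (`∧²Π` exists and is an isobaric sum
`σ₁ ⊞ ⋯ ⊞ σ_k` of unitary cuspidal `σᵢ`; tree: the UNPROVED named fact
`Kim2003_exteriorSquare_GL4`, itself triaged XL in `KimExteriorSquareGL4Proofs`); the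
Jacquet–Shalika / Jacquet–Piatetski-Shapiro–Shalika pole criterion (a non-cuspidal isobaric `ρ`
on `GL(6)` has a cuspidal summand `σ` of degree `≤ 3`, and then `L^S(s, ρ × σ̃)` has a pole at
`s = 1`; Thm. 3 p. 5); and the Langlands–Shahidi method on `G = GSpin(2n+6)` with Levi
`GL(n) × GSpin(6)` (Prop. 4: `w₀(Σ) ≇ Σ ⇒ L(s, Σ, r₁)` entire; Prop. 5: the action of `w₀`;
Props. 11–12: holomorphy of `L^S(s, Π ⊗ σ, ∧² ⊗ ρ_n)` at `s = 1`). The tree has no automorphy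
datum for `GSpin`, no Langlands–Shahidi `L`-functions and no isobaric sums; nothing in this file
assumes any unproved statement except as an explicit hypothesis.

**The whole printed argument is assembled here**, as the theorem
`AsgariRaghuram2007_selfDual_or_selfTwist_of_wedgeTwo_not_cuspidal_of_kim_of_LS`: the fact follows
from FOUR explicit hypotheses stated in the tree's vocabulary — Kim's Theorem A WITH its unitarity
clause (`hKim`), Arthur–Clozel (2.2)–(2.3) for Borel–Jacquet data (`hJSb`, `hJSp`: the tree's named
facts `JacquetShalika1981_partialPairL_boundary_repData`, `JacquetShalika1981_partialPairL_pole_repData`),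
and ONE Langlands–Shahidi input `hLS` = Props. 4 and 5 of the paper with its eq. (2) (for cuspidal `Π`
on `GL(4)` and `σ` on `GL(n)`, `n = 1, 2, 3`: if `Π ≇ Π̃ ⊗ ω_σ^{±1}` (`n` odd), resp. `Π ≇ Π ⊗ ω_σ`
(`n = 2`), on Satake parameters — `ω_σ(ϖ_v) = ∏ t_{σ,v}` — then `L^S(s, Π ⊗ σ, ∧² ⊗ ρ_n) =
partialPairL S (∧² ∘ α) β` has a finite limit at `s → 1⁺`); **Props. 11 and 12 are theorems**
(`tendsto_partialPairL_wedgeTwo_of_not_selfDual`, `tendsto_partialPairL_wedgeTwo_of_not_selfTwist`: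
the central character of `σ` as a Hecke character, `AutomorphicRepData.exists_centralCharacter`, and,
for Prop. 12 with `ω_σ = 1`, the printed twisting trick `Π ↦ Π ⊗ θ`, `σ ↦ σ ⊗ θ⁻²`, `θ = ‖·‖^{it₀}`
with `θ⁴ ≠ 1`, under which the Euler product is unchanged). The earlier form
`…_of_kim_of_langlandsShahidi` takes Props. 11 and 12 themselves as hypotheses (`hP11`, `hP12`,
rendered as finite limits of `partialPairL S (∧² ∘ α) β` at `s → 1⁺` for unitary data under the
Satake-level negations of (α), (β)); the new form is that one fed with the two theorems. Finally
`…_of_kim_of_unitarySummands_of_LS` is the same assembly resting on the tree's NAMED fact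
`Kim2003_exteriorSquare_GL4` itself (Theorem A in its weak Satake rendering: existence of the lift
with an isobaric decomposition into cuspidal data), the printed word "(unitary)" of Theorem A entering
separately as the hypothesis `hU` (Kim, p. 139: "a cuspidal representation always means a unitary
one"; Thms. 4.2.3, 5.3.1; mechanism Prop. 4.1.6), stated universally over every Satake-level isobaric
decomposition of every weak lift (which the printed clause implies by Flath's uniqueness of Satake
parameters and Jacquet–Shalika's rigidity of isobaric sums, II Thm. 4.4). After that theorem the
fact rests on three named facts of the tree (`Kim2003_exteriorSquare_GL4`,
`JacquetShalika1981_partialPairL_boundary_repData`, `JacquetShalika1981_partialPairL_pole_repData`)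
and two printed statements the tree does not name — the unitarity clause `hU` and the
Langlands–Shahidi input `hLS`. **The last assembly, `…_of_kim_of_entireLS`, removes `hU`**: reading
Prop. 4 as printed ("`L(s, Σ, r₁)` is ENTIRE": finite limits of the Euler product at every
`Re z ≥ 1`, not only at `z = 1`; remark (4)) the extremal-slope device of `IsobaricRigidityRepData`
(Arthur–Clozel, proof of Thm. 4.2 (d); Kim, Prop. 4.1.6) runs on the NON-unitary cuspidal data of
the weak rendering `Kim2003_exteriorSquare_GL4` directly (`false_of_wedgeTwo_decomposition_of_maximal_slope`,
on `π` or on its contragredient `π̃` according to the degree of the summand of extremal real twist),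
so that the fact — and with it `Y` and `Z` — rests on the three named facts and ONE unnamed printed
input, the binder `hLS` of `…_of_kim_of_entireLS`. The other
ingredients, all proved here: the reduction to unitary `π`
(`…_of_unitary`, through `CuspidalAutomorphicRepData.exists_unitary_avatar`, Borel–Jacquet 5.7, and
the invariance lemmas `not_exists_cuspidal_wedgeTwo_of_shift`, `exists_selfDual_of_shift`,
`exists_selfTwist_of_shift`); step 1 of §4 ("a non-cuspidal `∧²Π` has a cuspidal summand of degree
`1`, `2` or `3`": `exists_degree_le_three_of_decomposition`,
`exists_summand_degree_le_three_of_not_exists_cuspidal_wedgeTwo`; data on `GL_0` carry the empty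
parameter and are discarded, a lone summand of degree `6` would carry `∧² t_{π,v}` itself); step 2,
the use of Thm. 3 ("a cuspidal summand `σ_{i₀}` of `ρ = ⊞ σᵢ` makes `L^S(s, ρ × σ̃_{i₀})` have a
pole at `s = 1`": `exists_tendsto_pow_mul_partialPairL_sum_dual`, `not_tendsto_partialPairL_sum_dual`,
on Satake families with UNITARY cuspidal families, adapting the bookkeeping of
`IsobaricRigidityRepData`; (2.1) is the theorem `JacquetShalika1981_multipliable_partialPairL_repData_holds`);
and the passage between the a.e. clauses and families off a finite set
(`exists_finite_families_wedgeTwo_eq_sum`, `sum_eq_sum_subtype_pos_of_card_eq`).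

Three remarks on the missing inputs. (1) The unitarity of ALL `σⱼ` in step 2 is essential: it is
part of Kim's Theorem A as printed ("`τᵢ` (unitary) cuspidal") but is not recorded by the tree's
rendering `Kim2003_exteriorSquare_GL4`, whose `σⱼ` are arbitrary cuspidal data `σⱼ⁰ ⊗ |det|^{sⱼ}`;
with unequal `Re sⱼ` the factors `L^S(s, σⱼ × σ̃ᵢ)`, `j ≠ i`, are met at the points `1 + sⱼ - sᵢ`
off the line `Re s = 1`, where (2.2)–(2.3) say nothing, and the device of `IsobaricRigidityRepData`
(take `Re sᵢ` maximal) does not rescue the argument because the other side,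
`L^S(s, Π ⊗ σ̃ᵢ, ∧² ⊗ ρ_m)`, is controlled by Props. 11–12 at `s = 1` only. Hence the shape of
`hKim`. In Kim's paper the unitarity (`r₁ = ⋯ = r_k = 0` in (4.1), p. 154) is Prop. 4.1.6 (p. 155),
whose proof uses Lemma 4.1.3 = [Ra2, Lemma 3.1] (the places with `|a_v| ≥ q_v^ε` have density zero),
the Jacquet–Shalika classification `S₀–S₃` of the unitary generic unramified `π_v`, [Ra2, Thm. A]
(temperedness of `GL₂`-forms on a set of lower density `≥ 9/10`), Prop. 3.7 (weak Ramanujan for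
`GL₂`, `GL₃`) and Prop. 3.9 (holomorphy of `L_S(s, π, ∧²ρ₄ ⊗ χ)` on `Re s > 1`); none of these is in
the tree, so the clause cannot be recovered here from `Kim2003_exteriorSquare_GL4` and the tree's
theorem `summable_normSq_trace_satakePow_holds` ((5.3.3) of Jacquet–Shalika I). (2) The one input
from the Langlands–Shahidi method is Prop. 4 ("`w₀(Σ) ≇ Σ ⇒ L(s, Σ, r₁)` is entire", a "standard
fact", loc. cit., for `M = GL(n) × GSpin(6) ⊂ G = GSpin(2n+6)`) with Prop. 5 (the action of `w₀`:
`w₀(σ ⊗ Π) = σ̃ ⊗ (Π̃ ⊗ ω_σ)` for `n` odd, `σ̃ ⊗ (Π ⊗ ω_σ)` for `n` even) and eq. (2) of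
§2.3 (`L(s, Σ, r₁) = L(s, σ ⊗ Π, ρ_n ⊗ ∧²ρ₄)`, "see [kim-jams]"); the tree has no automorphy
datum for `GSpin`, so `hLS` renders their conjunction on `GL(4) × GL(n)` alone: the partial Euler
product of `L^S(s, Π ⊗ σ, ∧² ⊗ ρ_n)` is the tree's `partialPairL S (wedgeTwoParams ∘ α) β`;
"`Π ≅ Π̃ ⊗ ω_σ`", resp. "`Π ≅ Π ⊗ ω_σ`", imply the Satake identities `{aᵢ⁻¹} = {ω_σ(ϖ_v)^{∓1} aᵢ}`,
resp. `{ω_σ(ϖ_v) aᵢ} = {aᵢ}`, a.e., with `ω_σ(ϖ_v) = ∏ t_{σ,v}` (Gelbart, "`ω_π(ϖ_v) = det t_{π,v}`";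
`AutomorphicRepData.exists_centralCharacter`; BOTH signs are excluded in the hypothesis for `n` odd,
so that no normalisation of `χ(ϖ_v)` versus `t_{π,v}` is relied upon); and "entire", for every
admissible `S`, gives the finite limit of the Euler product along `s → 1⁺`, the Euler product
agreeing with `L^S` on `Re s > 1` (there it is `∏ⱼ L^S(s, σⱼ × σ)`, `σⱼ` the unitary cuspidal
summands of `∧²Π`, Kim's Thm. A, absolutely convergent by Jacquet–Shalika I, Thm. 5.3). (3) The
hypotheses `hP11`, `hP12` of the earlier assembly are Props. 11–12 as printed, rendered the same way
under the Satake-level negations of (α), (β) (`t_{Π̃ ⊗ χ, v} = χ(ϖ_v) t_{Π,v}⁻¹`,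
`t_{Π ⊗ χ, v} = χ(ϖ_v) t_{Π,v}`); they follow from `hLS` by the two theorems named above. (4) Remark
(1) concerns the rendering of Props. 11–12 AT `s = 1`. Prop. 4 prints more: `L(s, Σ, r₁)` is
ENTIRE. Rendered on the Euler product exactly as in (2) but at every point `z` with `Re z ≥ 1`
(finite limit along `t ↦ z + t`, `t → 0⁺`; the identification of the Euler product with `L^S` on
`Re s > 1` is the same sentence of (2), so the provenance is unchanged: Prop. 4, Prop. 5, eq. (2),
Kim's Thm. A, Jacquet–Shalika I Thm. 5.3), the input controls `L^S(s, Π ⊗ σ̃ᵤ, ∧² ⊗ ρ_m)` at the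
shifted points `u₀ = 1 + s_{i₀}`, `Re u₀ ≥ 1`, met by the device when the `σⱼ = σⱼᵘ ⊗ |det|^{sⱼ}` of
the weak rendering are not unitary; the summand `σ_{i₀}` of maximal `Re sⱼ` is paired with `π` when
its degree is `≤ 3`, and otherwise (the maximiser is then the unique summand of degree `≥ 4`) the
summand of minimal `Re sⱼ`, of degree `≤ 2`, is paired with the contragredient `π̃`, whose
decomposition `∧²(α⁻¹) = ∑ⱼ q^{-sⱼ} γⱼ⁻¹` reverses the order of the real twists. This is
`…_of_kim_of_entireLS`; the unitarity clause of Kim's Theorem A is then not needed at all (as in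
Kim's own proof of it, Prop. 4.1.6, which is this device with his Prop. 3.9 as the finiteness side).

## References

* [AsgariRaghuram2007] M. Asgari, A. Raghuram, arXiv:0712.4315 = Clay Math. Proc. 13 (2011)
  33–53: Theorem 1 (i) ⇒ (iii) (p. 3), §4 Props. 11–12 (p. 10).
* D. Flath, *Decomposition of representations into tensor products*, Corvallis 1979, Thm. 3.
  [FlathCorvallis1979]
* A. Borel, H. Jacquet, *Automorphic forms and automorphic representations*, Corvallis 1979,
  §4.6. [BorelJacquetCorvallis1979]
* J. W. S. Cassels, A. Fröhlich (eds.), *Algebraic Number Theory* (1967), Ch. VII §4, Prop. 4.1.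
  [CasselsFrohlichANT1967]
* J. Arthur, L. Clozel, *Simple algebras, base change, and the advanced theory of the trace
  formula*, Ann. of Math. Stud. 120 (1989), Ch. 3 §2, (2.1)–(2.3), p. 171. [ArthurClozelAMS120]
* H. Jacquet, J. A. Shalika, *On Euler products and the classification of automorphic forms II*,
  Amer. J. Math. 103 (1981), 777–815, Prop. 3.6, Thm. 4.4. [JacquetShalikaAJM1981II]
* H. H. Kim, *Functoriality for the exterior square of GL₄ and the symmetric fourth of GL₂*,
  J. Amer. Math. Soc. 16 (2003), 139–183, Theorem A (p. 139), (4.1) and Lemma 4.1.3 (p. 154),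
  Lemma 4.1.5, Prop. 4.1.6 (p. 155), Props. 3.7, 3.9. [Kim2002]
* D. Ramakrishnan, *On the coefficients of cusp forms*, Math. Res. Lett. 4 (1997), 295–307,
  Lemma 3.1, Thm. A (Kim's [Ra2]).
* M. Asgari, F. Shahidi, *Generic transfer for general spin groups*, Duke Math. J. 132 (2006),
  137–190 (the structure of `GSpin(2n+6) ⊃ GL(n) × GSpin(6)` used in §2.2–2.3 of the paper, cited
  there as [asgari-shahidi-duke]).
-/

noncomputable section

open scoped Classical MatrixGroups Topology
open IsDedekindDomain NumberField Filter

namespace Literature.NumberTheory.Automorphic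

open Literature.NumberTheory.GaloisRepresentations

/-! ### Values of Hecke characters at the chosen uniformizers -/

section HeckeValues

variable {F : Type} [Field F] [NumberField F]

/-- `χ(ϖ_v)` is the value of `χ` at the local idèle of the chosen uniformizer (unfolding of
`HeckeCharacter.valueAtUniformizer`, `HeckeCharacter.localComponent_apply`). [folklore] -/
private theorem valueAtUniformizer_eq_coe_apply (χ : HeckeCharacter F)
    (v : HeightOneSpectrum (𝓞 F)) :
    χ.valueAtUniformizer v = ((χ (localUnits v (HeckeCharacter.uniformizer F v)) : ℂˣ) : ℂ) :=
  rfl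

/-- The trivial Hecke character has value `1` at every uniformizer. [folklore] -/
private theorem valueAtUniformizer_one_eq (v : HeightOneSpectrum (𝓞 F)) :
    (1 : HeckeCharacter F).valueAtUniformizer v = 1 := by
  rw [valueAtUniformizer_eq_coe_apply]
  rfl

/-- `χ⁻¹(ϖ_v) = χ(ϖ_v)⁻¹`. [folklore] -/
private theorem valueAtUniformizer_inv_eq (χ : HeckeCharacter F) (v : HeightOneSpectrum (𝓞 F)) :
    χ⁻¹.valueAtUniformizer v = (χ.valueAtUniformizer v)⁻¹ := by
  rw [valueAtUniformizer_eq_coe_apply, valueAtUniformizer_eq_coe_apply, HeckeCharacter.inv_apply,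
    Units.val_inv_eq_inv_val]

/-- `χ(ϖ_v) ≠ 0` (a unit of `ℂ`). [folklore] -/
private theorem valueAtUniformizer_ne_zero' (χ : HeckeCharacter F) (v : HeightOneSpectrum (𝓞 F)) :
    χ.valueAtUniformizer v ≠ 0 := by
  rw [valueAtUniformizer_eq_coe_apply]
  exact Units.ne_zero _

end HeckeValues

/-! ### Multiset algebra: essential self-duality in the two spellings -/

section Multisets

/-- If `{αᵢ} = {c αᵢ⁻¹}` then `{αᵢ⁻¹} = {c⁻¹ αᵢ}` (invert entrywise). [folklore] -/
private theorem map_inv_eq_map_mul_of_eq_map_mul_inv {α : Multiset ℂ} {c : ℂ}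
    (h : α = α.map fun z => c * z⁻¹) :
    α.map (fun a => a⁻¹) = α.map (fun a => c⁻¹ * a) := by
  conv_lhs => rw [h]
  rw [Multiset.map_map]
  refine Multiset.map_congr rfl fun z _ => ?_
  show (c * z⁻¹)⁻¹ = c⁻¹ * z
  rw [mul_inv, inv_inv]

/-- If `{αᵢ⁻¹} = {c αᵢ}` with `c ≠ 0` then `{c⁻¹ αᵢ⁻¹} = {αᵢ}` (multiply entrywise by `c⁻¹`).
[folklore] -/
private theorem map_mul_inv_eq_self_of_map_inv_eq_map_mul {α : Multiset ℂ} {c : ℂ} (hc : c ≠ 0)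
    (h : α.map (fun a => a⁻¹) = α.map (fun a => c * a)) :
    α.map (fun z => c⁻¹ * z⁻¹) = α := by
  have h' := congrArg (Multiset.map fun a : ℂ => c⁻¹ * a) h
  simp only [Multiset.map_map, Function.comp_def] at h'
  rw [h']
  conv_rhs => rw [← Multiset.map_id α]
  refine Multiset.map_congr rfl fun z _ => ?_
  show c⁻¹ * (c * z) = z
  rw [← mul_assoc, inv_mul_cancel₀ hc, one_mul]

end Multisets

/-! ### `GL(1)`: Hecke characters as cuspidal data and back -/

section GLOne

variable {F : Type} [Field F] [NumberField F]

/-- **A Hecke character as a cuspidal datum on `GL(1, 𝔸_F)`** with Satake parameter `{χ(ϖ_v)}`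
at almost every finite place: the line `ℂ · (χ ∘ det)` over `⊥`
(`exists_automorphicRepData_detTwist_glOne`; on `GL(1)` the parabolic cusp condition is empty),
with the Satake parameters of `AutomorphicRepData.hasSatakeParamAt_detTwist_glOne` off a level
of `χ` (`HeckeCharacter.exists_level_glOne`). Borel–Jacquet 1979, 4.6 (automorphic
representations of `GL(1)` are the idèle class characters). [cite: BorelJacquetCorvallis1979, §4.6] -/
theorem exists_cuspidal_glOne_eventually_hasSatakeParamAt_valueAtUniformizer
    (h1 : isCompact_glFiniteIntegralLevel 1 F) (χ : HeckeCharacter F) :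
    ∃ η : CuspidalAutomorphicRepData 1 F h1,
      ∀ᶠ v : HeightOneSpectrum (𝓞 F) in cofinite,
        η.1.HasSatakeParamAt v {χ.valueAtUniformizer v} := by
  obtain ⟨τ, hW, hW'⟩ := exists_automorphicRepData_detTwist_glOne h1 χ
  have hcusp : τ.W ≤ cuspFormsGL 1 F h1 := by
    rw [hW, Submodule.span_le]
    rintro _ rfl
    exact IsCuspFormGL.mem_cuspFormsGL
      ⟨isAutomorphicForm_detTwist_glOne h1 χ, fun k hk hk1 => absurd hk1 (by omega)⟩
  refine ⟨⟨τ, hcusp⟩, ?_⟩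
  obtain ⟨𝔪, h𝔪, hχ𝔪⟩ := HeckeCharacter.exists_level_glOne χ
  filter_upwards [(Ideal.finite_factors h𝔪).compl_mem_cofinite] with v hv
  have h := AutomorphicRepData.hasSatakeParamAt_detTwist_glOne h1 hW hW' h𝔪 hχ𝔪 v hv
    (HeckeCharacter.valued_uniformizer (K := F) v)
  rwa [← valueAtUniformizer_eq_coe_apply] at h

/-- **The Hecke character of a datum on `GL(1, 𝔸_F)` gives its Satake parameters almost
everywhere**: for every automorphic representation datum `η` of `GL(1, 𝔸_F)` there is a Hecke
character `χ` with `t_{η,v} = {χ(ϖ_v)}` at all but finitely many `v`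
(`AutomorphicRepData.exists_heckeCharacter_glOne`, `AutomorphicRepData.eventually_hasSatakeParamAt_glOne`
at the chosen uniformizer). Gelbart 1975, §2.A; Borel–Jacquet 1979, 4.6. [cite: Gelbart1975, §2.A] -/
theorem AutomorphicRepData.exists_heckeCharacter_eventually_hasSatakeParamAt_glOne
    {h1 : isCompact_glFiniteIntegralLevel 1 F} (η : AutomorphicRepData (AutomorphyDatum.gl 1 F h1)) :
    ∃ χ : HeckeCharacter F,
      ∀ᶠ v : HeightOneSpectrum (𝓞 F) in cofinite, η.HasSatakeParamAt v {χ.valueAtUniformizer v} := by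
  obtain ⟨χ, hχ⟩ := η.exists_heckeCharacter_glOne
  refine ⟨χ, ?_⟩
  filter_upwards [η.eventually_hasSatakeParamAt_glOne hχ] with v hv
  rw [valueAtUniformizer_eq_coe_apply]
  exact hv _ (HeckeCharacter.valued_uniformizer (K := F) v)

/-- A datum on `GL(1, 𝔸_F)` with Satake parameter `{χ(ϖ_v)}` almost everywhere and `{1}` almost
everywhere has `χ = 1` (uniqueness of Satake parameters and rigidity of Hecke characters,
`HeckeCharacter.ext_of_eventually_valueAtUniformizer_eq`). Cassels–Fröhlich VII, Prop. 4.1.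
[cite: CasselsFrohlichANT1967, Ch. VII §4 Prop. 4.1] -/
theorem AutomorphicRepData.heckeCharacter_eq_one_of_eventually_hasSatakeParamAt_one_glOne
    {h1 : isCompact_glFiniteIntegralLevel 1 F} {η : AutomorphicRepData (AutomorphyDatum.gl 1 F h1)}
    {χ : HeckeCharacter F}
    (hχ : ∀ᶠ v : HeightOneSpectrum (𝓞 F) in cofinite, η.HasSatakeParamAt v {χ.valueAtUniformizer v})
    (h1v : ∀ᶠ v : HeightOneSpectrum (𝓞 F) in cofinite, η.HasSatakeParamAt v {1}) : χ = 1 := by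
  refine HeckeCharacter.ext_of_eventually_valueAtUniformizer_eq ?_
  filter_upwards [hχ, h1v] with v ha hb
  have h := AutomorphicRepData.hasSatakeParamAt_unique_holds η ha hb
  rw [Multiset.singleton_inj] at h
  rw [h, valueAtUniformizer_one_eq]

end GLOne

/-! ### The three renderings are equivalent -/

section Equivalences

/-- **Hecke-character rendering ⇔ `GL(1)`-datum rendering.** The named facts
`AsgariRaghuram2007_selfDual_or_selfTwist_of_wedgeTwo_not_cuspidal` (this topic, conclusions via
`χ(ϖ_v)`) and `AsgariRaghuram2007_notCuspidal_wedgeTwo_imp` (conclusions via a cuspidal datum on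
`GL(1, 𝔸_F)` and its Satake parameters) — two Satake-level transcriptions of Asgari–Raghuram
2007, Theorem 1 (i) ⇒ (iii) — are equivalent, through the proved rank-one dictionary
(`exists_cuspidal_glOne_eventually_hasSatakeParamAt_valueAtUniformizer`,
`AutomorphicRepData.exists_heckeCharacter_eventually_hasSatakeParamAt_glOne`), uniqueness of
Satake parameters (`AutomorphicRepData.hasSatakeParamAt_unique_holds`), rigidity of Hecke
characters, and `isCompact_glFiniteIntegralLevel_holds` for the binder shapes.
[cite: AsgariRaghuram2007, Theorem 1 (i) ⇒ (iii); §4, Props. 11–12] -/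
theorem AsgariRaghuram2007_selfDual_or_selfTwist_of_wedgeTwo_not_cuspidal_iff_notCuspidal_wedgeTwo_imp :
    AsgariRaghuram2007_selfDual_or_selfTwist_of_wedgeTwo_not_cuspidal ↔
      AsgariRaghuram2007_notCuspidal_wedgeTwo_imp := by
  constructor
  · intro h F _ _ h1 h4 h6 π hP
    -- pass to the binder shape `hF : ∀ m, …` (proof irrelevance: `hF 4 = h4`, `hF 6 = h6`)
    have hF : ∀ m : ℕ, isCompact_glFiniteIntegralLevel m F :=
      fun m => isCompact_glFiniteIntegralLevel_holds m F
    rcases h F hF π hP with ⟨χ, hχ⟩ | ⟨χ, hχ1, hχ⟩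
    · left
      obtain ⟨η, hη⟩ := exists_cuspidal_glOne_eventually_hasSatakeParamAt_valueAtUniformizer h1 χ
      refine ⟨η, ?_⟩
      filter_upwards [hχ, hη] with v hv hηv α hα
      exact ⟨χ.valueAtUniformizer v, hηv, hv α hα⟩
    · right
      obtain ⟨η, hη⟩ := exists_cuspidal_glOne_eventually_hasSatakeParamAt_valueAtUniformizer h1 χ
      refine ⟨η, fun h1v => hχ1 ?_, ?_⟩
      · exact AutomorphicRepData.heckeCharacter_eq_one_of_eventually_hasSatakeParamAt_one_glOne hη h1v
      · filter_upwards [hχ, hη] with v hv hηv α hα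
        exact ⟨χ.valueAtUniformizer v, hηv, hv α hα⟩
  · intro h F _ _ hF π hS
    rcases h F (hF 1) (hF 4) (hF 6) π hS with ⟨η, hη⟩ | ⟨ξ, hξ1, hξ⟩
    · left
      obtain ⟨χ, hχ⟩ := η.1.exists_heckeCharacter_eventually_hasSatakeParamAt_glOne
      refine ⟨χ, ?_⟩
      filter_upwards [hη, hχ] with v hv hχv α hα
      obtain ⟨e, he, heq⟩ := hv α hα
      have h1 := AutomorphicRepData.hasSatakeParamAt_unique_holds η.1 he hχv
      rw [Multiset.singleton_inj] at h1
      rwa [h1] at heq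
    · right
      obtain ⟨χ, hχ⟩ := ξ.1.exists_heckeCharacter_eventually_hasSatakeParamAt_glOne
      refine ⟨χ, ?_, ?_⟩
      · rintro rfl
        refine hξ1 ?_
        filter_upwards [hχ] with v hv
        rwa [valueAtUniformizer_one_eq] at hv
      · filter_upwards [hξ, hχ] with v hv hχv α hα
        obtain ⟨e, he, heq⟩ := hv α hα
        have h1 := AutomorphicRepData.hasSatakeParamAt_unique_holds ξ.1 he hχv
        rw [Multiset.singleton_inj] at h1
        rwa [h1] at heq

/-- **Hecke-character rendering ⇔ `HasSatakeParamAt`-transport rendering.** The named facts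
`AsgariRaghuram2007_selfDual_or_selfTwist_of_wedgeTwo_not_cuspidal` (conclusions as multiset
identities `{αᵢ⁻¹} = {χ(ϖ_v) αᵢ}`, `{χ(ϖ_v) αᵢ} = {αᵢ}`) and
`AsgariRaghuram_wedgeTwo_notCuspidal_GL4` (conclusions "`π` has Satake parameter
`{χ(ϖ_v) αᵢ⁻¹}` at `v`", `IsSatakeSelfTwist π`) are equivalent, by uniqueness of Satake
parameters (`AutomorphicRepData.hasSatakeParamAt_unique_holds`), the character of the one
rendering being the inverse of the character of the other in clause (α).
[cite: AsgariRaghuram2007, Theorem 1 (i) ⇒ (iii); §4, Props. 11–12] -/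
theorem AsgariRaghuram2007_selfDual_or_selfTwist_of_wedgeTwo_not_cuspidal_iff_wedgeTwo_notCuspidal_GL4 :
    AsgariRaghuram2007_selfDual_or_selfTwist_of_wedgeTwo_not_cuspidal ↔
      AsgariRaghuram_wedgeTwo_notCuspidal_GL4 := by
  constructor
  · intro h F _ _ hF π hS
    rcases h F hF π hS with ⟨χ, hχ⟩ | ⟨χ, hχ1, hχ⟩
    · left
      refine ⟨χ⁻¹, ?_⟩
      filter_upwards [hχ] with v hv α hα
      rw [valueAtUniformizer_inv_eq,
        map_mul_inv_eq_self_of_map_inv_eq_map_mul (valueAtUniformizer_ne_zero' χ v) (hv α hα)]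
      exact hα
    · right
      refine ⟨χ, hχ1, ?_⟩
      rw [isSatakeTwistBy_iff]
      filter_upwards [hχ] with v hv α hα
      rw [hv α hα]
      exact hα
  · intro h F _ _ hF π hS
    rcases h F hF π hS with ⟨χ, hχ⟩ | ⟨δ, hδ1, hδ⟩
    · left
      refine ⟨χ⁻¹, ?_⟩
      filter_upwards [hχ] with v hv α hα
      rw [valueAtUniformizer_inv_eq]
      exact map_inv_eq_map_mul_of_eq_map_mul_inv
        (AutomorphicRepData.hasSatakeParamAt_unique_holds π.1 hα (hv α hα))
    · right
      refine ⟨δ, hδ1, ?_⟩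
      rw [isSatakeTwistBy_iff] at hδ
      filter_upwards [hδ] with v hv α hα
      exact (AutomorphicRepData.hasSatakeParamAt_unique_holds π.1 hα (hv α hα)).symm

/-- **Transfer of a discharge, I.** A proof of the `GL(1)`-datum rendering
`AsgariRaghuram2007_notCuspidal_wedgeTwo_imp` proves this topic's fact.
[cite: AsgariRaghuram2007, Theorem 1 (i) ⇒ (iii)] -/
theorem AsgariRaghuram2007_selfDual_or_selfTwist_of_wedgeTwo_not_cuspidal_of_notCuspidal_wedgeTwo_imp
    (h : AsgariRaghuram2007_notCuspidal_wedgeTwo_imp) :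
    AsgariRaghuram2007_selfDual_or_selfTwist_of_wedgeTwo_not_cuspidal :=
  AsgariRaghuram2007_selfDual_or_selfTwist_of_wedgeTwo_not_cuspidal_iff_notCuspidal_wedgeTwo_imp.mpr h

/-- **Transfer of a discharge, II.** A proof of the transport rendering
`AsgariRaghuram_wedgeTwo_notCuspidal_GL4` proves this topic's fact.
[cite: AsgariRaghuram2007, Theorem 1 (i) ⇒ (iii)] -/
theorem AsgariRaghuram2007_selfDual_or_selfTwist_of_wedgeTwo_not_cuspidal_of_wedgeTwo_notCuspidal_GL4
    (h : AsgariRaghuram_wedgeTwo_notCuspidal_GL4) :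
    AsgariRaghuram2007_selfDual_or_selfTwist_of_wedgeTwo_not_cuspidal :=
  AsgariRaghuram2007_selfDual_or_selfTwist_of_wedgeTwo_not_cuspidal_iff_wedgeTwo_notCuspidal_GL4.mpr h

/-- **The other two renderings agree with each other** (through this topic's fact).
[cite: AsgariRaghuram2007, Theorem 1 (i) ⇒ (iii)] -/
theorem AsgariRaghuram2007_notCuspidal_wedgeTwo_imp_iff_wedgeTwo_notCuspidal_GL4 :
    AsgariRaghuram2007_notCuspidal_wedgeTwo_imp ↔ AsgariRaghuram_wedgeTwo_notCuspidal_GL4 :=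
  AsgariRaghuram2007_selfDual_or_selfTwist_of_wedgeTwo_not_cuspidal_iff_notCuspidal_wedgeTwo_imp.symm.trans
    AsgariRaghuram2007_selfDual_or_selfTwist_of_wedgeTwo_not_cuspidal_iff_wedgeTwo_notCuspidal_GL4

end Equivalences

/-! ### First step of the printed proof of (i) ⇒ (iii): a cuspidal summand of degree `1`, `2` or `3` -/

section Summand

variable {F : Type} [Field F] [NumberField F]

/-- Transport of a cuspidal datum along an equality of ranks, together with its Satake parameters
(`subst`). [folklore] -/
private theorem exists_cuspidal_eq_rank_hasSatakeParamAt_iff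
    (hF : ∀ m : ℕ, isCompact_glFiniteIntegralLevel m F) {n n' : ℕ} (h : n = n')
    (σ : CuspidalAutomorphicRepData n F (hF n)) :
    ∃ σ' : CuspidalAutomorphicRepData n' F (hF n'),
      ∀ (v : HeightOneSpectrum (𝓞 F)) (β : Multiset ℂ),
        σ'.1.HasSatakeParamAt v β ↔ σ.1.HasSatakeParamAt v β := by
  subst h
  exact ⟨σ, fun _ _ => Iff.rfl⟩

/-- If natural numbers indexed by a finite type are each `0` or `≥ 4` and add up to `6`, then one of
them is `6` and the others are `0`. [folklore] -/
private theorem exists_eq_six_of_sum_eq_six {k : ℕ} {m : Fin k → ℕ} (hsum : ∑ i, m i = 6)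
    (h04 : ∀ i, m i = 0 ∨ 4 ≤ m i) : ∃ j, m j = 6 ∧ ∀ i, i ≠ j → m i = 0 := by
  have hj : ∃ j, m j ≠ 0 := by
    by_contra h
    push Not at h
    have h0 : ∑ i, m i = 0 := Finset.sum_eq_zero fun i _ => h i
    omega
  obtain ⟨j, hj⟩ := hj
  have hj4 : 4 ≤ m j := (h04 j).resolve_left hj
  have hothers : ∀ i, i ≠ j → m i = 0 := by
    intro i hij
    rcases h04 i with h | h
    · exact h
    · exfalso
      have hle : m i + m j ≤ ∑ l, m l :=
        Finset.add_le_sum (fun l _ => Nat.zero_le (m l)) (Finset.mem_univ i) (Finset.mem_univ j) hij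
      omega
  refine ⟨j, ?_, hothers⟩
  have hsingle : ∑ i, m i = m j :=
    Finset.sum_eq_single j (fun i _ hij => hothers i hij) (fun h => absurd (Finset.mem_univ j) h)
  omega

/-- **Step 1 on given data.** For a weak exterior square `P` of `π` with an isobaric clause
`σ₁, …, σ_k` (`∑ mᵢ = 6`) as in `Kim2003_exteriorSquare_GL4` — but GIVEN, so that the lemma applies
verbatim to any refinement of Kim's fact (e.g. one recording the unitarity of the `σᵢ`) — the
hypothesis "no cuspidal datum on `GL(6)` carries `∧² t_{π,v}` a.e." forces a summand of degree
`1 ≤ mᵢ ≤ 3` (proof in the docstring of `exists_summand_degree_le_three_of_not_exists_cuspidal_wedgeTwo`,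
which is the same statement fed with the fact `Kim2003_exteriorSquare_GL4`).
[cite: AsgariRaghuram2007, §4, proof of (i) ⇒ (iii), first paragraph (p. 10)] -/
theorem exists_degree_le_three_of_decomposition
    (hF : ∀ m : ℕ, isCompact_glFiniteIntegralLevel m F)
    {π : CuspidalAutomorphicRepData 4 F (hF 4)}
    {P : AutomorphicRepData (AutomorphyDatum.gl 6 F (hF 6))} {k : ℕ} {m : Fin k → ℕ}
    (σ : ∀ i : Fin k, CuspidalAutomorphicRepData (m i) F (hF (m i)))
    (hP : ∀ᶠ v : HeightOneSpectrum (𝓞 F) in cofinite, ∀ α : Multiset ℂ,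
      π.1.HasSatakeParamAt v α → P.HasSatakeParamAt v (wedgeTwoParams α))
    (hsum : ∑ i, m i = 6)
    (hdec : ∀ᶠ v : HeightOneSpectrum (𝓞 F) in cofinite, ∀ β : Fin k → Multiset ℂ,
      (∀ i, (σ i).1.HasSatakeParamAt v (β i)) → P.HasSatakeParamAt v (∑ i, β i))
    (hno : ¬ ∃ S : CuspidalAutomorphicRepData 6 F (hF 6),
        ∀ᶠ v : HeightOneSpectrum (𝓞 F) in cofinite, ∀ α : Multiset ℂ,
          π.1.HasSatakeParamAt v α → S.1.HasSatakeParamAt v (wedgeTwoParams α)) :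
    ∃ i : Fin k, 1 ≤ m i ∧ m i ≤ 3 := by
  by_contra hcon
  push Not at hcon
  have h04 : ∀ i, m i = 0 ∨ 4 ≤ m i := fun i => by
    rcases Nat.eq_zero_or_pos (m i) with h | h
    · exact Or.inl h
    · exact Or.inr (hcon i h)
  obtain ⟨j, hj6, hothers⟩ := exists_eq_six_of_sum_eq_six hsum h04
  obtain ⟨S, hS⟩ := exists_cuspidal_eq_rank_hasSatakeParamAt_iff hF hj6 (σ j)
  refine hno ⟨S, ?_⟩
  have hcof : ∀ᶠ v : HeightOneSpectrum (𝓞 F) in cofinite, ∀ i, (σ i).1.IsUnramifiedAt v :=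
    Filter.eventually_all.mpr fun i => AutomorphicRepData.hasSatakeParamAt_cofinite_holds (σ i).1
  filter_upwards [hP, hdec, hcof] with v hPv hdecv hcofv α hα
  choose β hβ using hcofv
  have hsumβ : ∑ i, β i = β j := by
    refine Finset.sum_eq_single j (fun i _ hij => ?_) (fun h => absurd (Finset.mem_univ j) h)
    have hcard := (hβ i).card_eq
    rw [hothers i hij] at hcard
    exact Multiset.card_eq_zero.mp hcard
  have hPβ : P.HasSatakeParamAt v (β j) := hsumβ ▸ hdecv β hβ
  have heq : β j = wedgeTwoParams α :=
    AutomorphicRepData.hasSatakeParamAt_unique_holds P hPβ (hPv α hα)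
  rw [hS]
  exact heq ▸ hβ j

/-- **Asgari–Raghuram 2007, §4, proof of (i) ⇒ (iii), first step, on Kim's isobaric clause.**
"Observe that if an isobaric automorphic representation `ρ` of `GL(6, 𝔸_F)` is not cuspidal, then
it must have an isobaric summand of degree `1`, `2`, or `3`" (p. 10 of the arXiv text), applied to
`ρ = ∧²Π`. In the tree's vocabulary: granted Kim's theorem in the form `Kim2003_exteriorSquare_GL4`
(a weak exterior square `P` of `π` on `GL(6, 𝔸_F)` and cuspidal `σᵢ` on `GL_{mᵢ}(𝔸_F)`,
`∑ mᵢ = 6`, whose Satake parameters add up to those of `P` at almost every place), the hypothesis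
of `AsgariRaghuram2007_selfDual_or_selfTwist_of_wedgeTwo_not_cuspidal` — no cuspidal datum on
`GL(6, 𝔸_F)` carries `∧² t_{π,v}` at almost every `v` — forces a summand of degree
`1 ≤ mᵢ ≤ 3`. Indeed otherwise every `mᵢ` is `0` or `≥ 4`, so one `m_j` is `6` and the others are
`0` (`exists_eq_six_of_sum_eq_six`); data on `GL_0` have the empty Satake parameter
(`HasSatakeParamAt.card_eq`), every `σᵢ` is unramified at almost every place
(`AutomorphicRepData.hasSatakeParamAt_cofinite_holds`, finitely many `i`), hence
`t_{P,v} = t_{σ_j,v}` a.e., and by uniqueness of the parameters of `P`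
(`AutomorphicRepData.hasSatakeParamAt_unique_holds`) the datum `σ_j`, transported to rank `6`,
carries `∧² t_{π,v}` a.e. — a contradiction. (Kim's theorem enters as the hypothesis `hK`; it is
the unproved named fact of `KimExteriorSquareGL4`.)
[cite: AsgariRaghuram2007, §4, proof of (i) ⇒ (iii), first paragraph (p. 10)] -/
theorem exists_summand_degree_le_three_of_not_exists_cuspidal_wedgeTwo
    (hK : Kim2003_exteriorSquare_GL4)
    (F : Type) [Field F] [NumberField F] (hF : ∀ m : ℕ, isCompact_glFiniteIntegralLevel m F)
    (π : CuspidalAutomorphicRepData 4 F (hF 4))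
    (hno : ¬ ∃ S : CuspidalAutomorphicRepData 6 F (hF 6),
        ∀ᶠ v : HeightOneSpectrum (𝓞 F) in cofinite, ∀ α : Multiset ℂ,
          π.1.HasSatakeParamAt v α → S.1.HasSatakeParamAt v (wedgeTwoParams α)) :
    ∃ (P : AutomorphicRepData (AutomorphyDatum.gl 6 F (hF 6))) (k : ℕ) (m : Fin k → ℕ)
      (σ : ∀ i : Fin k, CuspidalAutomorphicRepData (m i) F (hF (m i))),
      (∀ᶠ v : HeightOneSpectrum (𝓞 F) in cofinite, ∀ α : Multiset ℂ,
          π.1.HasSatakeParamAt v α → P.HasSatakeParamAt v (wedgeTwoParams α)) ∧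
      (∑ i, m i = 6) ∧
      (∀ᶠ v : HeightOneSpectrum (𝓞 F) in cofinite, ∀ β : Fin k → Multiset ℂ,
          (∀ i, (σ i).1.HasSatakeParamAt v (β i)) → P.HasSatakeParamAt v (∑ i, β i)) ∧
      ∃ i : Fin k, 1 ≤ m i ∧ m i ≤ 3 := by
  obtain ⟨P, hP, k, m, σ, hsum, hdec⟩ := hK F hF π
  exact ⟨P, k, m, σ, hP, hsum, hdec, exists_degree_le_three_of_decomposition hF σ hP hsum hdec hno⟩

end Summand

/-! ### Second step of the printed proof: a cuspidal summand gives a pole at `s = 1` (Thm. 3) -/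

section SummandPole

variable {K : Type} [Field K] [NumberField K]

/-- **A cuspidal isobaric summand produces a pole of the Rankin–Selberg `L`-function at `s = 1`**
— the use of Thm. 3 (Jacquet, Piatetski-Shapiro, Shalika) in §4, p. 10: "there exists a cuspidal
representation `σ` of `GL(n, 𝔸_F)` … such that `L^S(s, ρ × σ)` has a pole at `s = 1`", for
`ρ = σ₁ ⊞ ⋯ ⊞ σ_k` and `σ = σ̃_{i₀}`, in the tree's vocabulary and granted Arthur–Clozel (2.2)–(2.3)
for Borel–Jacquet data (the named facts `JacquetShalika1981_partialPairL_boundary_repData`,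
`JacquetShalika1981_partialPairL_pole_repData`, hypotheses `hJSb`, `hJSp`). Let `σᵢ` (`i : ι`,
finite) be cuspidal data on `GL_{mᵢ}(𝔸_K)`, `mᵢ ≥ 1`, `i₀ : ι`, and `τ` a cuspidal datum on
`GL_{m_{i₀}}(𝔸_K)` (the contragredient of `σ_{i₀}`: `CuspidalAutomorphicRepData.exists_contragredient_satake_holds`).
There is a finite `S₀` such that for every finite `S ⊇ S₀`, all UNITARY Satake families `βᵢ` of the
`σᵢ` off `S` (`‖∏ βᵢ(w)‖ = 1`), `τ` carrying `β_{i₀}(w)⁻¹` off `S`, and every family `A` with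
`A(w) = ∑ᵢ βᵢ(w)` off `S` (the Hecke matrices of `ρ`), some `t^E · L^S(1 + t, A ⊗ β_{i₀}⁻¹)` with
`E ≥ 1` has a finite NON-ZERO limit as `t → 0⁺`; in particular `L^S(s, ρ × σ̃_{i₀})` has no finite
limit at `s = 1` (`not_tendsto_partialPairL_sum_dual`). Proof: `L^S(s, A ⊗ β_{i₀}⁻¹) =
∏ᵢ L^S(s, βᵢ ⊗ β_{i₀}⁻¹)` for `Re s > 1` (`satakePairPolynomial_sum_left` and (2.1),
`JacquetShalika1981_multipliable_partialPairL_repData_holds`); the factor `i₀` has a simple pole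
(`exists_tendsto_ofReal_mul_partialPairL_dual`, (2.3)), every factor has a finite non-zero limit
after multiplication by some `t^{eᵢ}` (`exists_tendsto_pow_mul_partialPairL_ofReal_add`,
(2.2)–(2.3) at `s = 1`), and the limits multiply (the bookkeeping of `IsobaricRigidityRepData`, in
the unitary case). The unitarity of ALL `βᵢ` is essential (module docstring, remark (1)).
[cite: AsgariRaghuram2007, §2.1 Thm. 3 and §4 (p. 10)] [cite: ArthurClozelAMS120, Ch. 3 §2 (2.1)–(2.3)] -/
theorem exists_tendsto_pow_mul_partialPairL_sum_dual
    (hJSb : JacquetShalika1981_partialPairL_boundary_repData)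
    (hJSp : JacquetShalika1981_partialPairL_pole_repData)
    {ι : Type*} [Fintype ι] {m : ι → ℕ} {hm : ∀ i, isCompact_glFiniteIntegralLevel (m i) K}
    (σ : ∀ i, CuspidalAutomorphicRepData (m i) K (hm i)) (hm0 : ∀ i, 0 < m i) (i₀ : ι)
    (τ : CuspidalAutomorphicRepData (m i₀) K (hm i₀)) :
    ∃ S₀ : Set (HeightOneSpectrum (𝓞 K)), S₀.Finite ∧
      ∀ {S : Set (HeightOneSpectrum (𝓞 K))} (_hS : S.Finite) (_hS₀ : S₀ ⊆ S)
        {β : ι → SatakeFamily K} {A : SatakeFamily K}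
        (_hβ : ∀ i, ∀ w ∉ S, (σ i).1.HasSatakeParamAt w (β i w))
        (_hu : ∀ i, ∀ w ∉ S, ‖(β i w).prod‖ = 1)
        (_hτ : ∀ w ∉ S, τ.1.HasSatakeParamAt w ((β i₀ w).map (·⁻¹)))
        (_hA : ∀ w ∉ S, A w = ∑ i, β i w),
        ∃ (E : ℕ) (c : ℂ), 1 ≤ E ∧ c ≠ 0 ∧
          Tendsto (fun t : ℝ => (t : ℂ) ^ E *
              partialPairL S A (fun w => (β i₀ w).map (·⁻¹)) (1 + t))
            (𝓝[>] (0 : ℝ)) (𝓝 c) := by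
  -- Step 1: a finite set absorbing every `S₀` of the analytic inputs for the pairs `(σ i, τ)`
  have hfacS : ∀ i, ∃ S₀ : Set (HeightOneSpectrum (𝓞 K)), S₀.Finite ∧
      ∀ {S' : Set (HeightOneSpectrum (𝓞 K))} (_hS : S'.Finite) (_hS₀ : S₀ ⊆ S')
        {α' β' : SatakeFamily K} (_hα : ∀ w ∉ S', (σ i).1.HasSatakeParamAt w (α' w))
        (_hβ : ∀ w ∉ S', τ.1.HasSatakeParamAt w (β' w))
        (_hu : ∀ w ∉ S', ‖(α' w).prod‖ = 1) (_hu' : ∀ w ∉ S', ‖(β' w).prod‖ = 1)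
        {z : ℂ} (_hz : 1 ≤ z.re),
        ∃ (e : ℕ) (c : ℂ), c ≠ 0 ∧ (m i ≠ m i₀ → e = 0) ∧
          Tendsto (fun t : ℝ => (t : ℂ) ^ e * partialPairL S' α' β' (z + t)) (𝓝[>] (0 : ℝ))
            (𝓝 c) := fun i =>
    exists_tendsto_pow_mul_partialPairL_ofReal_add hJSb hJSp (hm0 i) (hm0 i₀) (σ i) τ
  choose SA hSAfin hSA using hfacS
  obtain ⟨SB, hSBfin, hSB⟩ := exists_tendsto_ofReal_mul_partialPairL_dual hJSp (hm0 i₀) (σ i₀) τ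
  have h21 : ∀ i, ∃ S₀ : Set (HeightOneSpectrum (𝓞 K)), S₀.Finite ∧
      ∀ {S' : Set (HeightOneSpectrum (𝓞 K))} (_hS : S'.Finite) (_hS₀ : S₀ ⊆ S')
        {α' β' : SatakeFamily K} (_hα : ∀ w ∉ S', (σ i).1.HasSatakeParamAt w (α' w))
        (_hβ : ∀ w ∉ S', τ.1.HasSatakeParamAt w (β' w))
        (_hu : ∀ w ∉ S', ‖(α' w).prod‖ = 1) (_hu' : ∀ w ∉ S', ‖(β' w).prod‖ = 1)
        {z : ℂ} (_hs : 1 < z.re),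
        Multipliable fun v : {v : HeightOneSpectrum (𝓞 K) // v ∉ S'} =>
          ((satakePairPolynomial (α' v.1) (β' v.1)).eval ((v.1.residueCard : ℂ) ^ (-z)))⁻¹ :=
    fun i => JacquetShalika1981_multipliable_partialPairL_repData_holds (m i) (m i₀) K (hm i)
      (hm i₀) (hm0 i) (hm0 i₀) (σ i) τ
  choose S2 hS2fin hS2 using h21
  refine ⟨SB ∪ ((⋃ i, SA i) ∪ ⋃ i, S2 i),
    hSBfin.union ((Set.finite_iUnion hSAfin).union (Set.finite_iUnion hS2fin)), ?_⟩
  intro S hS hS₀ β A hβ hu hτ hA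
  have hSBS : SB ⊆ S := Set.subset_union_left.trans hS₀
  have hSAS : ∀ i, SA i ⊆ S := fun i =>
    (((Set.subset_iUnion SA i).trans Set.subset_union_left).trans Set.subset_union_right).trans hS₀
  have hS2S : ∀ i, S2 i ⊆ S := fun i =>
    (((Set.subset_iUnion S2 i).trans Set.subset_union_right).trans Set.subset_union_right).trans
      hS₀
  set αd : SatakeFamily K := fun w => (β i₀ w).map (·⁻¹) with hαd
  have hud : ∀ w ∉ S, ‖(αd w).prod‖ = 1 := fun w hw => by
    simp only [hαd]
    rw [Multiset.prod_map_inv', norm_inv, hu i₀ w hw, inv_one]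
  -- Step 2: limits of the factors at `s = 1` (`t^{e i} · L^S(1 + t, β i ⊗ αd) → c i ≠ 0`)
  have hfac : ∀ i, ∃ (e : ℕ) (c : ℂ), c ≠ 0 ∧ (i = i₀ → e = 1) ∧
      Tendsto (fun t : ℝ => (t : ℂ) ^ e * partialPairL S (β i) αd (1 + t)) (𝓝[>] (0 : ℝ))
        (𝓝 c) := by
    intro i
    by_cases hi : i = i₀
    · subst hi
      obtain ⟨c, hc, ht⟩ := hSB hS hSBS (hβ i) hτ (hu i) hud (fun w _ => rfl)
      exact ⟨1, c, hc, fun _ => rfl, by simpa only [pow_one] using ht⟩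
    · obtain ⟨e, c, hc, -, ht⟩ :=
        hSA i hS (hSAS i) (hβ i) hτ (hu i) hud (z := 1) (by simp)
      exact ⟨e, c, hc, fun h => (hi h).elim, ht⟩
  choose e c hc hei₀ hF using hfac
  -- Step 3: the Euler-product identity `L^S(1 + t, A ⊗ αd) = ∏ i, L^S(1 + t, β i ⊗ αd)`, `t > 0`
  have hident : ∀ t : ℝ, 0 < t →
      partialPairL S A αd (1 + t) = ∏ i, partialPairL S (β i) αd (1 + t) := by
    intro t ht
    have hmul : ∀ i, Multipliable fun v : {v : HeightOneSpectrum (𝓞 K) // v ∉ S} =>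
        ((satakePairPolynomial (β i v.1) (αd v.1)).eval
          ((v.1.residueCard : ℂ) ^ (-((1 : ℂ) + t))))⁻¹ := fun i =>
      hS2 i hS (hS2S i) (hβ i) hτ (hu i) hud (z := 1 + t)
        (by simp only [Complex.add_re, Complex.ofReal_re, Complex.one_re]; linarith)
    have hloc : ∀ v : {v : HeightOneSpectrum (𝓞 K) // v ∉ S},
        ((satakePairPolynomial (A v.1) (αd v.1)).eval
            ((v.1.residueCard : ℂ) ^ (-((1 : ℂ) + t))))⁻¹ =
          ∏ i, ((satakePairPolynomial (β i v.1) (αd v.1)).eval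
            ((v.1.residueCard : ℂ) ^ (-((1 : ℂ) + t))))⁻¹ := by
      intro v
      rw [hA v.1 v.2, satakePairPolynomial_sum_left, Polynomial.eval_prod,
        ← Finset.prod_inv_distrib]
    simp only [partialPairL]
    rw [tprod_congr hloc]
    exact Multipliable.tprod_finsetProd fun i _ => hmul i
  -- Step 4: the limits multiply
  set E : ℕ := ∑ i, e i with hEdef
  have hE : 1 ≤ E := by
    rw [hEdef, ← hei₀ i₀ rfl]
    exact Finset.single_le_sum (fun i _ => Nat.zero_le (e i)) (Finset.mem_univ i₀)
  have hC : (∏ i, c i) ≠ 0 := Finset.prod_ne_zero_iff.mpr fun i _ => hc i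
  have hR : Tendsto (fun t : ℝ => (t : ℂ) ^ E * ∏ i, partialPairL S (β i) αd (1 + t))
      (𝓝[>] (0 : ℝ)) (𝓝 (∏ i, c i)) := by
    have h := tendsto_finsetProd Finset.univ fun i (_ : i ∈ Finset.univ) => hF i
    refine h.congr fun t => ?_
    rw [Finset.prod_mul_distrib, Finset.prod_pow_eq_pow_sum]
  refine ⟨E, ∏ i, c i, hE, hC, hR.congr' ?_⟩
  filter_upwards [self_mem_nhdsWithin] with t ht
  rw [hident t ht]

/-- **Corollary: `L^S(s, ρ × σ̃_{i₀})` has no finite limit at `s = 1`** (a genuine pole), in the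
setting of `exists_tendsto_pow_mul_partialPairL_sum_dual`: if `t^E · L → c ≠ 0` with `E ≥ 1` and
`L → d` then `t^E · L → 0`. This is the form in which the pole contradicts the holomorphy of
`L^S(s, Π ⊗ σ̃_{i₀}, ∧² ⊗ ρ_m)` at `s = 1` (Props. 11–12) in the printed proof.
[cite: AsgariRaghuram2007, §2.1 Thm. 3 and §4 (p. 10)] -/
theorem not_tendsto_partialPairL_sum_dual
    (hJSb : JacquetShalika1981_partialPairL_boundary_repData)
    (hJSp : JacquetShalika1981_partialPairL_pole_repData)
    {ι : Type*} [Fintype ι] {m : ι → ℕ} {hm : ∀ i, isCompact_glFiniteIntegralLevel (m i) K}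
    (σ : ∀ i, CuspidalAutomorphicRepData (m i) K (hm i)) (hm0 : ∀ i, 0 < m i) (i₀ : ι)
    (τ : CuspidalAutomorphicRepData (m i₀) K (hm i₀)) :
    ∃ S₀ : Set (HeightOneSpectrum (𝓞 K)), S₀.Finite ∧
      ∀ {S : Set (HeightOneSpectrum (𝓞 K))} (_hS : S.Finite) (_hS₀ : S₀ ⊆ S)
        {β : ι → SatakeFamily K} {A : SatakeFamily K}
        (_hβ : ∀ i, ∀ w ∉ S, (σ i).1.HasSatakeParamAt w (β i w))
        (_hu : ∀ i, ∀ w ∉ S, ‖(β i w).prod‖ = 1)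
        (_hτ : ∀ w ∉ S, τ.1.HasSatakeParamAt w ((β i₀ w).map (·⁻¹)))
        (_hA : ∀ w ∉ S, A w = ∑ i, β i w) (d : ℂ),
        ¬ Tendsto (fun t : ℝ => partialPairL S A (fun w => (β i₀ w).map (·⁻¹)) (1 + t))
            (𝓝[>] (0 : ℝ)) (𝓝 d) := by
  obtain ⟨S₀, hS₀fin, h⟩ := exists_tendsto_pow_mul_partialPairL_sum_dual hJSb hJSp σ hm0 i₀ τ
  refine ⟨S₀, hS₀fin, ?_⟩
  intro S hS hS₀ β A hβ hu hτ hA d hd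
  obtain ⟨E, c, hE, hc, hlim⟩ := h hS hS₀ hβ hu hτ hA
  have h0 : Tendsto (fun t : ℝ => (t : ℂ) ^ E) (𝓝[>] (0 : ℝ)) (𝓝 0) := by
    have h1 : Tendsto (fun t : ℝ => (t : ℂ)) (𝓝[>] (0 : ℝ)) (𝓝 0) := by
      have h2 := (Complex.continuous_ofReal.tendsto (0 : ℝ)).mono_left
        (nhdsWithin_le_nhds (s := Set.Ioi (0 : ℝ)))
      simpa using h2
    simpa [zero_pow (by omega : E ≠ 0)] using h1.pow E
  have h0d := h0.mul hd
  rw [zero_mul] at h0d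
  exact hc (tendsto_nhds_unique hlim h0d)

end SummandPole

/-! ### Glue independent of the missing analytic inputs: exceptional sets, degree-`0` parts -/

section Glue

variable {F : Type} [Field F] [NumberField F]

/-- **Finite exceptional set and Satake families for the isobaric clause.** From the a.e. clauses
of Kim's fact (weak exterior square `hP`, isobaric clause `hdec`) and a Satake family `α` of `π`
off a finite `Sπ`, there are a finite `S₁ ⊇ Sπ` and families `βᵢ` of the `σᵢ` off `S₁` with
`∧² α(w) = ∑ᵢ βᵢ(w)` for `w ∉ S₁` (unramifiedness a.e. of the finitely many `σᵢ`,
`hasSatakeParamAt_cofinite_holds`; uniqueness of the parameters of `P`, `hasSatakeParamAt_unique_holds`)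
— the passage from "almost every place" to the "off a finite `S`" format of
`exists_tendsto_pow_mul_partialPairL_sum_dual` (pattern of `IsobaricRigidityRepData`, Step 2).
[folklore] -/
theorem exists_finite_families_wedgeTwo_eq_sum
    (hF : ∀ m : ℕ, isCompact_glFiniteIntegralLevel m F)
    {π : CuspidalAutomorphicRepData 4 F (hF 4)}
    {P : AutomorphicRepData (AutomorphyDatum.gl 6 F (hF 6))} {k : ℕ} {m : Fin k → ℕ}
    (σ : ∀ i : Fin k, CuspidalAutomorphicRepData (m i) F (hF (m i)))
    {Sπ : Set (HeightOneSpectrum (𝓞 F))} (hSπ : Sπ.Finite) {α : SatakeFamily F}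
    (hα : ∀ w ∉ Sπ, π.1.HasSatakeParamAt w (α w))
    (hP : ∀ᶠ v : HeightOneSpectrum (𝓞 F) in cofinite, ∀ a : Multiset ℂ,
      π.1.HasSatakeParamAt v a → P.HasSatakeParamAt v (wedgeTwoParams a))
    (hdec : ∀ᶠ v : HeightOneSpectrum (𝓞 F) in cofinite, ∀ β : Fin k → Multiset ℂ,
      (∀ i, (σ i).1.HasSatakeParamAt v (β i)) → P.HasSatakeParamAt v (∑ i, β i)) :
    ∃ (S₁ : Set (HeightOneSpectrum (𝓞 F))) (β : Fin k → SatakeFamily F), S₁.Finite ∧ Sπ ⊆ S₁ ∧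
      (∀ i, ∀ w ∉ S₁, (σ i).1.HasSatakeParamAt w (β i w)) ∧
      (∀ w ∉ S₁, wedgeTwoParams (α w) = ∑ i, β i w) := by
  have hcof : ∀ᶠ v : HeightOneSpectrum (𝓞 F) in cofinite, ∀ i, (σ i).1.IsUnramifiedAt v :=
    Filter.eventually_all.mpr fun i => AutomorphicRepData.hasSatakeParamAt_cofinite_holds (σ i).1
  -- a choice of parameters wherever they exist
  let β : Fin k → SatakeFamily F := fun i w =>
    if h : (σ i).1.IsUnramifiedAt w then h.choose else 0
  have hβ : ∀ i w, (σ i).1.IsUnramifiedAt w → (σ i).1.HasSatakeParamAt w (β i w) := by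
    intro i w h
    simp only [β, dif_pos h]
    exact h.choose_spec
  have hgood : ∀ᶠ v : HeightOneSpectrum (𝓞 F) in cofinite,
      (∀ i, (σ i).1.HasSatakeParamAt v (β i v)) ∧
        ∀ a : Multiset ℂ, π.1.HasSatakeParamAt v a → wedgeTwoParams a = ∑ i, β i v := by
    filter_upwards [hcof, hP, hdec] with v h1 h2 h3
    exact ⟨fun i => hβ i v (h1 i), fun a ha =>
      AutomorphicRepData.hasSatakeParamAt_unique_holds P (h2 a ha) (h3 _ fun i => hβ i v (h1 i))⟩
  rw [Filter.eventually_cofinite] at hgood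
  refine ⟨Sπ ∪ {v | ¬ ((∀ i, (σ i).1.HasSatakeParamAt v (β i v)) ∧
      ∀ a : Multiset ℂ, π.1.HasSatakeParamAt v a → wedgeTwoParams a = ∑ i, β i v)}, β,
    hSπ.union hgood, Set.subset_union_left, ?_, ?_⟩
  · intro i w hw
    have hw' := not_not.mp fun h => hw (Or.inr h)
    exact hw'.1 i
  · intro w hw
    have hw' := not_not.mp fun h => hw (Or.inr h)
    exact hw'.2 (α w) (hα w fun h => hw (Or.inl h))

/-- **Degree-`0` parts contribute nothing to the isobaric clause**: if `card (βᵢ) = mᵢ` for all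
`i` then `∑ᵢ βᵢ` is the sum over the indices of positive degree — the reindexing by
`{i // 0 < mᵢ}` under which `exists_tendsto_pow_mul_partialPairL_sum_dual` (degrees `≥ 1`)
applies to Kim's clause. [folklore] -/
theorem sum_eq_sum_subtype_pos_of_card_eq {k : ℕ} {m : Fin k → ℕ} (β : Fin k → Multiset ℂ)
    (hcard : ∀ i, Multiset.card (β i) = m i) :
    ∑ i, β i = ∑ i : {i : Fin k // 0 < m i}, β i.1 := by
  rw [← Finset.sum_subtype (Finset.univ.filter fun i : Fin k => 0 < m i) (by simp)
    (fun i : Fin k => β i)]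
  symm
  refine Finset.sum_filter_of_ne fun i _ hi => ?_
  rw [Nat.pos_iff_ne_zero]
  intro h0
  apply hi
  rw [← Multiset.card_eq_zero, hcard i, h0]

end Glue

/-! ### Reduction to unitary `π` (the standing normalisation of Kim and of Asgari–Raghuram) -/

section Unitary

variable {F : Type} [Field F] [NumberField F]

/-- `(q^{s})² = q^{2s}` for the residue cardinality. [folklore] -/
private theorem residueCard_cpow_sq (v : HeightOneSpectrum (𝓞 F)) (s : ℂ) :
    ((v.residueCard : ℂ) ^ s) ^ 2 = (v.residueCard : ℂ) ^ (2 * s) := by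
  rw [← Complex.cpow_nat_mul]
  norm_num

/-- The residue cardinality is a non-zero complex number. [folklore] -/
private theorem residueCard_ne_zero' (v : HeightOneSpectrum (𝓞 F)) : (v.residueCard : ℂ) ≠ 0 :=
  Nat.cast_ne_zero.mpr (zero_lt_one.trans v.one_lt_residueCard).ne'

/-- **The hypothesis of the fact is invariant under `π ↦ π ⊗ |det|^{-s₀}`.** If the Satake
parameters of `π` off a finite `Sπ` are exactly `q_w^{s₀} α₀(w)` and `πu` carries `α₀(w)` there
(`CuspidalAutomorphicRepData.exists_unitary_avatar`), then "no cuspidal datum on `GL(6)` carries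
`∧² t_{π,v}` a.e." implies the same for `πu`: a cuspidal `S'` carrying `∧² α₀` a.e., twisted by the
norm-power character `‖·‖^{-2s₀}` (`exists_heckeCharacter_ideleNorm_cpow`,
`CuspidalAutomorphicRepData.exists_twist_hecke_hasSatakeParamAt`; `‖ϖ_v‖^{-2s₀} = q_v^{2s₀}`,
`HeckeCharacter.valueAtUniformizer_of_cpow`), carries `q_v^{2s₀} ∧² α₀ = ∧²(q_v^{s₀} α₀) = ∧² t_{π,v}`
(`wedgeTwoParams_map_mul`). Asgari–Raghuram, p. 3: (i) is invariant under `Π ↦ Π ⊗ |det|^s`.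
[cite: AsgariRaghuram2007, §1 (Theorem 1 and the remarks before it)] -/
theorem not_exists_cuspidal_wedgeTwo_of_shift
    (hF : ∀ m : ℕ, isCompact_glFiniteIntegralLevel m F)
    {π πu : CuspidalAutomorphicRepData 4 F (hF 4)}
    {Sπ : Set (HeightOneSpectrum (𝓞 F))} (hSπ : Sπ.Finite) {α₀ : SatakeFamily F} {s₀ : ℂ}
    (hiff : ∀ w ∉ Sπ, ∀ β : Multiset ℂ,
      π.1.HasSatakeParamAt w β ↔ β = (α₀ w).map (((w.residueCard : ℂ) ^ s₀) * ·))
    (hπu : ∀ w ∉ Sπ, πu.1.HasSatakeParamAt w (α₀ w))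
    (hno : ¬ ∃ S : CuspidalAutomorphicRepData 6 F (hF 6),
        ∀ᶠ v : HeightOneSpectrum (𝓞 F) in cofinite, ∀ α : Multiset ℂ,
          π.1.HasSatakeParamAt v α → S.1.HasSatakeParamAt v (wedgeTwoParams α)) :
    ¬ ∃ S : CuspidalAutomorphicRepData 6 F (hF 6),
        ∀ᶠ v : HeightOneSpectrum (𝓞 F) in cofinite, ∀ α : Multiset ℂ,
          πu.1.HasSatakeParamAt v α → S.1.HasSatakeParamAt v (wedgeTwoParams α) := by
  rintro ⟨S', hS'⟩
  obtain ⟨χ, hχ⟩ := exists_heckeCharacter_ideleNorm_cpow F (-(2 * s₀))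
  haveI : NeZero (6 : ℕ) := ⟨by norm_num⟩
  obtain ⟨S, hS⟩ := CuspidalAutomorphicRepData.exists_twist_hecke_hasSatakeParamAt χ S'
  refine hno ⟨S, ?_⟩
  filter_upwards [hS', hS, hSπ.eventually_cofinite_notMem] with v hv₁ hv₂ hv₃ α hα
  have hαeq : α = (α₀ v).map (((v.residueCard : ℂ) ^ s₀) * ·) := (hiff v hv₃ α).1 hα
  have hχv : χ.valueAtUniformizer v = (v.residueCard : ℂ) ^ (2 * s₀) := by
    rw [HeckeCharacter.valueAtUniformizer_of_cpow hχ v, ← Complex.cpow_neg, neg_neg]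
  have h := hv₂ _ (hv₁ _ (hπu v hv₃))
  have hfun : (fun x : ℂ => ((v.residueCard : ℂ) ^ s₀) ^ 2 * x) =
      fun x : ℂ => χ.valueAtUniformizer v * x := by
    funext x
    rw [residueCard_cpow_sq, hχv]
  rw [hαeq, wedgeTwoParams_map_mul, hfun]
  exact h

/-- **Clause (α) is invariant under `π ↦ π ⊗ |det|^{-s₀}`** (on Satake parameters): if `πu`
(parameters `α₀(w)` off `Sπ`) satisfies `{aᵢ⁻¹} = {χ(ϖ_v) aᵢ}` a.e. for some Hecke character `χ`,
then `π` (parameters `q_w^{s₀} α₀(w)`) satisfies it with `χ · ‖·‖^{2s₀}`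
(`(q^{s₀} a)⁻¹ = χ(ϖ_v) q_v^{-2s₀} · (q^{s₀} a)`). Asgari–Raghuram, p. 3: (iii) is invariant under
`Π ↦ Π ⊗ |det|^s`. [cite: AsgariRaghuram2007, §1 (Theorem 1 and the remarks before it)] -/
theorem exists_selfDual_of_shift {n : ℕ} {hcpt : isCompact_glFiniteIntegralLevel n F}
    {π πu : AutomorphicRepData (AutomorphyDatum.gl n F hcpt)}
    {Sπ : Set (HeightOneSpectrum (𝓞 F))} (hSπ : Sπ.Finite) {α₀ : SatakeFamily F} {s₀ : ℂ}
    (hiff : ∀ w ∉ Sπ, ∀ β : Multiset ℂ,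
      π.HasSatakeParamAt w β ↔ β = (α₀ w).map (((w.residueCard : ℂ) ^ s₀) * ·))
    (hπu : ∀ w ∉ Sπ, πu.HasSatakeParamAt w (α₀ w))
    (h : ∃ χ : HeckeCharacter F,
      ∀ᶠ v : HeightOneSpectrum (𝓞 F) in cofinite, ∀ α : Multiset ℂ,
        πu.HasSatakeParamAt v α → α.map (fun a => a⁻¹) = α.map (fun a => χ.valueAtUniformizer v * a)) :
    ∃ χ : HeckeCharacter F,
      ∀ᶠ v : HeightOneSpectrum (𝓞 F) in cofinite, ∀ α : Multiset ℂ,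
        π.HasSatakeParamAt v α → α.map (fun a => a⁻¹) = α.map (fun a => χ.valueAtUniformizer v * a) := by
  obtain ⟨χ, hχ⟩ := h
  obtain ⟨ν, hν⟩ := exists_heckeCharacter_ideleNorm_cpow F (2 * s₀)
  refine ⟨χ * ν, ?_⟩
  filter_upwards [hχ, hSπ.eventually_cofinite_notMem] with v hv hvS α hα
  have hαeq : α = (α₀ v).map (((v.residueCard : ℂ) ^ s₀) * ·) := (hiff v hvS α).1 hα
  have hνv : ν.valueAtUniformizer v = ((v.residueCard : ℂ) ^ (2 * s₀))⁻¹ :=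
    HeckeCharacter.valueAtUniformizer_of_cpow hν v
  have hq : (v.residueCard : ℂ) ^ s₀ ≠ 0 := fun h0 =>
    residueCard_ne_zero' v ((Complex.cpow_eq_zero_iff _ _).1 h0).1
  have hu := hv (α₀ v) (hπu v hvS)
  have hu' := congrArg (Multiset.map fun y : ℂ => ((v.residueCard : ℂ) ^ s₀)⁻¹ * y) hu
  rw [Multiset.map_map, Multiset.map_map] at hu'
  rw [hαeq, HeckeCharacter.valueAtUniformizer_mul, hνv, Multiset.map_map, Multiset.map_map]
  have h1 : ((fun a : ℂ => a⁻¹) ∘ fun x : ℂ => (v.residueCard : ℂ) ^ s₀ * x) =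
      ((fun y : ℂ => ((v.residueCard : ℂ) ^ s₀)⁻¹ * y) ∘ fun a : ℂ => a⁻¹) := by
    funext x
    simp only [Function.comp_apply, mul_inv]
  have h2 : ((fun a : ℂ => χ.valueAtUniformizer v * ((v.residueCard : ℂ) ^ (2 * s₀))⁻¹ * a) ∘
        fun x : ℂ => (v.residueCard : ℂ) ^ s₀ * x) =
      ((fun y : ℂ => ((v.residueCard : ℂ) ^ s₀)⁻¹ * y) ∘ fun a : ℂ => χ.valueAtUniformizer v * a) := by
    funext x
    simp only [Function.comp_apply, ← residueCard_cpow_sq]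
    field_simp
  rw [h1, h2]
  exact hu'

/-- **Clause (β) is invariant under `π ↦ π ⊗ |det|^{-s₀}`** (on Satake parameters): a
self-twist `{χ(ϖ_v) aᵢ} = {aᵢ}` a.e. of `πu` (parameters `α₀(w)` off `Sπ`) by `χ ≠ 1` is a
self-twist of `π` (parameters `q_w^{s₀} α₀(w)`) by the same `χ`. Asgari–Raghuram, p. 3.
[cite: AsgariRaghuram2007, §1 (Theorem 1 and the remarks before it)] -/
theorem exists_selfTwist_of_shift {n : ℕ} {hcpt : isCompact_glFiniteIntegralLevel n F}
    {π πu : AutomorphicRepData (AutomorphyDatum.gl n F hcpt)}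
    {Sπ : Set (HeightOneSpectrum (𝓞 F))} (hSπ : Sπ.Finite) {α₀ : SatakeFamily F} {s₀ : ℂ}
    (hiff : ∀ w ∉ Sπ, ∀ β : Multiset ℂ,
      π.HasSatakeParamAt w β ↔ β = (α₀ w).map (((w.residueCard : ℂ) ^ s₀) * ·))
    (hπu : ∀ w ∉ Sπ, πu.HasSatakeParamAt w (α₀ w))
    (h : ∃ χ : HeckeCharacter F, χ ≠ 1 ∧
      ∀ᶠ v : HeightOneSpectrum (𝓞 F) in cofinite, ∀ α : Multiset ℂ,
        πu.HasSatakeParamAt v α → α.map (fun a => χ.valueAtUniformizer v * a) = α) :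
    ∃ χ : HeckeCharacter F, χ ≠ 1 ∧
      ∀ᶠ v : HeightOneSpectrum (𝓞 F) in cofinite, ∀ α : Multiset ℂ,
        π.HasSatakeParamAt v α → α.map (fun a => χ.valueAtUniformizer v * a) = α := by
  obtain ⟨χ, hχ1, hχ⟩ := h
  refine ⟨χ, hχ1, ?_⟩
  filter_upwards [hχ, hSπ.eventually_cofinite_notMem] with v hv hvS α hα
  have hαeq : α = (α₀ v).map (((v.residueCard : ℂ) ^ s₀) * ·) := (hiff v hvS α).1 hα
  have hu := hv (α₀ v) (hπu v hvS)
  rw [hαeq, Multiset.map_map]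
  conv_rhs => rw [← hu, Multiset.map_map]
  refine Multiset.map_congr rfl fun x _ => ?_
  simp only [Function.comp_apply]
  ring

/-- **Reduction of the fact to unitary `π`.** It suffices to prove
`AsgariRaghuram2007_selfDual_or_selfTwist_of_wedgeTwo_not_cuspidal` for the cuspidal `π` on
`GL(4, 𝔸_F)` admitting a UNITARY Satake family off a finite set (`‖∏ α(w)‖ = 1`, i.e. unitary central
character): every cuspidal `π` is `πu ⊗ |det|^{s₀}` with such a `πu` (Borel–Jacquet 1979, 5.7;
`CuspidalAutomorphicRepData.exists_unitary_avatar`), and the hypothesis and both conclusions of the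
fact pass between `π` and `πu` (`not_exists_cuspidal_wedgeTwo_of_shift`, `exists_selfDual_of_shift`,
`exists_selfTwist_of_shift`). This is the standing normalisation "cuspidal = unitary cuspidal" of
Kim (JAMS 2003, p. 139) and of the Langlands–Shahidi inputs of Asgari–Raghuram.
[cite: AsgariRaghuram2007, §1 (Theorem 1)] [cite: BorelJacquetCorvallis1979, 5.7] -/
theorem AsgariRaghuram2007_selfDual_or_selfTwist_of_wedgeTwo_not_cuspidal_of_unitary
    (h : ∀ (F : Type) [Field F] [NumberField F]
      (hF : ∀ m : ℕ, isCompact_glFiniteIntegralLevel m F) (π : CuspidalAutomorphicRepData 4 F (hF 4)),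
      (∃ (S : Set (HeightOneSpectrum (𝓞 F))) (α : SatakeFamily F), S.Finite ∧
          (∀ w ∉ S, π.1.HasSatakeParamAt w (α w)) ∧ ∀ w ∉ S, ‖(α w).prod‖ = 1) →
      (¬ ∃ S : CuspidalAutomorphicRepData 6 F (hF 6),
          ∀ᶠ v : HeightOneSpectrum (𝓞 F) in cofinite, ∀ α : Multiset ℂ,
            π.1.HasSatakeParamAt v α → S.1.HasSatakeParamAt v (wedgeTwoParams α)) →
      (∃ χ : HeckeCharacter F,
          ∀ᶠ v : HeightOneSpectrum (𝓞 F) in cofinite, ∀ α : Multiset ℂ,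
            π.1.HasSatakeParamAt v α →
              α.map (fun a => a⁻¹) = α.map (fun a => χ.valueAtUniformizer v * a)) ∨
      (∃ χ : HeckeCharacter F, χ ≠ 1 ∧
          ∀ᶠ v : HeightOneSpectrum (𝓞 F) in cofinite, ∀ α : Multiset ℂ,
            π.1.HasSatakeParamAt v α →
              α.map (fun a => χ.valueAtUniformizer v * a) = α)) :
    AsgariRaghuram2007_selfDual_or_selfTwist_of_wedgeTwo_not_cuspidal := by
  intro F _ _ hF π hno
  haveI : NeZero (4 : ℕ) := ⟨by norm_num⟩
  obtain ⟨s₀, Sπ, α₀, πu, hSπ, hiff, hπu, hu, -⟩ :=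
    CuspidalAutomorphicRepData.exists_unitary_avatar (hF 4) π
  have hno' := not_exists_cuspidal_wedgeTwo_of_shift hF hSπ hiff hπu hno
  rcases h F hF πu ⟨Sπ, α₀, hSπ, hπu, hu⟩ hno' with hα | hβ
  · exact Or.inl (exists_selfDual_of_shift hSπ hiff hπu hα)
  · exact Or.inr (exists_selfTwist_of_shift hSπ hiff hπu hβ)

end Unitary

/-! ### Props. 11 and 12 from the Langlands–Shahidi input (Props. 4–5) -/

section LanglandsShahidi

variable {F : Type} [Field F] [NumberField F]

/-- `q_v^s ≠ 0`. [folklore] -/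
private theorem residueCard_cpow_ne_zero (v : HeightOneSpectrum (𝓞 F)) (s : ℂ) :
    (v.residueCard : ℂ) ^ s ≠ 0 := fun h0 =>
  residueCard_ne_zero' v ((Complex.cpow_eq_zero_iff _ _).1 h0).1

/-- `|q_v^z| = 1` for purely imaginary `z` (the norm-power characters `‖·‖^{it}` are unitary).
[folklore] -/
private theorem norm_residueCard_cpow_of_re_eq_zero (v : HeightOneSpectrum (𝓞 F)) {z : ℂ}
    (hz : z.re = 0) : ‖(v.residueCard : ℂ) ^ z‖ = 1 := by
  rw [← Complex.ofReal_natCast, Complex.norm_cpow_eq_rpow_re_of_pos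
    (by exact_mod_cast (zero_lt_one.trans v.one_lt_residueCard)), hz, Real.rpow_zero]

/-- A number field has a finite place (`𝓞 F` is not a field). [folklore] -/
private theorem nonempty_heightOneSpectrum' : Nonempty (HeightOneSpectrum (𝓞 F)) := by
  obtain ⟨𝔪, h𝔪⟩ := Ideal.exists_maximal (𝓞 F)
  exact ⟨⟨𝔪, h𝔪.isPrime, Ring.ne_bot_of_isMaximal_of_not_isField h𝔪 (RingOfIntegers.not_isField F)⟩⟩

/-- Twisting algebra on a Satake parameter: from `{e θ x} = {θ x}`, `{c x} = {x}`, `e = p c` and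
`θ ≠ 0` conclude `{p x} = {x}`. [folklore] -/
private theorem map_mul_eq_self_of_twist {a : Multiset ℂ} {θ c e p : ℂ} (hθ : θ ≠ 0)
    (h1 : (a.map fun x => θ * x).map (fun y => e * y) = a.map fun x => θ * x)
    (h2 : a.map (fun x => c * x) = a) (he : e = p * c) :
    a.map (fun x => p * x) = a := by
  have h3 : a.map (fun x => θ * x) = a.map (fun x => p * θ * x) := by
    calc a.map (fun x => θ * x) = (a.map fun x => θ * x).map (fun y => e * y) := h1.symm
      _ = (a.map fun x => c * x).map (fun y => p * θ * y) := by
          simp only [Multiset.map_map, Function.comp_def, he]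
          exact Multiset.map_congr rfl fun x _ => by ring
      _ = a.map (fun x => p * θ * x) := by rw [h2]
  have h4 := congrArg (Multiset.map fun y : ℂ => θ⁻¹ * y) h3
  simp only [Multiset.map_map, Function.comp_def] at h4
  have h5 : a.map (fun x => θ⁻¹ * (θ * x)) = a := by
    conv_rhs => rw [← Multiset.map_id a]
    exact Multiset.map_congr rfl fun x _ => by simp only [id]; field_simp
  have h6 : a.map (fun x => θ⁻¹ * (p * θ * x)) = a.map (fun x => p * x) :=
    Multiset.map_congr rfl fun x _ => by field_simp
  rw [h5, h6] at h4
  exact h4.symm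

/-- `∏ (c • a) = c^{#a} ∏ a`: the central character of a twist `σ ⊗ χ` at `ϖ_v` is
`χ(ϖ_v)^n ω_σ(ϖ_v)`. [folklore] -/
private theorem prod_map_const_mul (a : Multiset ℂ) (c : ℂ) :
    (a.map fun x => c * x).prod = c ^ Multiset.card a * a.prod := by
  rw [Multiset.prod_map_mul, Multiset.map_const', Multiset.prod_replicate, Multiset.map_id']

/-- **Asgari–Raghuram 2007, Prop. 11, from the Langlands–Shahidi input.** *"If `Π ≇ Π̃ ⊗ χ` for all
`χ`, then `L^S(s, Π ⊗ σ, ∧² ⊗ ρ_n)` is holomorphic at `s = 1` for every cuspidal representation `σ`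
of `GL(n, 𝔸_F)`, `n = 1, 3`. Proof. By Prop. 4 it is enough to show that `w₀(Σ) ≇ Σ`. If
`w₀(Σ) ≅ Σ`, then `w₀(σ ⊗ Π) ≅ σ ⊗ Π`. On the other hand, by Prop. 5, `w₀(σ ⊗ Π) ≅ σ̃ ⊗ (Π̃ ⊗ ω_σ)`.
In particular `Π ≅ Π̃ ⊗ ω_σ`, contradicting the hypothesis."* In the tree's vocabulary: the
Langlands–Shahidi input is the hypothesis `hLSodd` (Props. 4–5 with eq. (2) of §2.3 for this `Π`
and `n`: the finite limit of `partialPairL S (∧² ∘ α) β` at `s → 1⁺` unless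
`{aᵢ⁻¹} = {ω_τ(ϖ_v)^{±1} aᵢ}` a.e. on the Satake parameters `a` of `Π`, `ω_τ(ϖ_v) = ∏ β(v)`; module
docstring, remark (2)); the hypothesis of Prop. 11 is the Satake-level negation of clause (α) of the
fact (`hnα`, all Hecke characters `χ`); and the printed two lines are: the central character `Ω` of
`τ` is a Hecke character with `Ω(ϖ_v) = ∏ t_{τ,v}` wherever `τ` has a Satake parameter
(`AutomorphicRepData.exists_heckeCharacter_valueAtUniformizer_eq_prod`, Borel–Jacquet 5.7, Gelbart
§7.1: `ω(ϖ_v) = det t_v`), so each excluded identity is clause (α) with `χ = Ω`, resp. `χ = Ω⁻¹`.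
[cite: AsgariRaghuram2007, §4 Prop. 11 (with §2.3 Props. 4–5)] -/
theorem tendsto_partialPairL_wedgeTwo_of_not_selfDual
    {hF : ∀ m : ℕ, isCompact_glFiniteIntegralLevel m F}
    {π : CuspidalAutomorphicRepData 4 F (hF 4)} {α : SatakeFamily F} {n : ℕ}
    (hnα : ∀ χ : HeckeCharacter F, ¬ ∀ᶠ v : HeightOneSpectrum (𝓞 F) in cofinite, ∀ a : Multiset ℂ,
        π.1.HasSatakeParamAt v a →
          a.map (fun x => x⁻¹) = a.map (fun x => χ.valueAtUniformizer v * x))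
    (hLSodd : ∀ (τ : CuspidalAutomorphicRepData n F (hF n)) (Sτ : Set (HeightOneSpectrum (𝓞 F)))
        (β : SatakeFamily F), Sτ.Finite → (∀ w ∉ Sτ, τ.1.HasSatakeParamAt w (β w)) →
        (∀ w ∉ Sτ, ‖(β w).prod‖ = 1) →
        ((¬ ∀ᶠ v : HeightOneSpectrum (𝓞 F) in cofinite, ∀ a : Multiset ℂ, π.1.HasSatakeParamAt v a →
            a.map (fun x => x⁻¹) = a.map (fun x => (β v).prod * x)) ∧
         (¬ ∀ᶠ v : HeightOneSpectrum (𝓞 F) in cofinite, ∀ a : Multiset ℂ, π.1.HasSatakeParamAt v a →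
            a.map (fun x => x⁻¹) = a.map (fun x => ((β v).prod)⁻¹ * x))) →
        ∃ S₁ : Set (HeightOneSpectrum (𝓞 F)), S₁.Finite ∧
          ∀ S : Set (HeightOneSpectrum (𝓞 F)), S.Finite → S₁ ⊆ S →
            ∃ d : ℂ, Tendsto (fun t : ℝ => partialPairL S (fun w => wedgeTwoParams (α w)) β (1 + t))
              (𝓝[>] (0 : ℝ)) (𝓝 d))
    (τ : CuspidalAutomorphicRepData n F (hF n)) (Sτ : Set (HeightOneSpectrum (𝓞 F)))
    (β : SatakeFamily F) (hSτ : Sτ.Finite) (hτβ : ∀ w ∉ Sτ, τ.1.HasSatakeParamAt w (β w))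
    (huβ : ∀ w ∉ Sτ, ‖(β w).prod‖ = 1) :
    ∃ S₁ : Set (HeightOneSpectrum (𝓞 F)), S₁.Finite ∧
      ∀ S : Set (HeightOneSpectrum (𝓞 F)), S.Finite → S₁ ⊆ S →
        ∃ d : ℂ, Tendsto (fun t : ℝ => partialPairL S (fun w => wedgeTwoParams (α w)) β (1 + t))
          (𝓝[>] (0 : ℝ)) (𝓝 d) := by
  obtain ⟨Ω, hΩ⟩ := τ.1.exists_heckeCharacter_valueAtUniformizer_eq_prod
  refine hLSodd τ Sτ β hSτ hτβ huβ ⟨fun H => hnα Ω ?_, fun H => hnα Ω⁻¹ ?_⟩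
  · filter_upwards [H, hSτ.eventually_cofinite_notMem] with v hv hvS a ha
    rw [(hΩ v _ (hτβ v hvS)).2]
    exact hv a ha
  · filter_upwards [H, hSτ.eventually_cofinite_notMem] with v hv hvS a ha
    rw [valueAtUniformizer_inv_eq, (hΩ v _ (hτβ v hvS)).2]
    exact hv a ha

/-- **Asgari–Raghuram 2007, Prop. 12, from the Langlands–Shahidi input, both halves of the printed
proof.** *"If `Π ≇ Π ⊗ χ` for all nontrivial `χ`, then `L^S(s, Π ⊗ σ, ∧² ⊗ ρ₂)` is holomorphic at
`s = 1` for every cuspidal representation `σ` of `GL(2, 𝔸_F)`. Proof. The same argument as in the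
above proof works as long as `ω_σ ≠ 1` because by Prop. 5 we have `w₀(σ ⊗ Π) ≅ σ̃ ⊗ (Π ⊗ ω_σ) ≇ σ ⊗ Π`
… Now suppose that `σ` … with trivial central character … Then `σ ⊗ θ²` occurs in `∧²(Π ⊗ θ)` for any
Hecke character `θ`. Note that `Π ⊗ θ` also satisfies the hypothesis that it has no nontrivial
self-twists. Choose `θ` such that `ω_{σ ⊗ θ²} = ω_σ θ⁴ = θ⁴ ≠ 1` to get a contradiction."* In the
tree's vocabulary, with the Langlands–Shahidi input `hLS2` (Props. 4–5 with eq. (2) for `n = 2` and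
every cuspidal `Π'` on `GL(4, 𝔸_F)`: the finite limit of `partialPairL S (∧² ∘ α') β'` at `s → 1⁺`
unless `{ω_{τ'}(ϖ_v) aᵢ} = {aᵢ}` a.e., `ω_{τ'}(ϖ_v) = ∏ β'(v)`) and the Satake-level negation of
clause (β) (`hnβ`, all `χ ≠ 1`): if `{ω_τ(ϖ_v) aᵢ} = {aᵢ}` fails a.e. apply `hLS2` to `(Π, τ)`;
otherwise (this is "`ω_σ = 1`" read on `Π`) take `θ = ‖·‖^{s₀}`, `s₀ = i π / (4 log q_{v₀})`
(`exists_heckeCharacter_ideleNorm_cpow`; unitary at every uniformizer, and `θ(ϖ_{v₀})⁻⁴ = -1`, so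
`χ = ‖·‖^{-4s₀} ≠ 1`), the cuspidal twists `Π ⊗ θ` and `τ ⊗ θ⁻²`
(`CuspidalAutomorphicRepData.exists_twist_hecke_hasSatakeParamAt`, families `θ(ϖ_v) α(v)` and
`θ(ϖ_v)⁻² β(v)`, still unitary): a self-twist `{ω_{τ ⊗ θ⁻²}(ϖ_v) a'ᵢ} = {a'ᵢ}` of `Π ⊗ θ` a.e. would
be the self-twist `{θ(ϖ_v)⁻⁴ aᵢ} = {aᵢ}` of `Π` by `χ ≠ 1` (`map_mul_eq_self_of_twist`), excluded by
`hnβ`; so `hLS2` applies to `(Π ⊗ θ, τ ⊗ θ⁻²)`, whose Euler product IS that of `(Π, τ)` factor by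
factor (`∧²(θ a) ⊗ θ⁻² b = ∧² a ⊗ b`: `wedgeTwoParams_map_mul`,
`eval_satakePairPolynomial_map_mul_map_mul`). The rank is a parameter `n = 2` (`subst`) so that the
assembly can feed a summand of degree `m i₀ = 2` without transport.
[cite: AsgariRaghuram2007, §4 Prop. 12 (with §2.3 Props. 4–5)] [cite: TateThesis1967, §4.3 (the characters `‖·‖^s`)] -/
theorem tendsto_partialPairL_wedgeTwo_of_not_selfTwist
    {hF : ∀ m : ℕ, isCompact_glFiniteIntegralLevel m F}
    {π : CuspidalAutomorphicRepData 4 F (hF 4)} {Sπ : Set (HeightOneSpectrum (𝓞 F))}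
    (hSπ : Sπ.Finite) {α : SatakeFamily F} (hπα : ∀ w ∉ Sπ, π.1.HasSatakeParamAt w (α w))
    (hu : ∀ w ∉ Sπ, ‖(α w).prod‖ = 1)
    (hnβ : ∀ χ : HeckeCharacter F, χ ≠ 1 → ¬ ∀ᶠ v : HeightOneSpectrum (𝓞 F) in cofinite,
        ∀ a : Multiset ℂ, π.1.HasSatakeParamAt v a →
          a.map (fun x => χ.valueAtUniformizer v * x) = a)
    (hLS2 : ∀ (π' : CuspidalAutomorphicRepData 4 F (hF 4)) (Sπ' : Set (HeightOneSpectrum (𝓞 F)))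
        (α' : SatakeFamily F), Sπ'.Finite → (∀ w ∉ Sπ', π'.1.HasSatakeParamAt w (α' w)) →
        (∀ w ∉ Sπ', ‖(α' w).prod‖ = 1) →
        ∀ (τ' : CuspidalAutomorphicRepData 2 F (hF 2)) (Sτ' : Set (HeightOneSpectrum (𝓞 F)))
          (β' : SatakeFamily F), Sτ'.Finite → (∀ w ∉ Sτ', τ'.1.HasSatakeParamAt w (β' w)) →
          (∀ w ∉ Sτ', ‖(β' w).prod‖ = 1) →
          (¬ ∀ᶠ v : HeightOneSpectrum (𝓞 F) in cofinite, ∀ a : Multiset ℂ,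
              π'.1.HasSatakeParamAt v a → a.map (fun x => (β' v).prod * x) = a) →
          ∃ S₁ : Set (HeightOneSpectrum (𝓞 F)), S₁.Finite ∧
            ∀ S : Set (HeightOneSpectrum (𝓞 F)), S.Finite → S₁ ⊆ S →
              ∃ d : ℂ, Tendsto
                (fun t : ℝ => partialPairL S (fun w => wedgeTwoParams (α' w)) β' (1 + t))
                (𝓝[>] (0 : ℝ)) (𝓝 d))
    {n : ℕ} (hn : n = 2) (τ : CuspidalAutomorphicRepData n F (hF n))
    (Sτ : Set (HeightOneSpectrum (𝓞 F))) (β : SatakeFamily F) (hSτ : Sτ.Finite)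
    (hτβ : ∀ w ∉ Sτ, τ.1.HasSatakeParamAt w (β w)) (huβ : ∀ w ∉ Sτ, ‖(β w).prod‖ = 1) :
    ∃ S₁ : Set (HeightOneSpectrum (𝓞 F)), S₁.Finite ∧
      ∀ S : Set (HeightOneSpectrum (𝓞 F)), S.Finite → S₁ ⊆ S →
        ∃ d : ℂ, Tendsto (fun t : ℝ => partialPairL S (fun w => wedgeTwoParams (α w)) β (1 + t))
          (𝓝[>] (0 : ℝ)) (𝓝 d) := by
  subst hn
  by_cases H : ∀ᶠ v : HeightOneSpectrum (𝓞 F) in cofinite, ∀ a : Multiset ℂ,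
      π.1.HasSatakeParamAt v a → a.map (fun x => (β v).prod * x) = a
  swap
  · -- `ω_σ ≠ 1` (on the Satake parameters of `Π`): Props. 4–5 apply to `(Π, τ)` itself
    exact hLS2 π Sπ α hSπ hπα hu τ Sτ β hSτ hτβ huβ H
  -- `ω_σ = 1`: the twisting trick, with `θ = ‖·‖^{s₀}`, `s₀ = iπ / (4 log q_{v₀})`
  obtain ⟨v₀⟩ := (nonempty_heightOneSpectrum' : Nonempty (HeightOneSpectrum (𝓞 F)))
  have hq₀ : (1 : ℝ) < (v₀.residueCard : ℝ) := by exact_mod_cast v₀.one_lt_residueCard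
  have hlog : Real.log (v₀.residueCard : ℝ) ≠ 0 := (Real.log_pos hq₀).ne'
  set t₀ : ℝ := Real.pi / (4 * Real.log (v₀.residueCard : ℝ)) with ht₀
  set s₀ : ℂ := (t₀ : ℂ) * Complex.I with hs₀
  have hs₀re : s₀.re = 0 := by simp [hs₀]
  obtain ⟨θ, hθ⟩ := exists_heckeCharacter_ideleNorm_cpow F s₀
  obtain ⟨ψ, hψ⟩ := exists_heckeCharacter_ideleNorm_cpow F (-(2 * s₀))
  obtain ⟨χ, hχ⟩ := exists_heckeCharacter_ideleNorm_cpow F (-(4 * s₀))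
  have hθv : ∀ v : HeightOneSpectrum (𝓞 F),
      θ.valueAtUniformizer v = ((v.residueCard : ℂ) ^ s₀)⁻¹ :=
    HeckeCharacter.valueAtUniformizer_of_cpow hθ
  have hψv : ∀ v : HeightOneSpectrum (𝓞 F),
      ψ.valueAtUniformizer v = ((v.residueCard : ℂ) ^ (-(2 * s₀)))⁻¹ :=
    HeckeCharacter.valueAtUniformizer_of_cpow hψ
  have hχv : ∀ v : HeightOneSpectrum (𝓞 F),
      χ.valueAtUniformizer v = ((v.residueCard : ℂ) ^ (-(4 * s₀)))⁻¹ :=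
    HeckeCharacter.valueAtUniformizer_of_cpow hχ
  have hθnorm : ∀ v : HeightOneSpectrum (𝓞 F), ‖θ.valueAtUniformizer v‖ = 1 := fun v => by
    rw [hθv, norm_inv, norm_residueCard_cpow_of_re_eq_zero v hs₀re, inv_one]
  have hψnorm : ∀ v : HeightOneSpectrum (𝓞 F), ‖ψ.valueAtUniformizer v‖ = 1 := fun v => by
    rw [hψv, norm_inv, norm_residueCard_cpow_of_re_eq_zero v (by simp [hs₀re]), inv_one]
  have hθne : ∀ v : HeightOneSpectrum (𝓞 F), θ.valueAtUniformizer v ≠ 0 := fun v => by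
    rw [hθv]; exact inv_ne_zero (residueCard_cpow_ne_zero v _)
  -- `θ(ϖ_v)² ψ(ϖ_v) = 1`, `ψ(ϖ_v)² = χ(ϖ_v)`, and `χ(ϖ_{v₀}) = -1` (so `χ ≠ 1`)
  have hθψ : ∀ v : HeightOneSpectrum (𝓞 F),
      θ.valueAtUniformizer v ^ 2 * ψ.valueAtUniformizer v = 1 := fun v => by
    rw [hθv, hψv, inv_pow, residueCard_cpow_sq, Complex.cpow_neg, inv_inv,
      inv_mul_cancel₀ (residueCard_cpow_ne_zero v _)]
  have hψχ : ∀ v : HeightOneSpectrum (𝓞 F),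
      ψ.valueAtUniformizer v ^ 2 = χ.valueAtUniformizer v := fun v => by
    rw [hψv, hχv, inv_pow, residueCard_cpow_sq]
    have e : (2 : ℂ) * -(2 * s₀) = -(4 * s₀) := by ring
    rw [e]
  have hχ1 : χ ≠ 1 := by
    intro h1
    have hval := hχv v₀
    rw [h1, valueAtUniformizer_one_eq] at hval
    have hexp : (v₀.residueCard : ℂ) ^ (-(4 * s₀)) = -1 := by
      rw [Complex.cpow_def_of_ne_zero (residueCard_ne_zero' v₀), ← Complex.natCast_log]
      have hreal : Real.log (v₀.residueCard : ℝ) * (4 * t₀) = Real.pi := by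
        rw [ht₀]
        field_simp
      have hcast : (Real.log (v₀.residueCard : ℝ) : ℂ) * (4 * (t₀ : ℂ)) = (Real.pi : ℂ) := by
        exact_mod_cast hreal
      have harg : (Real.log (v₀.residueCard : ℝ) : ℂ) * -(4 * s₀) = -((Real.pi : ℂ) * Complex.I) := by
        rw [hs₀, ← hcast]
        ring
      rw [harg, Complex.exp_neg, Complex.exp_pi_mul_I]
      norm_num
    rw [hexp] at hval
    norm_num at hval
  -- the cuspidal twists `Π ⊗ θ`, `τ ⊗ ψ` (`ψ = θ⁻²` at every uniformizer) and their families
  haveI : NeZero (4 : ℕ) := ⟨by norm_num⟩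
  haveI : NeZero (2 : ℕ) := ⟨by norm_num⟩
  obtain ⟨π', hπ'⟩ := CuspidalAutomorphicRepData.exists_twist_hecke_hasSatakeParamAt θ π
  obtain ⟨τ', hτ'⟩ := CuspidalAutomorphicRepData.exists_twist_hecke_hasSatakeParamAt ψ τ
  have hπ'fin := hπ'
  have hτ'fin := hτ'
  rw [Filter.eventually_cofinite] at hπ'fin hτ'fin
  set Sπ' : Set (HeightOneSpectrum (𝓞 F)) := Sπ ∪ {v | ¬ ∀ a : Multiset ℂ,
    π.1.HasSatakeParamAt v a →
      π'.1.HasSatakeParamAt v (a.map (θ.valueAtUniformizer v * ·))} with hSπ'def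
  set Sτ' : Set (HeightOneSpectrum (𝓞 F)) := Sτ ∪ {v | ¬ ∀ a : Multiset ℂ,
    τ.1.HasSatakeParamAt v a →
      τ'.1.HasSatakeParamAt v (a.map (ψ.valueAtUniformizer v * ·))} with hSτ'def
  have hSπ'fin : Sπ'.Finite := hSπ.union hπ'fin
  have hSτ'fin : Sτ'.Finite := hSτ.union hτ'fin
  set α' : SatakeFamily F := fun w => (α w).map (θ.valueAtUniformizer w * ·) with hα'def
  set β' : SatakeFamily F := fun w => (β w).map (ψ.valueAtUniformizer w * ·) with hβ'def
  have hπ'α' : ∀ w ∉ Sπ', π'.1.HasSatakeParamAt w (α' w) := fun w hw =>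
    (not_not.mp fun h => hw (Or.inr h)) _ (hπα w fun h => hw (Or.inl h))
  have hτ'β' : ∀ w ∉ Sτ', τ'.1.HasSatakeParamAt w (β' w) := fun w hw =>
    (not_not.mp fun h => hw (Or.inr h)) _ (hτβ w fun h => hw (Or.inl h))
  have hu' : ∀ w ∉ Sπ', ‖(α' w).prod‖ = 1 := fun w hw => by
    rw [hα'def, prod_map_const_mul, norm_mul, norm_pow, hθnorm, one_pow, one_mul]
    exact hu w fun h => hw (Or.inl h)
  have huβ' : ∀ w ∉ Sτ', ‖(β' w).prod‖ = 1 := fun w hw => by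
    rw [hβ'def, prod_map_const_mul, norm_mul, norm_pow, hψnorm, one_pow, one_mul]
    exact huβ w fun h => hw (Or.inl h)
  -- `Π ⊗ θ ≇ (Π ⊗ θ) ⊗ ω_{τ ⊗ ψ}` on Satake parameters: it would be the self-twist of `Π` by `χ ≠ 1`
  have hw0 : ¬ ∀ᶠ v : HeightOneSpectrum (𝓞 F) in cofinite, ∀ a : Multiset ℂ,
      π'.1.HasSatakeParamAt v a → a.map (fun x => (β' v).prod * x) = a := by
    intro K
    refine hnβ χ hχ1 ?_
    filter_upwards [K, H, hπ', hSτ.eventually_cofinite_notMem] with v hK hH htw hvτ a ha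
    have h1 := hK _ (htw a ha)
    have h2 := hH a ha
    have hcard : Multiset.card (β v) = 2 := (hτβ v hvτ).card_eq
    have hprod : (β' v).prod = χ.valueAtUniformizer v * (β v).prod := by
      rw [hβ'def, prod_map_const_mul, hcard, hψχ]
    exact map_mul_eq_self_of_twist (hθne v) h1 h2 hprod
  -- Props. 4–5 for the twisted pair; its Euler product is that of `(Π, τ)`
  obtain ⟨S₁, hS₁, hcon⟩ := hLS2 π' Sπ' α' hSπ'fin hπ'α' hu' τ' Sτ' β' hSτ'fin hτ'β' huβ' hw0
  refine ⟨S₁, hS₁, fun S hS hS₁S => ?_⟩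
  obtain ⟨d, hd⟩ := hcon S hS hS₁S
  refine ⟨d, hd.congr fun t => ?_⟩
  simp only [partialPairL]
  refine tprod_congr fun v => ?_
  rw [hα'def, hβ'def]
  simp only
  rw [wedgeTwoParams_map_mul, eval_satakePairPolynomial_map_mul_map_mul, hθψ v.1, one_mul]

end LanglandsShahidi

/-! ### The printed proof of (i) ⇒ (iii), assembled modulo its three missing inputs -/

section Assembly

/-- **Asgari–Raghuram 2007, §4 "The proof of (i) ⇒ (iii)", assembled in the tree modulo exactly
the inputs the tree lacks**, each entering as an explicit hypothesis stated in the tree's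
vocabulary (they are NOT named facts of the tree; this theorem fixes the shapes under which a
discharge of them closes the fact):

* `hKim` — Kim, JAMS 16 (2003), **Theorem A with its unitarity clause** (p. 139: for unitary
  cuspidal `π` on `GL₄`, `∧²π = τ₁ ⊞ ⋯ ⊞ τ_k` with `τᵢ` UNITARY cuspidal): the clauses of the tree's
  `Kim2003_exteriorSquare_GL4` for `π` with a unitary Satake family, plus
  "`‖∏ t_{σᵢ,v}‖ = 1` a.e." for every `σᵢ` (module docstring, remark (1): the tree's rendering omits
  this clause, without which the argument does not run);
* `hJSb`, `hJSp` — Arthur–Clozel (2.2)–(2.3) for Borel–Jacquet data, the tree's named facts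
  `JacquetShalika1981_partialPairL_boundary_repData`, `JacquetShalika1981_partialPairL_pole_repData`
  (Thm. 3 of the paper);
* `hP11` — **Prop. 11** (p. 10): if `Π ≇ Π̃ ⊗ χ` for all `χ` then `L^S(s, Π ⊗ σ, ∧² ⊗ ρ_n)` is
  holomorphic at `s = 1` for every cuspidal `σ` of `GL(n)`, `n = 1, 3`; `hP12` — **Prop. 12**: if
  `Π ≇ Π ⊗ χ` for all `χ ≠ 1`, the same for `n = 2` (Langlands–Shahidi method on
  `GL(n) × GSpin(6) ⊂ GSpin(2n+6)`, Props. 4–5). Rendering: for unitary `Π`, `σ` (unitary Satake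
  families `α`, `β` off finite sets) and the Satake-level negations of (α), (β) exactly as in the
  fact, `L^S(s, Π ⊗ σ, ∧² ⊗ ρ_n) = partialPairL S (∧² ∘ α) β` has a finite limit as `s → 1⁺` along
  the reals, for every finite `S` containing some finite `S₁` ("holomorphic at `s = 1`" for every
  admissible `S` implies this).

Proof (the paper's ten lines, pp. 10): reduce to unitary `π`
(`AsgariRaghuram2007_selfDual_or_selfTwist_of_wedgeTwo_not_cuspidal_of_unitary`); assume neither
(α) nor (β); Kim gives `P`, `σ₁, …, σ_k`; the hypothesis of the fact gives a summand `σ_{i₀}` of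
degree `1 ≤ m ≤ 3` (`exists_degree_le_three_of_decomposition`); pass to unitary Satake families off
a finite set (`exists_finite_families_wedgeTwo_eq_sum`, `sum_eq_sum_subtype_pos_of_card_eq`) and to
the contragredient `τ = σ̃_{i₀}` (`CuspidalAutomorphicRepData.exists_contragredient_satake_holds`);
then `L^S(s, ∧²Π × τ)` has a pole at `s = 1` (`not_tendsto_partialPairL_sum_dual`, from Thm. 3) and
is holomorphic there (Prop. 11 if `m = 1, 3`, Prop. 12 if `m = 2`) — contradiction.
[cite: AsgariRaghuram2007, §4 (p. 10), Props. 11–12, Thm. 3] [cite: Kim2002, Theorem A (p. 139)] -/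
theorem AsgariRaghuram2007_selfDual_or_selfTwist_of_wedgeTwo_not_cuspidal_of_kim_of_langlandsShahidi
    (hKim : ∀ (F : Type) [Field F] [NumberField F]
      (hF : ∀ m : ℕ, isCompact_glFiniteIntegralLevel m F) (π : CuspidalAutomorphicRepData 4 F (hF 4)),
      (∃ (S : Set (HeightOneSpectrum (𝓞 F))) (α : SatakeFamily F), S.Finite ∧
          (∀ w ∉ S, π.1.HasSatakeParamAt w (α w)) ∧ ∀ w ∉ S, ‖(α w).prod‖ = 1) →
      ∃ (P : AutomorphicRepData (AutomorphyDatum.gl 6 F (hF 6))) (k : ℕ) (m : Fin k → ℕ)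
        (σ : ∀ i : Fin k, CuspidalAutomorphicRepData (m i) F (hF (m i))),
        (∀ᶠ v : HeightOneSpectrum (𝓞 F) in cofinite, ∀ α : Multiset ℂ,
            π.1.HasSatakeParamAt v α → P.HasSatakeParamAt v (wedgeTwoParams α)) ∧
        (∑ i, m i = 6) ∧
        (∀ᶠ v : HeightOneSpectrum (𝓞 F) in cofinite, ∀ β : Fin k → Multiset ℂ,
            (∀ i, (σ i).1.HasSatakeParamAt v (β i)) → P.HasSatakeParamAt v (∑ i, β i)) ∧
        ∀ i, ∀ᶠ v : HeightOneSpectrum (𝓞 F) in cofinite, ∀ b : Multiset ℂ,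
            (σ i).1.HasSatakeParamAt v b → ‖b.prod‖ = 1)
    (hJSb : JacquetShalika1981_partialPairL_boundary_repData)
    (hJSp : JacquetShalika1981_partialPairL_pole_repData)
    (hP11 : ∀ (F : Type) [Field F] [NumberField F]
      (hF : ∀ m : ℕ, isCompact_glFiniteIntegralLevel m F) (π : CuspidalAutomorphicRepData 4 F (hF 4))
      (Sπ : Set (HeightOneSpectrum (𝓞 F))) (α : SatakeFamily F), Sπ.Finite →
      (∀ w ∉ Sπ, π.1.HasSatakeParamAt w (α w)) → (∀ w ∉ Sπ, ‖(α w).prod‖ = 1) →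
      (∀ χ : HeckeCharacter F, ¬ ∀ᶠ v : HeightOneSpectrum (𝓞 F) in cofinite, ∀ a : Multiset ℂ,
          π.1.HasSatakeParamAt v a →
            a.map (fun x => x⁻¹) = a.map (fun x => χ.valueAtUniformizer v * x)) →
      ∀ (n : ℕ), (n = 1 ∨ n = 3) → ∀ (τ : CuspidalAutomorphicRepData n F (hF n))
        (Sτ : Set (HeightOneSpectrum (𝓞 F))) (β : SatakeFamily F), Sτ.Finite →
        (∀ w ∉ Sτ, τ.1.HasSatakeParamAt w (β w)) → (∀ w ∉ Sτ, ‖(β w).prod‖ = 1) →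
        ∃ S₁ : Set (HeightOneSpectrum (𝓞 F)), S₁.Finite ∧
          ∀ S : Set (HeightOneSpectrum (𝓞 F)), S.Finite → S₁ ⊆ S →
            ∃ d : ℂ, Tendsto (fun t : ℝ => partialPairL S (fun w => wedgeTwoParams (α w)) β (1 + t))
              (𝓝[>] (0 : ℝ)) (𝓝 d))
    (hP12 : ∀ (F : Type) [Field F] [NumberField F]
      (hF : ∀ m : ℕ, isCompact_glFiniteIntegralLevel m F) (π : CuspidalAutomorphicRepData 4 F (hF 4))
      (Sπ : Set (HeightOneSpectrum (𝓞 F))) (α : SatakeFamily F), Sπ.Finite →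
      (∀ w ∉ Sπ, π.1.HasSatakeParamAt w (α w)) → (∀ w ∉ Sπ, ‖(α w).prod‖ = 1) →
      (∀ χ : HeckeCharacter F, χ ≠ 1 → ¬ ∀ᶠ v : HeightOneSpectrum (𝓞 F) in cofinite,
          ∀ a : Multiset ℂ, π.1.HasSatakeParamAt v a →
            a.map (fun x => χ.valueAtUniformizer v * x) = a) →
      ∀ (τ : CuspidalAutomorphicRepData 2 F (hF 2))
        (Sτ : Set (HeightOneSpectrum (𝓞 F))) (β : SatakeFamily F), Sτ.Finite →
        (∀ w ∉ Sτ, τ.1.HasSatakeParamAt w (β w)) → (∀ w ∉ Sτ, ‖(β w).prod‖ = 1) →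
        ∃ S₁ : Set (HeightOneSpectrum (𝓞 F)), S₁.Finite ∧
          ∀ S : Set (HeightOneSpectrum (𝓞 F)), S.Finite → S₁ ⊆ S →
            ∃ d : ℂ, Tendsto (fun t : ℝ => partialPairL S (fun w => wedgeTwoParams (α w)) β (1 + t))
              (𝓝[>] (0 : ℝ)) (𝓝 d)) :
    AsgariRaghuram2007_selfDual_or_selfTwist_of_wedgeTwo_not_cuspidal := by
  refine AsgariRaghuram2007_selfDual_or_selfTwist_of_wedgeTwo_not_cuspidal_of_unitary ?_
  intro F _ _ hF π hunit hno
  obtain ⟨Sπ, α, hSπ, hπα, hu⟩ := hunit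
  by_contra hcon
  rw [not_or, not_exists, not_exists] at hcon
  obtain ⟨hnα, hnβ⟩ := hcon
  have hnβ' : ∀ χ : HeckeCharacter F, χ ≠ 1 → ¬ ∀ᶠ v : HeightOneSpectrum (𝓞 F) in cofinite,
      ∀ a : Multiset ℂ, π.1.HasSatakeParamAt v a →
        a.map (fun x => χ.valueAtUniformizer v * x) = a := fun χ hχ h => hnβ χ ⟨hχ, h⟩
  -- Kim's theorem with its unitarity clause
  obtain ⟨P, k, m, σ, hP, hsum, hdec, hunitσ⟩ := hKim F hF π ⟨Sπ, α, hSπ, hπα, hu⟩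
  -- Step 1: a summand of degree `1 ≤ m i₀ ≤ 3`
  obtain ⟨i₀, hi₀1, hi₀3⟩ := exists_degree_le_three_of_decomposition hF σ hP hsum hdec hno
  -- Satake families off a finite set, unitary
  obtain ⟨S₁, β, hS₁, hSπS₁, hβ, hrel⟩ :=
    exists_finite_families_wedgeTwo_eq_sum hF σ hSπ hπα hP hdec
  have hunitσ' : ∀ᶠ v : HeightOneSpectrum (𝓞 F) in cofinite, ∀ i, ∀ b : Multiset ℂ,
      (σ i).1.HasSatakeParamAt v b → ‖b.prod‖ = 1 := Filter.eventually_all.mpr hunitσ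
  rw [Filter.eventually_cofinite] at hunitσ'
  set S₂ : Set (HeightOneSpectrum (𝓞 F)) :=
    S₁ ∪ {v | ¬ ∀ i, ∀ b : Multiset ℂ, (σ i).1.HasSatakeParamAt v b → ‖b.prod‖ = 1} with hS₂def
  have hS₂ : S₂.Finite := hS₁.union hunitσ'
  have hS₁S₂ : S₁ ⊆ S₂ := Set.subset_union_left
  have hβ₂ : ∀ i, ∀ w ∉ S₂, (σ i).1.HasSatakeParamAt w (β i w) := fun i w hw =>
    hβ i w fun h => hw (hS₁S₂ h)
  have huβ₂ : ∀ i, ∀ w ∉ S₂, ‖(β i w).prod‖ = 1 := fun i w hw =>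
    (not_not.mp fun h => hw (Or.inr h)) i _ (hβ₂ i w hw)
  have hrel₂ : ∀ w ∉ S₂, wedgeTwoParams (α w) = ∑ i, β i w := fun w hw =>
    hrel w fun h => hw (hS₁S₂ h)
  -- drop the degree-`0` parts
  let ι : Type := {i : Fin k // 0 < m i}
  let i₀' : ι := ⟨i₀, hi₀1⟩
  have hA : ∀ w ∉ S₂, (fun w => wedgeTwoParams (α w)) w = ∑ i : ι, β i.1 w := by
    intro w hw
    simp only
    rw [hrel₂ w hw]
    exact sum_eq_sum_subtype_pos_of_card_eq (fun i => β i w) fun i => (hβ₂ i w hw).card_eq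
  -- the contragredient `τ` of `σ i₀`
  obtain ⟨τ, hτ⟩ :=
    CuspidalAutomorphicRepData.exists_contragredient_satake_holds (hF (m i₀)) (σ i₀)
  have hτ₂ : ∀ w ∉ S₂, τ.1.HasSatakeParamAt w ((β i₀ w).map (·⁻¹)) := fun w hw =>
    hτ w _ (hβ₂ i₀ w hw)
  have huτ₂ : ∀ w ∉ S₂, ‖((β i₀ w).map (·⁻¹)).prod‖ = 1 := fun w hw => by
    rw [Multiset.prod_map_inv', norm_inv, huβ₂ i₀ w hw, inv_one]
  -- Step 2: the pole of `L^S(s, ∧²π × τ)` at `s = 1`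
  obtain ⟨S₀, hS₀, hpole⟩ := not_tendsto_partialPairL_sum_dual hJSb hJSp
    (fun i : ι => σ i.1) (fun i => i.2) i₀' τ
  -- holomorphy at `s = 1` (Props. 11–12)
  have hhol : ∃ S₃ : Set (HeightOneSpectrum (𝓞 F)), S₃.Finite ∧
      ∀ S : Set (HeightOneSpectrum (𝓞 F)), S.Finite → S₃ ⊆ S →
        ∃ d : ℂ, Tendsto (fun t : ℝ => partialPairL S (fun w => wedgeTwoParams (α w))
          (fun w => (β i₀ w).map (·⁻¹)) (1 + t)) (𝓝[>] (0 : ℝ)) (𝓝 d) := by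
    have hSπ₂ : ∀ w ∉ S₂, π.1.HasSatakeParamAt w (α w) := fun w hw =>
      hπα w fun h => hw (hS₁S₂ (hSπS₁ h))
    have hu₂ : ∀ w ∉ S₂, ‖(α w).prod‖ = 1 := fun w hw => hu w fun h => hw (hS₁S₂ (hSπS₁ h))
    rcases (show m i₀ = 1 ∨ m i₀ = 2 ∨ m i₀ = 3 by omega) with h1 | h2 | h3
    · exact hP11 F hF π S₂ α hS₂ hSπ₂ hu₂ hnα (m i₀) (Or.inl h1) τ S₂ _ hS₂ hτ₂ huτ₂
    · obtain ⟨τ', hτ'⟩ := exists_cuspidal_eq_rank_hasSatakeParamAt_iff hF h2 τ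
      have hτ'₂ : ∀ w ∉ S₂, τ'.1.HasSatakeParamAt w ((β i₀ w).map (·⁻¹)) := fun w hw =>
        (hτ' w _).2 (hτ₂ w hw)
      exact hP12 F hF π S₂ α hS₂ hSπ₂ hu₂ hnβ' τ' S₂ _ hS₂ hτ'₂ huτ₂
    · exact hP11 F hF π S₂ α hS₂ hSπ₂ hu₂ hnα (m i₀) (Or.inr h3) τ S₂ _ hS₂ hτ₂ huτ₂
  obtain ⟨S₃, hS₃, hhol⟩ := hhol
  -- the common finite set and the contradiction
  set S : Set (HeightOneSpectrum (𝓞 F)) := S₂ ∪ (S₀ ∪ S₃) with hSdef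
  have hSfin : S.Finite := hS₂.union (hS₀.union hS₃)
  have hS₂S : S₂ ⊆ S := Set.subset_union_left
  have hS₀S : S₀ ⊆ S := Set.subset_union_left.trans Set.subset_union_right
  have hS₃S : S₃ ⊆ S := Set.subset_union_right.trans Set.subset_union_right
  obtain ⟨d, hd⟩ := hhol S hSfin hS₃S
  exact hpole hSfin hS₀S (β := fun i : ι => β i.1) (A := fun w => wedgeTwoParams (α w))
    (fun i w hw => hβ₂ i.1 w fun h => hw (hS₂S h))
    (fun i w hw => huβ₂ i.1 w fun h => hw (hS₂S h))
    (fun w hw => hτ₂ w fun h => hw (hS₂S h))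
    (fun w hw => hA w fun h => hw (hS₂S h)) d hd

/-- **Asgari–Raghuram 2007, §4, (i) ⇒ (iii) assembled modulo Kim's Theorem A, Jacquet–Shalika
(2.2)–(2.3) and ONE Langlands–Shahidi input** — the printed proof with Props. 11 and 12 now PROVED
(`tendsto_partialPairL_wedgeTwo_of_not_selfDual`, `tendsto_partialPairL_wedgeTwo_of_not_selfTwist`).
The hypotheses `hKim`, `hJSb`, `hJSp` are those of
`AsgariRaghuram2007_selfDual_or_selfTwist_of_wedgeTwo_not_cuspidal_of_kim_of_langlandsShahidi`;
`hLS` renders Props. 4 and 5 of the paper with eq. (2) of §2.3 (module docstring, remark (2)): for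
cuspidal `Π` on `GL(4, 𝔸_F)` and `σ` on `GL(n, 𝔸_F)`, `n = 1, 2, 3`, with unitary Satake families
`α`, `β` off finite sets, *if `w₀(σ ⊗ Π) ≇ σ ⊗ Π` then `L(s, Σ, r₁) = L(s, σ ⊗ Π, ρ_n ⊗ ∧²ρ₄)` is
entire* — `w₀(σ ⊗ Π) = σ̃ ⊗ (Π̃ ⊗ ω_σ)` (`n` odd), `σ̃ ⊗ (Π ⊗ ω_σ)` (`n` even) — read as: unless
`{aᵢ⁻¹} = {ω_σ(ϖ_v)^{±1} aᵢ}` a.e. (`n = 1, 3`), resp. `{ω_σ(ϖ_v) aᵢ} = {aᵢ}` a.e. (`n = 2`), on the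
Satake parameters of `Π`, where `ω_σ(ϖ_v) = ∏ β(v)`, the Euler product
`partialPairL S (∧² ∘ α) β` of `L^S(s, Π ⊗ σ, ∧² ⊗ ρ_n)` has a finite limit at `s → 1⁺` for every
finite `S` containing some finite `S₁`. Proof: the earlier assembly, its `hP11` supplied by Prop. 11
and its `hP12` by Prop. 12, both from `hLS`.
[cite: AsgariRaghuram2007, §4 (p. 10): Props. 11–12, with §2.3 Props. 4–5 and Thm. 3] [cite: Kim2002, Theorem A (p. 139)] -/
theorem AsgariRaghuram2007_selfDual_or_selfTwist_of_wedgeTwo_not_cuspidal_of_kim_of_LS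
    (hKim : ∀ (F : Type) [Field F] [NumberField F]
      (hF : ∀ m : ℕ, isCompact_glFiniteIntegralLevel m F) (π : CuspidalAutomorphicRepData 4 F (hF 4)),
      (∃ (S : Set (HeightOneSpectrum (𝓞 F))) (α : SatakeFamily F), S.Finite ∧
          (∀ w ∉ S, π.1.HasSatakeParamAt w (α w)) ∧ ∀ w ∉ S, ‖(α w).prod‖ = 1) →
      ∃ (P : AutomorphicRepData (AutomorphyDatum.gl 6 F (hF 6))) (k : ℕ) (m : Fin k → ℕ)
        (σ : ∀ i : Fin k, CuspidalAutomorphicRepData (m i) F (hF (m i))),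
        (∀ᶠ v : HeightOneSpectrum (𝓞 F) in cofinite, ∀ α : Multiset ℂ,
            π.1.HasSatakeParamAt v α → P.HasSatakeParamAt v (wedgeTwoParams α)) ∧
        (∑ i, m i = 6) ∧
        (∀ᶠ v : HeightOneSpectrum (𝓞 F) in cofinite, ∀ β : Fin k → Multiset ℂ,
            (∀ i, (σ i).1.HasSatakeParamAt v (β i)) → P.HasSatakeParamAt v (∑ i, β i)) ∧
        ∀ i, ∀ᶠ v : HeightOneSpectrum (𝓞 F) in cofinite, ∀ b : Multiset ℂ,
            (σ i).1.HasSatakeParamAt v b → ‖b.prod‖ = 1)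
    (hJSb : JacquetShalika1981_partialPairL_boundary_repData)
    (hJSp : JacquetShalika1981_partialPairL_pole_repData)
    (hLS : ∀ (F : Type) [Field F] [NumberField F]
      (hF : ∀ m : ℕ, isCompact_glFiniteIntegralLevel m F) (π : CuspidalAutomorphicRepData 4 F (hF 4))
      (Sπ : Set (HeightOneSpectrum (𝓞 F))) (α : SatakeFamily F), Sπ.Finite →
      (∀ w ∉ Sπ, π.1.HasSatakeParamAt w (α w)) → (∀ w ∉ Sπ, ‖(α w).prod‖ = 1) →
      ∀ (n : ℕ), (n = 1 ∨ n = 2 ∨ n = 3) → ∀ (σ : CuspidalAutomorphicRepData n F (hF n))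
        (Sσ : Set (HeightOneSpectrum (𝓞 F))) (β : SatakeFamily F), Sσ.Finite →
        (∀ w ∉ Sσ, σ.1.HasSatakeParamAt w (β w)) → (∀ w ∉ Sσ, ‖(β w).prod‖ = 1) →
        ((n = 1 ∨ n = 3) →
          (¬ ∀ᶠ v : HeightOneSpectrum (𝓞 F) in cofinite, ∀ a : Multiset ℂ,
              π.1.HasSatakeParamAt v a →
                a.map (fun x => x⁻¹) = a.map (fun x => (β v).prod * x)) ∧
          (¬ ∀ᶠ v : HeightOneSpectrum (𝓞 F) in cofinite, ∀ a : Multiset ℂ,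
              π.1.HasSatakeParamAt v a →
                a.map (fun x => x⁻¹) = a.map (fun x => ((β v).prod)⁻¹ * x))) →
        (n = 2 →
          ¬ ∀ᶠ v : HeightOneSpectrum (𝓞 F) in cofinite, ∀ a : Multiset ℂ,
              π.1.HasSatakeParamAt v a → a.map (fun x => (β v).prod * x) = a) →
        ∃ S₁ : Set (HeightOneSpectrum (𝓞 F)), S₁.Finite ∧
          ∀ S : Set (HeightOneSpectrum (𝓞 F)), S.Finite → S₁ ⊆ S →
            ∃ d : ℂ, Tendsto (fun t : ℝ => partialPairL S (fun w => wedgeTwoParams (α w)) β (1 + t))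
              (𝓝[>] (0 : ℝ)) (𝓝 d)) :
    AsgariRaghuram2007_selfDual_or_selfTwist_of_wedgeTwo_not_cuspidal := by
  refine AsgariRaghuram2007_selfDual_or_selfTwist_of_wedgeTwo_not_cuspidal_of_kim_of_langlandsShahidi
    hKim hJSb hJSp ?_ ?_
  · -- Prop. 11 from Props. 4–5 (`n = 1, 3`)
    intro F _ _ hF π Sπ α hSπ hπα hu hnα n hn τ Sτ β hSτ hτβ huβ
    exact tendsto_partialPairL_wedgeTwo_of_not_selfDual hnα
      (fun τ₁ Sτ₁ β₁ h₁ h₂ h₃ hw0 => hLS F hF π Sπ α hSπ hπα hu n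
        (hn.elim Or.inl fun h => Or.inr (Or.inr h)) τ₁ Sτ₁ β₁ h₁ h₂ h₃ (fun _ => hw0)
        (fun h2 => False.elim (by rcases hn with h | h <;> omega)))
      τ Sτ β hSτ hτβ huβ
  · -- Prop. 12 from Props. 4–5 (`n = 2`)
    intro F _ _ hF π Sπ α hSπ hπα hu hnβ τ Sτ β hSτ hτβ huβ
    exact tendsto_partialPairL_wedgeTwo_of_not_selfTwist hSπ hπα hu hnβ
      (fun π' Sπ' α' h₁ h₂ h₃ τ' Sτ' β' h₄ h₅ h₆ hw0 => hLS F hF π' Sπ' α' h₁ h₂ h₃ 2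
        (Or.inr (Or.inl rfl)) τ' Sτ' β' h₄ h₅ h₆ (fun h => False.elim (by omega)) (fun _ => hw0))
      rfl τ Sτ β hSτ hτβ huβ

/-- **Asgari–Raghuram 2007, §4, (i) ⇒ (iii) on the tree's named fact `Kim2003_exteriorSquare_GL4`
itself, modulo Jacquet–Shalika (2.2)–(2.3) and the two printed statements the tree does not name.**
The hypothesis `hKim` of `…_of_kim_of_LS` (Kim's Theorem A WITH its unitarity clause) is split into

* `hK : Kim2003_exteriorSquare_GL4` — the tree's weak Satake rendering of Theorem A (existence of
  the weak lift `P` and of cuspidal data `σᵢ` on `GL_{mᵢ}`, `∑ mᵢ = 6`, whose Satake parameters add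
  up to those of `P` almost everywhere), and
* `hU` — **the printed word "(unitary)" of Theorem A** (Kim, JAMS 16, p. 139: "In what follows, a
  cuspidal representation always means a unitary one"; Thm. 4.2.3 p. 156 and Thm. 5.3.1 p. 165:
  "`τᵢ` is a (unitary) cuspidal representation"; mechanism: (4.1) and Prop. 4.1.6, pp. 154–155,
  `r₁ = ⋯ = r_k = 0`), rendered universally: for `π` with a unitary Satake family, EVERY weak lift
  `P` and EVERY family of cuspidal data `σᵢ` as in `hK` have `‖∏ t_{σᵢ,v}‖ = 1` (`|ω_{σᵢ}(ϖ_v)| = 1`)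
  for almost all `v`. The universal form is implied by the printed clause: by uniqueness of Satake
  parameters (Flath, `AutomorphicRepData.hasSatakeParamAt_unique_holds`) such `σᵢ` satisfy
  `⊎ᵢ t_{σᵢ,v} = ∧² t_{π,v} = ⊎ⱼ t_{τⱼ,v}` a.e. with Kim's unitary `τⱼ`, and by the rigidity of
  isobaric sums for cuspidal data `σ⁰ ⊗ |det|^{s}` (Jacquet–Shalika II, Thm. 4.4 — the uniqueness
  half of the classification [J-S3] quoted in Kim's (4.1); the tree's `IsobaricRigidityRepData` is
  its cuspidal-versus-sum case) the `σᵢ` of positive degree are the `τⱼ` up to order and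
  near-equivalence; summands of degree `0` carry the empty parameter, `∏ ∅ = 1`.

`hJSb`, `hJSp`, `hLS` are as in `…_of_kim_of_LS` (`hLS` = Props. 4–5 of the paper with eq. (2)).
Proof: `hK` and `hU` together give `hKim`. So the fact rests on the three named facts
`Kim2003_exteriorSquare_GL4`, `JacquetShalika1981_partialPairL_boundary_repData`,
`JacquetShalika1981_partialPairL_pole_repData` and on the two unnamed printed inputs `hU`, `hLS`,
whose Lean texts are these binders.
[cite: AsgariRaghuram2007, §4 (p. 10): Props. 11–12, with §2.3 Props. 4–5 and Thm. 3] [cite: Kim2002, Theorem A (p. 139), Thm. 4.2.3 (p. 156), Thm. 5.3.1 (p. 165), Prop. 4.1.6 (p. 155)] -/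
theorem AsgariRaghuram2007_selfDual_or_selfTwist_of_wedgeTwo_not_cuspidal_of_kim_of_unitarySummands_of_LS
    (hK : Kim2003_exteriorSquare_GL4)
    (hU : ∀ (F : Type) [Field F] [NumberField F]
      (hF : ∀ m : ℕ, isCompact_glFiniteIntegralLevel m F) (π : CuspidalAutomorphicRepData 4 F (hF 4)),
      (∃ (S : Set (HeightOneSpectrum (𝓞 F))) (α : SatakeFamily F), S.Finite ∧
          (∀ w ∉ S, π.1.HasSatakeParamAt w (α w)) ∧ ∀ w ∉ S, ‖(α w).prod‖ = 1) →
      ∀ (P : AutomorphicRepData (AutomorphyDatum.gl 6 F (hF 6))) (k : ℕ) (m : Fin k → ℕ)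
        (σ : ∀ i : Fin k, CuspidalAutomorphicRepData (m i) F (hF (m i))),
        (∀ᶠ v : HeightOneSpectrum (𝓞 F) in cofinite, ∀ α : Multiset ℂ,
            π.1.HasSatakeParamAt v α → P.HasSatakeParamAt v (wedgeTwoParams α)) →
        (∑ i, m i = 6) →
        (∀ᶠ v : HeightOneSpectrum (𝓞 F) in cofinite, ∀ β : Fin k → Multiset ℂ,
            (∀ i, (σ i).1.HasSatakeParamAt v (β i)) → P.HasSatakeParamAt v (∑ i, β i)) →
        ∀ i, ∀ᶠ v : HeightOneSpectrum (𝓞 F) in cofinite, ∀ b : Multiset ℂ,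
          (σ i).1.HasSatakeParamAt v b → ‖b.prod‖ = 1)
    (hJSb : JacquetShalika1981_partialPairL_boundary_repData)
    (hJSp : JacquetShalika1981_partialPairL_pole_repData)
    (hLS : ∀ (F : Type) [Field F] [NumberField F]
      (hF : ∀ m : ℕ, isCompact_glFiniteIntegralLevel m F) (π : CuspidalAutomorphicRepData 4 F (hF 4))
      (Sπ : Set (HeightOneSpectrum (𝓞 F))) (α : SatakeFamily F), Sπ.Finite →
      (∀ w ∉ Sπ, π.1.HasSatakeParamAt w (α w)) → (∀ w ∉ Sπ, ‖(α w).prod‖ = 1) →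
      ∀ (n : ℕ), (n = 1 ∨ n = 2 ∨ n = 3) → ∀ (σ : CuspidalAutomorphicRepData n F (hF n))
        (Sσ : Set (HeightOneSpectrum (𝓞 F))) (β : SatakeFamily F), Sσ.Finite →
        (∀ w ∉ Sσ, σ.1.HasSatakeParamAt w (β w)) → (∀ w ∉ Sσ, ‖(β w).prod‖ = 1) →
        ((n = 1 ∨ n = 3) →
          (¬ ∀ᶠ v : HeightOneSpectrum (𝓞 F) in cofinite, ∀ a : Multiset ℂ,
              π.1.HasSatakeParamAt v a →
                a.map (fun x => x⁻¹) = a.map (fun x => (β v).prod * x)) ∧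
          (¬ ∀ᶠ v : HeightOneSpectrum (𝓞 F) in cofinite, ∀ a : Multiset ℂ,
              π.1.HasSatakeParamAt v a →
                a.map (fun x => x⁻¹) = a.map (fun x => ((β v).prod)⁻¹ * x))) →
        (n = 2 →
          ¬ ∀ᶠ v : HeightOneSpectrum (𝓞 F) in cofinite, ∀ a : Multiset ℂ,
              π.1.HasSatakeParamAt v a → a.map (fun x => (β v).prod * x) = a) →
        ∃ S₁ : Set (HeightOneSpectrum (𝓞 F)), S₁.Finite ∧
          ∀ S : Set (HeightOneSpectrum (𝓞 F)), S.Finite → S₁ ⊆ S →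
            ∃ d : ℂ, Tendsto (fun t : ℝ => partialPairL S (fun w => wedgeTwoParams (α w)) β (1 + t))
              (𝓝[>] (0 : ℝ)) (𝓝 d)) :
    AsgariRaghuram2007_selfDual_or_selfTwist_of_wedgeTwo_not_cuspidal := by
  refine AsgariRaghuram2007_selfDual_or_selfTwist_of_wedgeTwo_not_cuspidal_of_kim_of_LS ?_ hJSb hJSp hLS
  intro F _ _ hF π hπ
  obtain ⟨P, hP, k, m, σ, hsum, hdec⟩ := hK F hF π
  exact ⟨P, k, m, σ, hP, hsum, hdec, hU F hF π hπ P k m σ hP hsum hdec⟩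

/-- **The same for the two other renderings of the printed implication** (`Y` =
`AsgariRaghuram2007_notCuspidal_wedgeTwo_imp`, consumed by the crux `InducedSquareAscent`, and `Z` =
`AsgariRaghuram_wedgeTwo_notCuspidal_GL4`), through the equivalences of this file: both rest on the
same three named facts and the same two unnamed printed inputs.
[cite: AsgariRaghuram2007, Theorem 1 (i) ⇒ (iii); §4 Props. 11–12] -/
theorem notCuspidal_wedgeTwo_imp_and_wedgeTwo_notCuspidal_GL4_of_kim_of_unitarySummands_of_LS
    (hK : Kim2003_exteriorSquare_GL4)
    (hU : ∀ (F : Type) [Field F] [NumberField F]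
      (hF : ∀ m : ℕ, isCompact_glFiniteIntegralLevel m F) (π : CuspidalAutomorphicRepData 4 F (hF 4)),
      (∃ (S : Set (HeightOneSpectrum (𝓞 F))) (α : SatakeFamily F), S.Finite ∧
          (∀ w ∉ S, π.1.HasSatakeParamAt w (α w)) ∧ ∀ w ∉ S, ‖(α w).prod‖ = 1) →
      ∀ (P : AutomorphicRepData (AutomorphyDatum.gl 6 F (hF 6))) (k : ℕ) (m : Fin k → ℕ)
        (σ : ∀ i : Fin k, CuspidalAutomorphicRepData (m i) F (hF (m i))),
        (∀ᶠ v : HeightOneSpectrum (𝓞 F) in cofinite, ∀ α : Multiset ℂ,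
            π.1.HasSatakeParamAt v α → P.HasSatakeParamAt v (wedgeTwoParams α)) →
        (∑ i, m i = 6) →
        (∀ᶠ v : HeightOneSpectrum (𝓞 F) in cofinite, ∀ β : Fin k → Multiset ℂ,
            (∀ i, (σ i).1.HasSatakeParamAt v (β i)) → P.HasSatakeParamAt v (∑ i, β i)) →
        ∀ i, ∀ᶠ v : HeightOneSpectrum (𝓞 F) in cofinite, ∀ b : Multiset ℂ,
          (σ i).1.HasSatakeParamAt v b → ‖b.prod‖ = 1)
    (hJSb : JacquetShalika1981_partialPairL_boundary_repData)
    (hJSp : JacquetShalika1981_partialPairL_pole_repData)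
    (hLS : ∀ (F : Type) [Field F] [NumberField F]
      (hF : ∀ m : ℕ, isCompact_glFiniteIntegralLevel m F) (π : CuspidalAutomorphicRepData 4 F (hF 4))
      (Sπ : Set (HeightOneSpectrum (𝓞 F))) (α : SatakeFamily F), Sπ.Finite →
      (∀ w ∉ Sπ, π.1.HasSatakeParamAt w (α w)) → (∀ w ∉ Sπ, ‖(α w).prod‖ = 1) →
      ∀ (n : ℕ), (n = 1 ∨ n = 2 ∨ n = 3) → ∀ (σ : CuspidalAutomorphicRepData n F (hF n))
        (Sσ : Set (HeightOneSpectrum (𝓞 F))) (β : SatakeFamily F), Sσ.Finite →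
        (∀ w ∉ Sσ, σ.1.HasSatakeParamAt w (β w)) → (∀ w ∉ Sσ, ‖(β w).prod‖ = 1) →
        ((n = 1 ∨ n = 3) →
          (¬ ∀ᶠ v : HeightOneSpectrum (𝓞 F) in cofinite, ∀ a : Multiset ℂ,
              π.1.HasSatakeParamAt v a →
                a.map (fun x => x⁻¹) = a.map (fun x => (β v).prod * x)) ∧
          (¬ ∀ᶠ v : HeightOneSpectrum (𝓞 F) in cofinite, ∀ a : Multiset ℂ,
              π.1.HasSatakeParamAt v a →
                a.map (fun x => x⁻¹) = a.map (fun x => ((β v).prod)⁻¹ * x))) →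
        (n = 2 →
          ¬ ∀ᶠ v : HeightOneSpectrum (𝓞 F) in cofinite, ∀ a : Multiset ℂ,
              π.1.HasSatakeParamAt v a → a.map (fun x => (β v).prod * x) = a) →
        ∃ S₁ : Set (HeightOneSpectrum (𝓞 F)), S₁.Finite ∧
          ∀ S : Set (HeightOneSpectrum (𝓞 F)), S.Finite → S₁ ⊆ S →
            ∃ d : ℂ, Tendsto (fun t : ℝ => partialPairL S (fun w => wedgeTwoParams (α w)) β (1 + t))
              (𝓝[>] (0 : ℝ)) (𝓝 d)) :
    AsgariRaghuram2007_notCuspidal_wedgeTwo_imp ∧ AsgariRaghuram_wedgeTwo_notCuspidal_GL4 :=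
  have hT := AsgariRaghuram2007_selfDual_or_selfTwist_of_wedgeTwo_not_cuspidal_of_kim_of_unitarySummands_of_LS
    hK hU hJSb hJSp hLS
  ⟨AsgariRaghuram2007_selfDual_or_selfTwist_of_wedgeTwo_not_cuspidal_iff_notCuspidal_wedgeTwo_imp.mp hT,
    AsgariRaghuram2007_selfDual_or_selfTwist_of_wedgeTwo_not_cuspidal_iff_wedgeTwo_notCuspidal_GL4.mp hT⟩

end Assembly

/-! ### The unitarity clause eliminated: the extremal-slope device with Prop. 4 read as "entire" -/

section EntireLS

variable {F : Type} [Field F] [NumberField F]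

/-- **Prop. 11 from the Langlands–Shahidi input, with an arbitrary conclusion.** The printed two
lines of Prop. 11 (p. 10: "it is enough to show that `w₀(Σ) ≇ Σ` … by Prop. 5,
`w₀(σ ⊗ Π) ≅ σ̃ ⊗ (Π̃ ⊗ ω_σ)`; in particular `Π ≅ Π̃ ⊗ ω_σ`, contradicting the hypothesis") only
VERIFY the hypothesis of Prop. 4 for `(Π, τ)`; what Prop. 4 then delivers is immaterial to them.
Hence the same proof as `tendsto_partialPairL_wedgeTwo_of_not_selfDual` gives the conclusion `R τ Sτ β`
of any Langlands–Shahidi input `hLSodd` of the shape "unless `{aᵢ⁻¹} = {ω_τ(ϖ_v)^{±1} aᵢ}` a.e. on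
the Satake parameters of `Π` (`ω_τ(ϖ_v) = ∏ β(v)`), `R τ Sτ β`", from the Satake-level negation of
clause (α) (`hnα`): the central character `Ω` of `τ` is a Hecke character with `Ω(ϖ_v) = ∏ t_{τ,v}`
(`AutomorphicRepData.exists_heckeCharacter_valueAtUniformizer_eq_prod`), so the excluded identities
are clause (α) with `χ = Ω^{±1}`. Used below with `R` = "finite limit of the Euler product at every
`Re z ≥ 1`" (Prop. 4 as printed: `L(s, Σ, r₁)` is ENTIRE).
[cite: AsgariRaghuram2007, §4 Prop. 11 (with §2.3 Props. 4–5)] -/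
theorem langlandsShahidi_apply_of_not_selfDual
    {hF : ∀ m : ℕ, isCompact_glFiniteIntegralLevel m F}
    {π : CuspidalAutomorphicRepData 4 F (hF 4)} {n : ℕ}
    {R : CuspidalAutomorphicRepData n F (hF n) → Set (HeightOneSpectrum (𝓞 F)) →
      SatakeFamily F → Prop}
    (hnα : ∀ χ : HeckeCharacter F, ¬ ∀ᶠ v : HeightOneSpectrum (𝓞 F) in cofinite, ∀ a : Multiset ℂ,
        π.1.HasSatakeParamAt v a →
          a.map (fun x => x⁻¹) = a.map (fun x => χ.valueAtUniformizer v * x))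
    (hLSodd : ∀ (τ : CuspidalAutomorphicRepData n F (hF n)) (Sτ : Set (HeightOneSpectrum (𝓞 F)))
        (β : SatakeFamily F), Sτ.Finite → (∀ w ∉ Sτ, τ.1.HasSatakeParamAt w (β w)) →
        (∀ w ∉ Sτ, ‖(β w).prod‖ = 1) →
        ((¬ ∀ᶠ v : HeightOneSpectrum (𝓞 F) in cofinite, ∀ a : Multiset ℂ, π.1.HasSatakeParamAt v a →
            a.map (fun x => x⁻¹) = a.map (fun x => (β v).prod * x)) ∧
         (¬ ∀ᶠ v : HeightOneSpectrum (𝓞 F) in cofinite, ∀ a : Multiset ℂ, π.1.HasSatakeParamAt v a →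
            a.map (fun x => x⁻¹) = a.map (fun x => ((β v).prod)⁻¹ * x))) →
        R τ Sτ β)
    (τ : CuspidalAutomorphicRepData n F (hF n)) (Sτ : Set (HeightOneSpectrum (𝓞 F)))
    (β : SatakeFamily F) (hSτ : Sτ.Finite) (hτβ : ∀ w ∉ Sτ, τ.1.HasSatakeParamAt w (β w))
    (huβ : ∀ w ∉ Sτ, ‖(β w).prod‖ = 1) :
    R τ Sτ β := by
  obtain ⟨Ω, hΩ⟩ := τ.1.exists_heckeCharacter_valueAtUniformizer_eq_prod
  refine hLSodd τ Sτ β hSτ hτβ huβ ⟨fun H => hnα Ω ?_, fun H => hnα Ω⁻¹ ?_⟩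
  · filter_upwards [H, hSτ.eventually_cofinite_notMem] with v hv hvS a ha
    rw [(hΩ v _ (hτβ v hvS)).2]
    exact hv a ha
  · filter_upwards [H, hSτ.eventually_cofinite_notMem] with v hv hvS a ha
    rw [valueAtUniformizer_inv_eq, (hΩ v _ (hτβ v hvS)).2]
    exact hv a ha

/-- **Prop. 12 from the Langlands–Shahidi input, both halves, with an arbitrary conclusion
predicate of the Euler product.** As for Prop. 11: the printed proof of Prop. 12 (p. 10; the case
`ω_σ ≠ 1` directly, the case `ω_σ = 1` through the twist `Π ↦ Π ⊗ θ`, `σ ↦ σ ⊗ θ⁻²` with `θ⁴ ≠ 1`)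
verifies the hypothesis of Prop. 4, for `(Π, τ)` or for the twisted pair, and the Euler product of
the twisted pair IS that of `(Π, τ)` (`∧²(θ a) ⊗ θ⁻² b = ∧² a ⊗ b`, `wedgeTwoParams_map_mul`,
`eval_satakePairPolynomial_map_mul_map_mul`), for every `S` and every `s`. So the proof of
`tendsto_partialPairL_wedgeTwo_of_not_selfTwist` yields `R L` for the Euler product
`L = (S, s) ↦ partialPairL S (∧² ∘ α) β s` and ANY predicate `R` of it that the Langlands–Shahidi
input `hLS2` asserts under "`{ω_{τ'}(ϖ_v) aᵢ} ≠ {aᵢ}` a.e.". (`θ = ‖·‖^{s₀}`,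
`s₀ = iπ / (4 log q_{v₀})`, `exists_heckeCharacter_ideleNorm_cpow`; the self-twist of `Π ⊗ θ` by
`ω_{τ ⊗ θ⁻²}` would be the self-twist of `Π` by `‖·‖^{-4s₀} ≠ 1`, `map_mul_eq_self_of_twist`.)
[cite: AsgariRaghuram2007, §4 Prop. 12 (with §2.3 Props. 4–5)] [cite: TateThesis1967, §4.3 (the characters `‖·‖^s`)] -/
theorem langlandsShahidi_apply_of_not_selfTwist
    {hF : ∀ m : ℕ, isCompact_glFiniteIntegralLevel m F}
    {π : CuspidalAutomorphicRepData 4 F (hF 4)} {Sπ : Set (HeightOneSpectrum (𝓞 F))}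
    (hSπ : Sπ.Finite) {α : SatakeFamily F} (hπα : ∀ w ∉ Sπ, π.1.HasSatakeParamAt w (α w))
    (hu : ∀ w ∉ Sπ, ‖(α w).prod‖ = 1)
    (hnβ : ∀ χ : HeckeCharacter F, χ ≠ 1 → ¬ ∀ᶠ v : HeightOneSpectrum (𝓞 F) in cofinite,
        ∀ a : Multiset ℂ, π.1.HasSatakeParamAt v a →
          a.map (fun x => χ.valueAtUniformizer v * x) = a)
    {R : (Set (HeightOneSpectrum (𝓞 F)) → ℂ → ℂ) → Prop}
    (hLS2 : ∀ (π' : CuspidalAutomorphicRepData 4 F (hF 4)) (Sπ' : Set (HeightOneSpectrum (𝓞 F)))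
        (α' : SatakeFamily F), Sπ'.Finite → (∀ w ∉ Sπ', π'.1.HasSatakeParamAt w (α' w)) →
        (∀ w ∉ Sπ', ‖(α' w).prod‖ = 1) →
        ∀ (τ' : CuspidalAutomorphicRepData 2 F (hF 2)) (Sτ' : Set (HeightOneSpectrum (𝓞 F)))
          (β' : SatakeFamily F), Sτ'.Finite → (∀ w ∉ Sτ', τ'.1.HasSatakeParamAt w (β' w)) →
          (∀ w ∉ Sτ', ‖(β' w).prod‖ = 1) →
          (¬ ∀ᶠ v : HeightOneSpectrum (𝓞 F) in cofinite, ∀ a : Multiset ℂ,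
              π'.1.HasSatakeParamAt v a → a.map (fun x => (β' v).prod * x) = a) →
          R (fun S s => partialPairL S (fun w => wedgeTwoParams (α' w)) β' s))
    {n : ℕ} (hn : n = 2) (τ : CuspidalAutomorphicRepData n F (hF n))
    (Sτ : Set (HeightOneSpectrum (𝓞 F))) (β : SatakeFamily F) (hSτ : Sτ.Finite)
    (hτβ : ∀ w ∉ Sτ, τ.1.HasSatakeParamAt w (β w)) (huβ : ∀ w ∉ Sτ, ‖(β w).prod‖ = 1) :
    R (fun S s => partialPairL S (fun w => wedgeTwoParams (α w)) β s) := by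
  subst hn
  by_cases H : ∀ᶠ v : HeightOneSpectrum (𝓞 F) in cofinite, ∀ a : Multiset ℂ,
      π.1.HasSatakeParamAt v a → a.map (fun x => (β v).prod * x) = a
  swap
  · -- `ω_σ ≠ 1` (on the Satake parameters of `Π`): Props. 4–5 apply to `(Π, τ)` itself
    exact hLS2 π Sπ α hSπ hπα hu τ Sτ β hSτ hτβ huβ H
  -- `ω_σ = 1`: the twisting trick, with `θ = ‖·‖^{s₀}`, `s₀ = iπ / (4 log q_{v₀})`
  obtain ⟨v₀⟩ := (nonempty_heightOneSpectrum' : Nonempty (HeightOneSpectrum (𝓞 F)))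
  have hq₀ : (1 : ℝ) < (v₀.residueCard : ℝ) := by exact_mod_cast v₀.one_lt_residueCard
  have hlog : Real.log (v₀.residueCard : ℝ) ≠ 0 := (Real.log_pos hq₀).ne'
  set t₀ : ℝ := Real.pi / (4 * Real.log (v₀.residueCard : ℝ)) with ht₀
  set s₀ : ℂ := (t₀ : ℂ) * Complex.I with hs₀
  have hs₀re : s₀.re = 0 := by simp [hs₀]
  obtain ⟨θ, hθ⟩ := exists_heckeCharacter_ideleNorm_cpow F s₀
  obtain ⟨ψ, hψ⟩ := exists_heckeCharacter_ideleNorm_cpow F (-(2 * s₀))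
  obtain ⟨χ, hχ⟩ := exists_heckeCharacter_ideleNorm_cpow F (-(4 * s₀))
  have hθv : ∀ v : HeightOneSpectrum (𝓞 F),
      θ.valueAtUniformizer v = ((v.residueCard : ℂ) ^ s₀)⁻¹ :=
    HeckeCharacter.valueAtUniformizer_of_cpow hθ
  have hψv : ∀ v : HeightOneSpectrum (𝓞 F),
      ψ.valueAtUniformizer v = ((v.residueCard : ℂ) ^ (-(2 * s₀)))⁻¹ :=
    HeckeCharacter.valueAtUniformizer_of_cpow hψ
  have hχv : ∀ v : HeightOneSpectrum (𝓞 F),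
      χ.valueAtUniformizer v = ((v.residueCard : ℂ) ^ (-(4 * s₀)))⁻¹ :=
    HeckeCharacter.valueAtUniformizer_of_cpow hχ
  have hθnorm : ∀ v : HeightOneSpectrum (𝓞 F), ‖θ.valueAtUniformizer v‖ = 1 := fun v => by
    rw [hθv, norm_inv, norm_residueCard_cpow_of_re_eq_zero v hs₀re, inv_one]
  have hψnorm : ∀ v : HeightOneSpectrum (𝓞 F), ‖ψ.valueAtUniformizer v‖ = 1 := fun v => by
    rw [hψv, norm_inv, norm_residueCard_cpow_of_re_eq_zero v (by simp [hs₀re]), inv_one]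
  have hθne : ∀ v : HeightOneSpectrum (𝓞 F), θ.valueAtUniformizer v ≠ 0 := fun v => by
    rw [hθv]; exact inv_ne_zero (residueCard_cpow_ne_zero v _)
  -- `θ(ϖ_v)² ψ(ϖ_v) = 1`, `ψ(ϖ_v)² = χ(ϖ_v)`, and `χ(ϖ_{v₀}) = -1` (so `χ ≠ 1`)
  have hθψ : ∀ v : HeightOneSpectrum (𝓞 F),
      θ.valueAtUniformizer v ^ 2 * ψ.valueAtUniformizer v = 1 := fun v => by
    rw [hθv, hψv, inv_pow, residueCard_cpow_sq, Complex.cpow_neg, inv_inv,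
      inv_mul_cancel₀ (residueCard_cpow_ne_zero v _)]
  have hψχ : ∀ v : HeightOneSpectrum (𝓞 F),
      ψ.valueAtUniformizer v ^ 2 = χ.valueAtUniformizer v := fun v => by
    rw [hψv, hχv, inv_pow, residueCard_cpow_sq]
    have e : (2 : ℂ) * -(2 * s₀) = -(4 * s₀) := by ring
    rw [e]
  have hχ1 : χ ≠ 1 := by
    intro h1
    have hval := hχv v₀
    rw [h1, valueAtUniformizer_one_eq] at hval
    have hexp : (v₀.residueCard : ℂ) ^ (-(4 * s₀)) = -1 := by
      rw [Complex.cpow_def_of_ne_zero (residueCard_ne_zero' v₀), ← Complex.natCast_log]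
      have hreal : Real.log (v₀.residueCard : ℝ) * (4 * t₀) = Real.pi := by
        rw [ht₀]
        field_simp
      have hcast : (Real.log (v₀.residueCard : ℝ) : ℂ) * (4 * (t₀ : ℂ)) = (Real.pi : ℂ) := by
        exact_mod_cast hreal
      have harg : (Real.log (v₀.residueCard : ℝ) : ℂ) * -(4 * s₀) = -((Real.pi : ℂ) * Complex.I) := by
        rw [hs₀, ← hcast]
        ring
      rw [harg, Complex.exp_neg, Complex.exp_pi_mul_I]
      norm_num
    rw [hexp] at hval
    norm_num at hval
  -- the cuspidal twists `Π ⊗ θ`, `τ ⊗ ψ` (`ψ = θ⁻²` at every uniformizer) and their families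
  haveI : NeZero (4 : ℕ) := ⟨by norm_num⟩
  haveI : NeZero (2 : ℕ) := ⟨by norm_num⟩
  obtain ⟨π', hπ'⟩ := CuspidalAutomorphicRepData.exists_twist_hecke_hasSatakeParamAt θ π
  obtain ⟨τ', hτ'⟩ := CuspidalAutomorphicRepData.exists_twist_hecke_hasSatakeParamAt ψ τ
  have hπ'fin := hπ'
  have hτ'fin := hτ'
  rw [Filter.eventually_cofinite] at hπ'fin hτ'fin
  set Sπ' : Set (HeightOneSpectrum (𝓞 F)) := Sπ ∪ {v | ¬ ∀ a : Multiset ℂ,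
    π.1.HasSatakeParamAt v a →
      π'.1.HasSatakeParamAt v (a.map (θ.valueAtUniformizer v * ·))} with hSπ'def
  set Sτ' : Set (HeightOneSpectrum (𝓞 F)) := Sτ ∪ {v | ¬ ∀ a : Multiset ℂ,
    τ.1.HasSatakeParamAt v a →
      τ'.1.HasSatakeParamAt v (a.map (ψ.valueAtUniformizer v * ·))} with hSτ'def
  have hSπ'fin : Sπ'.Finite := hSπ.union hπ'fin
  have hSτ'fin : Sτ'.Finite := hSτ.union hτ'fin
  set α' : SatakeFamily F := fun w => (α w).map (θ.valueAtUniformizer w * ·) with hα'def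
  set β' : SatakeFamily F := fun w => (β w).map (ψ.valueAtUniformizer w * ·) with hβ'def
  have hπ'α' : ∀ w ∉ Sπ', π'.1.HasSatakeParamAt w (α' w) := fun w hw =>
    (not_not.mp fun h => hw (Or.inr h)) _ (hπα w fun h => hw (Or.inl h))
  have hτ'β' : ∀ w ∉ Sτ', τ'.1.HasSatakeParamAt w (β' w) := fun w hw =>
    (not_not.mp fun h => hw (Or.inr h)) _ (hτβ w fun h => hw (Or.inl h))
  have hu' : ∀ w ∉ Sπ', ‖(α' w).prod‖ = 1 := fun w hw => by
    rw [hα'def, prod_map_const_mul, norm_mul, norm_pow, hθnorm, one_pow, one_mul]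
    exact hu w fun h => hw (Or.inl h)
  have huβ' : ∀ w ∉ Sτ', ‖(β' w).prod‖ = 1 := fun w hw => by
    rw [hβ'def, prod_map_const_mul, norm_mul, norm_pow, hψnorm, one_pow, one_mul]
    exact huβ w fun h => hw (Or.inl h)
  -- `Π ⊗ θ ≇ (Π ⊗ θ) ⊗ ω_{τ ⊗ ψ}` on Satake parameters: it would be the self-twist of `Π` by `χ ≠ 1`
  have hw0 : ¬ ∀ᶠ v : HeightOneSpectrum (𝓞 F) in cofinite, ∀ a : Multiset ℂ,
      π'.1.HasSatakeParamAt v a → a.map (fun x => (β' v).prod * x) = a := by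
    intro K
    refine hnβ χ hχ1 ?_
    filter_upwards [K, H, hπ', hSτ.eventually_cofinite_notMem] with v hK hH htw hvτ a ha
    have h1 := hK _ (htw a ha)
    have h2 := hH a ha
    have hcard : Multiset.card (β v) = 2 := (hτβ v hvτ).card_eq
    have hprod : (β' v).prod = χ.valueAtUniformizer v * (β v).prod := by
      rw [hβ'def, prod_map_const_mul, hcard, hψχ]
    exact map_mul_eq_self_of_twist (hθne v) h1 h2 hprod
  -- Props. 4–5 for the twisted pair; its Euler product is that of `(Π, τ)`, for every `S` and `s`
  have hcon := hLS2 π' Sπ' α' hSπ'fin hπ'α' hu' τ' Sτ' β' hSτ'fin hτ'β' huβ' hw0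
  have hfun : (fun S s => partialPairL S (fun w => wedgeTwoParams (α' w)) β' s) =
      fun S s => partialPairL S (fun w => wedgeTwoParams (α w)) β s := by
    funext S s
    simp only [partialPairL]
    refine tprod_congr fun v => ?_
    rw [hα'def, hβ'def]
    simp only
    rw [wedgeTwoParams_map_mul, eval_satakePairPolynomial_map_mul_map_mul, hθψ v.1, one_mul]
  rw [hfun] at hcon
  exact hcon

/-- **Clause (α) passes to the contragredient** (Satake level): if no Hecke character `χ` makes
`{aᵢ⁻¹} = {χ(ϖ_v) aᵢ}` hold a.e. on the parameters of `π` (family `α` off `Sπ`), then none does on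
those of a datum `π̃` carrying `α(w)⁻¹` off `Sπ` — the identity for `π̃` and `χ` is the identity for
`π` and `χ⁻¹` (`(χ a⁻¹)⁻¹ = χ⁻¹ a`; uniqueness of parameters,
`AutomorphicRepData.hasSatakeParamAt_unique_holds`). Asgari–Raghuram, p. 3: (iii) is stable under
`Π ↦ Π̃`. [cite: AsgariRaghuram2007, §1 (Theorem 1 and the remarks before it)] -/
theorem not_eventually_selfDual_of_contragredient
    {n : ℕ} {hcpt : isCompact_glFiniteIntegralLevel n F}
    {π πd : AutomorphicRepData (AutomorphyDatum.gl n F hcpt)}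
    {Sπ : Set (HeightOneSpectrum (𝓞 F))} (hSπ : Sπ.Finite) {α : SatakeFamily F}
    (hπα : ∀ w ∉ Sπ, π.HasSatakeParamAt w (α w))
    (hπd : ∀ w ∉ Sπ, πd.HasSatakeParamAt w ((α w).map (·⁻¹)))
    (hnα : ∀ χ : HeckeCharacter F, ¬ ∀ᶠ v : HeightOneSpectrum (𝓞 F) in cofinite, ∀ a : Multiset ℂ,
        π.HasSatakeParamAt v a →
          a.map (fun x => x⁻¹) = a.map (fun x => χ.valueAtUniformizer v * x))
    (χ : HeckeCharacter F) :
    ¬ ∀ᶠ v : HeightOneSpectrum (𝓞 F) in cofinite, ∀ a : Multiset ℂ,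
        πd.HasSatakeParamAt v a →
          a.map (fun x => x⁻¹) = a.map (fun x => χ.valueAtUniformizer v * x) := by
  intro H
  refine hnα χ⁻¹ ?_
  filter_upwards [H, hSπ.eventually_cofinite_notMem] with v hv hvS a ha
  have haα : a = α v := AutomorphicRepData.hasSatakeParamAt_unique_holds π ha (hπα v hvS)
  have h := hv _ (hπd v hvS)
  rw [Multiset.map_map, Multiset.map_map] at h
  have hid : (α v).map ((fun x : ℂ => x⁻¹) ∘ fun x : ℂ => x⁻¹) = α v := by
    conv_rhs => rw [← Multiset.map_id (α v)]
    exact Multiset.map_congr rfl fun x _ => by simp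
  rw [hid] at h
  rw [haα, valueAtUniformizer_inv_eq]
  calc (α v).map (fun x => x⁻¹)
        = ((α v).map ((fun x => χ.valueAtUniformizer v * x) ∘ fun x : ℂ => x⁻¹)).map
            (fun x => x⁻¹) := by rw [← h]
    _ = (α v).map (fun x => (χ.valueAtUniformizer v)⁻¹ * x) := by
        rw [Multiset.map_map]
        exact Multiset.map_congr rfl fun x _ => by simp [mul_comm]

/-- **Clause (β) passes to the contragredient** (Satake level): a self-twist
`{χ(ϖ_v) bᵢ} = {bᵢ}` a.e. of a datum `π̃` carrying `α(w)⁻¹` off `Sπ`, by `χ ≠ 1`, would be the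
self-twist of `π` (family `α`) by `χ⁻¹ ≠ 1` (invert entrywise; uniqueness of parameters).
Asgari–Raghuram, p. 3. [cite: AsgariRaghuram2007, §1 (Theorem 1 and the remarks before it)] -/
theorem not_eventually_selfTwist_of_contragredient
    {n : ℕ} {hcpt : isCompact_glFiniteIntegralLevel n F}
    {π πd : AutomorphicRepData (AutomorphyDatum.gl n F hcpt)}
    {Sπ : Set (HeightOneSpectrum (𝓞 F))} (hSπ : Sπ.Finite) {α : SatakeFamily F}
    (hπα : ∀ w ∉ Sπ, π.HasSatakeParamAt w (α w))
    (hπd : ∀ w ∉ Sπ, πd.HasSatakeParamAt w ((α w).map (·⁻¹)))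
    (hnβ : ∀ χ : HeckeCharacter F, χ ≠ 1 → ¬ ∀ᶠ v : HeightOneSpectrum (𝓞 F) in cofinite,
        ∀ a : Multiset ℂ, π.HasSatakeParamAt v a →
          a.map (fun x => χ.valueAtUniformizer v * x) = a)
    (χ : HeckeCharacter F) (hχ : χ ≠ 1) :
    ¬ ∀ᶠ v : HeightOneSpectrum (𝓞 F) in cofinite, ∀ a : Multiset ℂ,
        πd.HasSatakeParamAt v a → a.map (fun x => χ.valueAtUniformizer v * x) = a := by
  intro H
  refine hnβ χ⁻¹ (fun h1 => hχ (inv_eq_one.mp h1)) ?_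
  filter_upwards [H, hSπ.eventually_cofinite_notMem] with v hv hvS a ha
  have haα : a = α v := AutomorphicRepData.hasSatakeParamAt_unique_holds π ha (hπα v hvS)
  have h := hv _ (hπd v hvS)
  rw [Multiset.map_map] at h
  have h' := congrArg (Multiset.map fun x : ℂ => x⁻¹) h
  rw [Multiset.map_map, Multiset.map_map] at h'
  have hid : (α v).map ((fun x : ℂ => x⁻¹) ∘ fun x : ℂ => x⁻¹) = α v := by
    conv_rhs => rw [← Multiset.map_id (α v)]
    exact Multiset.map_congr rfl fun x _ => by simp
  rw [hid] at h'
  rw [haα, valueAtUniformizer_inv_eq]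
  calc (α v).map (fun x => (χ.valueAtUniformizer v)⁻¹ * x)
        = (α v).map ((fun x : ℂ => x⁻¹) ∘ ((fun x => χ.valueAtUniformizer v * x) ∘
            fun x : ℂ => x⁻¹)) :=
          Multiset.map_congr rfl fun x _ => by simp [mul_comm]
    _ = α v := h'

/-- **The pole against the finiteness side, off the unitary axis** (the device of
`IsobaricRigidityRepData`, i.e. of Arthur–Clozel, Ch. 3, proof of Thm. 4.2 (d), and of Kim's
Prop. 4.1.6: take the summand of extremal real twist). Data: cuspidal `σᵢᵘ` on `GL_{mᵢ}(𝔸_F)`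
(`i : ι` finite, `mᵢ ≥ 1`) with UNITARY Satake families `γᵢ` off a finite `S₁`, complex exponents
`sᵢ`, and a family `A` (the Hecke matrices of `ρ = ⊞ᵢ σᵢᵘ ⊗ |det|^{sᵢ}`, below `A = ∧² α`) with
`A(w) = ∑ᵢ q_w^{sᵢ} γᵢ(w)` off `S₁`; an index `i₀` with `Re sᵢ ≤ Re s_{i₀}` for all `i` and
`Re s_{i₀} ≥ 0`; and the FINITENESS SIDE `hhol` for the degree `m_{i₀}`: for every cuspidal `τ` on
`GL_{m_{i₀}}` with a unitary family `β`, the Euler product `partialPairL S A β` has a finite limit at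
`z⁺` along `t ↦ z + t` for every `Re z ≥ 1` and every finite `S` beyond some finite `S₃`. Then:
contradiction. Proof: with `τ = σ̃ᵘ_{i₀}` (family `γ_{i₀}⁻¹`,
`CuspidalAutomorphicRepData.exists_contragredient_satake_holds`), `u₀ = 1 + s_{i₀}` (`Re u₀ ≥ 1`) and
`zᵢ = 1 + s_{i₀} - sᵢ` (`Re zᵢ ≥ 1`, `z_{i₀} = 1`), multiplicativity of the Rankin–Selberg polynomial
(`satakePairPolynomial_sum_left`, `eval_satakePairPolynomial_map_mul_left`) and (2.1)
(`JacquetShalika1981_multipliable_partialPairL_repData_holds`) give, for real `t > 0`,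
`L^S(u₀ + t, A ⊗ γ_{i₀}⁻¹) = ∏ᵢ L^S(zᵢ + t, γᵢ ⊗ γ_{i₀}⁻¹)`; each factor has a finite NON-ZERO limit
after multiplication by some `t^{eᵢ}` (`exists_tendsto_pow_mul_partialPairL_ofReal_add`: interior
point, Jacquet–Shalika I Thm. 5.3, or (2.2) `hJSb`, or (2.3) `hJSp`), with `e_{i₀} = 1`
(`exists_tendsto_ofReal_mul_partialPairL_dual`, (2.3) at `s = 1`); so `t^E ·` RHS `→ ∏ cᵢ ≠ 0` with
`E ≥ 1`, while `t^E ·` LHS `→ 0` by `hhol` at `z = u₀`.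
[cite: ArthurClozelAMS120, Ch. 3 §2 (2.1)–(2.3) and proof of Thm. 4.2 (d), pp. 206–207] [cite: Kim2002, Prop. 4.1.6 (p. 155)] -/
theorem false_of_wedgeTwo_decomposition_of_maximal_slope
    (hJSb : JacquetShalika1981_partialPairL_boundary_repData)
    (hJSp : JacquetShalika1981_partialPairL_pole_repData)
    {hF : ∀ m : ℕ, isCompact_glFiniteIntegralLevel m F}
    {A : SatakeFamily F} {S₁ : Set (HeightOneSpectrum (𝓞 F))} (hS₁ : S₁.Finite)
    {ι : Type*} [Fintype ι] {m : ι → ℕ} (hm0 : ∀ i, 0 < m i)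
    (σu : ∀ i, CuspidalAutomorphicRepData (m i) F (hF (m i)))
    {γ : ι → SatakeFamily F} (hγ : ∀ i, ∀ w ∉ S₁, (σu i).1.HasSatakeParamAt w (γ i w))
    (huγ : ∀ i, ∀ w ∉ S₁, ‖(γ i w).prod‖ = 1) {s : ι → ℂ}
    (hdec : ∀ w ∉ S₁, A w = ∑ i, (γ i w).map ((((w.residueCard : ℂ) ^ (s i))) * ·))
    (i₀ : ι) (hmax : ∀ i, (s i).re ≤ (s i₀).re) (h0 : 0 ≤ (s i₀).re)
    (hhol : ∀ (τ : CuspidalAutomorphicRepData (m i₀) F (hF (m i₀)))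
        (Sτ : Set (HeightOneSpectrum (𝓞 F))) (β : SatakeFamily F), Sτ.Finite →
        (∀ w ∉ Sτ, τ.1.HasSatakeParamAt w (β w)) → (∀ w ∉ Sτ, ‖(β w).prod‖ = 1) →
        ∃ S₃ : Set (HeightOneSpectrum (𝓞 F)), S₃.Finite ∧
          ∀ S : Set (HeightOneSpectrum (𝓞 F)), S.Finite → S₃ ⊆ S → ∀ z : ℂ, 1 ≤ z.re →
            ∃ d : ℂ, Tendsto (fun t : ℝ => partialPairL S A β (z + t)) (𝓝[>] (0 : ℝ)) (𝓝 d)) :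
    False := by
  have hq0 : ∀ w : HeightOneSpectrum (𝓞 F), ((w.residueCard : ℕ) : ℂ) ≠ 0 := fun w =>
    Nat.cast_ne_zero.mpr (zero_lt_one.trans w.one_lt_residueCard).ne'
  -- the contragredient `τ` of `σu i₀`, with the unitary family `γ i₀ ⁻¹`
  obtain ⟨τ, hτ⟩ :=
    CuspidalAutomorphicRepData.exists_contragredient_satake_holds (hF (m i₀)) (σu i₀)
  set αd : SatakeFamily F := fun w => (γ i₀ w).map (·⁻¹) with hαd
  have hτd : ∀ w ∉ S₁, τ.1.HasSatakeParamAt w (αd w) := fun w hw => hτ w _ (hγ i₀ w hw)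
  have hud : ∀ w ∉ S₁, ‖(αd w).prod‖ = 1 := fun w hw => by
    simp only [hαd]
    rw [Multiset.prod_map_inv', norm_inv, huγ i₀ w hw, inv_one]
  -- the analytic inputs for the pairs `(σu i, τ)`
  have hAn : ∀ i, ∃ S₀ : Set (HeightOneSpectrum (𝓞 F)), S₀.Finite ∧
      ∀ {S' : Set (HeightOneSpectrum (𝓞 F))} (_hS : S'.Finite) (_hS₀ : S₀ ⊆ S')
        {α' β' : SatakeFamily F} (_hα : ∀ w ∉ S', (σu i).1.HasSatakeParamAt w (α' w))
        (_hβ : ∀ w ∉ S', τ.1.HasSatakeParamAt w (β' w))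
        (_hu : ∀ w ∉ S', ‖(α' w).prod‖ = 1) (_hu' : ∀ w ∉ S', ‖(β' w).prod‖ = 1)
        {z : ℂ} (_hz : 1 ≤ z.re),
        ∃ (e : ℕ) (c : ℂ), c ≠ 0 ∧ (m i ≠ m i₀ → e = 0) ∧
          Tendsto (fun t : ℝ => (t : ℂ) ^ e * partialPairL S' α' β' (z + t)) (𝓝[>] (0 : ℝ))
            (𝓝 c) := fun i =>
    exists_tendsto_pow_mul_partialPairL_ofReal_add hJSb hJSp (hm0 i) (hm0 i₀) (σu i) τ
  choose SA hSAfin hSA using hAn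
  obtain ⟨SB, hSBfin, hSB⟩ := exists_tendsto_ofReal_mul_partialPairL_dual hJSp (hm0 i₀) (σu i₀) τ
  have h21 : ∀ i, ∃ S₀ : Set (HeightOneSpectrum (𝓞 F)), S₀.Finite ∧
      ∀ {S' : Set (HeightOneSpectrum (𝓞 F))} (_hS : S'.Finite) (_hS₀ : S₀ ⊆ S')
        {α' β' : SatakeFamily F} (_hα : ∀ w ∉ S', (σu i).1.HasSatakeParamAt w (α' w))
        (_hβ : ∀ w ∉ S', τ.1.HasSatakeParamAt w (β' w))
        (_hu : ∀ w ∉ S', ‖(α' w).prod‖ = 1) (_hu' : ∀ w ∉ S', ‖(β' w).prod‖ = 1)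
        {z : ℂ} (_hs : 1 < z.re),
        Multipliable fun v : {v : HeightOneSpectrum (𝓞 F) // v ∉ S'} =>
          ((satakePairPolynomial (α' v.1) (β' v.1)).eval ((v.1.residueCard : ℂ) ^ (-z)))⁻¹ :=
    fun i => JacquetShalika1981_multipliable_partialPairL_repData_holds (m i) (m i₀) F (hF (m i))
      (hF (m i₀)) (hm0 i) (hm0 i₀) (σu i) τ
  choose S2 hS2fin hS2 using h21
  -- the finiteness side for `τ`, family `αd` off `S₁`
  obtain ⟨S₃, hS₃fin, hS₃⟩ := hhol τ S₁ αd hS₁ hτd hud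
  -- the finite set `S` absorbing everything
  set S : Set (HeightOneSpectrum (𝓞 F)) := S₁ ∪ (S₃ ∪ (SB ∪ ((⋃ i, SA i) ∪ ⋃ i, S2 i)))
    with hSdef
  have hSfin : S.Finite :=
    hS₁.union (hS₃fin.union (hSBfin.union ((Set.finite_iUnion hSAfin).union
      (Set.finite_iUnion hS2fin))))
  have hS₁S : S₁ ⊆ S := Set.subset_union_left
  have hS₃S : S₃ ⊆ S := Set.subset_union_left.trans Set.subset_union_right
  have hSBS : SB ⊆ S :=
    (Set.subset_union_left.trans Set.subset_union_right).trans Set.subset_union_right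
  have hSAS : ∀ i, SA i ⊆ S := fun i =>
    (((Set.subset_iUnion SA i).trans Set.subset_union_left).trans Set.subset_union_right).trans
      (Set.subset_union_right.trans Set.subset_union_right)
  have hS2S : ∀ i, S2 i ⊆ S := fun i =>
    (((Set.subset_iUnion S2 i).trans Set.subset_union_right).trans Set.subset_union_right).trans
      (Set.subset_union_right.trans Set.subset_union_right)
  have hnot₁ : ∀ w ∉ S, w ∉ S₁ := fun w hw h => hw (hS₁S h)
  have hγS : ∀ i, ∀ w ∉ S, (σu i).1.HasSatakeParamAt w (γ i w) := fun i w hw =>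
    hγ i w (hnot₁ w hw)
  have huS : ∀ i, ∀ w ∉ S, ‖(γ i w).prod‖ = 1 := fun i w hw => huγ i w (hnot₁ w hw)
  have hτS : ∀ w ∉ S, τ.1.HasSatakeParamAt w (αd w) := fun w hw => hτd w (hnot₁ w hw)
  have hudS : ∀ w ∉ S, ‖(αd w).prod‖ = 1 := fun w hw => hud w (hnot₁ w hw)
  -- the points `u₀ = 1 + s i₀`, `z i = 1 + s i₀ - s i` (all with `Re ≥ 1`)
  set u₀ : ℂ := 1 + s i₀ with hu₀def
  set z : ι → ℂ := fun i => 1 + s i₀ - s i with hzdef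
  have hu₀re : 1 ≤ u₀.re := by
    simp only [hu₀def, Complex.add_re, Complex.one_re]
    linarith
  have hzre : ∀ i, 1 ≤ (z i).re := fun i => by
    simp only [hzdef, Complex.add_re, Complex.sub_re, Complex.one_re]
    linarith [hmax i]
  have hzi₀ : z i₀ = 1 := by simp [hzdef]
  -- limits of the factors
  have hfac : ∀ i, ∃ (e : ℕ) (c : ℂ), c ≠ 0 ∧ (i = i₀ → e = 1) ∧
      Tendsto (fun t : ℝ => (t : ℂ) ^ e * partialPairL S (γ i) αd (z i + t)) (𝓝[>] (0 : ℝ))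
        (𝓝 c) := by
    intro i
    by_cases hi : i = i₀
    · subst hi
      obtain ⟨c, hc, ht⟩ := hSB hSfin hSBS (hγS i) hτS (huS i) hudS (fun w _ => rfl)
      refine ⟨1, c, hc, fun _ => rfl, ?_⟩
      simpa only [hzi₀, pow_one] using ht
    · obtain ⟨e, c, hc, -, ht⟩ := hSA i hSfin (hSAS i) (hγS i) hτS (huS i) hudS (hzre i)
      exact ⟨e, c, hc, fun h => (hi h).elim, ht⟩
  choose e c hc hei₀ hF' using hfac
  -- the left-hand side has a finite limit at `u₀` (the finiteness side)
  obtain ⟨d, hG⟩ := hS₃ S hSfin hS₃S u₀ hu₀re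
  -- the Euler-product identity for real `t > 0`
  have hident : ∀ t : ℝ, 0 < t →
      partialPairL S A αd (u₀ + t) = ∏ i, partialPairL S (γ i) αd (z i + t) := by
    intro t ht
    have hmul : ∀ i, Multipliable fun v : {v : HeightOneSpectrum (𝓞 F) // v ∉ S} =>
        ((satakePairPolynomial (γ i v.1) (αd v.1)).eval
          ((v.1.residueCard : ℂ) ^ (-(z i + t))))⁻¹ := fun i =>
      hS2 i hSfin (hS2S i) (hγS i) hτS (huS i) hudS (z := z i + t)
        (by simp only [Complex.add_re, Complex.ofReal_re]; linarith [hzre i])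
    have hloc : ∀ v : {v : HeightOneSpectrum (𝓞 F) // v ∉ S},
        ((satakePairPolynomial (A v.1) (αd v.1)).eval ((v.1.residueCard : ℂ) ^ (-(u₀ + t))))⁻¹ =
          ∏ i, ((satakePairPolynomial (γ i v.1) (αd v.1)).eval
            ((v.1.residueCard : ℂ) ^ (-(z i + t))))⁻¹ := by
      intro v
      rw [hdec v.1 (hnot₁ v.1 v.2), satakePairPolynomial_sum_left, Polynomial.eval_prod,
        ← Finset.prod_inv_distrib]
      refine Finset.prod_congr rfl fun i _ => ?_
      rw [eval_satakePairPolynomial_map_mul_left, ← Complex.cpow_add _ _ (hq0 v.1)]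
      congr 3
      simp only [hzdef, hu₀def]
      ring
    simp only [partialPairL]
    rw [tprod_congr hloc]
    exact Multipliable.tprod_finsetProd fun i _ => hmul i
  -- the contradiction
  set E : ℕ := ∑ i, e i with hEdef
  have hE : 1 ≤ E := by
    rw [hEdef, ← hei₀ i₀ rfl]
    exact Finset.single_le_sum (fun i _ => Nat.zero_le (e i)) (Finset.mem_univ i₀)
  have hC : (∏ i, c i) ≠ 0 := Finset.prod_ne_zero_iff.mpr fun i _ => hc i
  have hR : Tendsto (fun t : ℝ => (t : ℂ) ^ E * ∏ i, partialPairL S (γ i) αd (z i + t))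
      (𝓝[>] (0 : ℝ)) (𝓝 (∏ i, c i)) := by
    have h := tendsto_finsetProd Finset.univ fun i (_ : i ∈ Finset.univ) => hF' i
    refine h.congr fun t => ?_
    rw [Finset.prod_mul_distrib, Finset.prod_pow_eq_pow_sum]
  have hL : Tendsto (fun t : ℝ => (t : ℂ) ^ E * partialPairL S A αd (u₀ + t))
      (𝓝[>] (0 : ℝ)) (𝓝 0) := by
    have h0' : Tendsto (fun t : ℝ => (t : ℂ) ^ E) (𝓝[>] (0 : ℝ)) (𝓝 0) := by
      have : Tendsto (fun t : ℝ => (t : ℂ)) (𝓝[>] (0 : ℝ)) (𝓝 0) := by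
        have h := (Complex.continuous_ofReal.tendsto (0 : ℝ)).mono_left
          (nhdsWithin_le_nhds (s := Set.Ioi (0 : ℝ)))
        simpa using h
      simpa [zero_pow (by omega : E ≠ 0)] using this.pow E
    simpa using h0'.mul hG
  have hL' : Tendsto (fun t : ℝ => (t : ℂ) ^ E * ∏ i, partialPairL S (γ i) αd (z i + t))
      (𝓝[>] (0 : ℝ)) (𝓝 0) := by
    refine hL.congr' ?_
    filter_upwards [self_mem_nhdsWithin] with t ht
    rw [hident t ht]
  exact hC (tendsto_nhds_unique hR hL')

/-- **Asgari–Raghuram 2007, §4, (i) ⇒ (iii) on the tree's named fact `Kim2003_exteriorSquare_GL4`,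
Jacquet–Shalika (2.2)–(2.3), and ONE Langlands–Shahidi input — the unitarity clause `hU` of
`…_of_kim_of_unitarySummands_of_LS` ELIMINATED.** Here `hLS` is Props. 4 and 5 of the paper with
eq. (2) of §2.3 exactly as in `…_of_kim_of_LS` (same binders: cuspidal `Π` on `GL(4)` and `σ` on
`GL(n)`, `n = 1, 2, 3`, with unitary Satake families; the same Satake-level exclusions
`{aᵢ⁻¹} ≠ {ω_σ(ϖ_v)^{±1} aᵢ}`, resp. `{ω_σ(ϖ_v) aᵢ} ≠ {aᵢ}`, a.e.), except that its conclusion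
renders Prop. 4 AS PRINTED — *"`L(s, Σ, r₁)` is entire"*, not merely holomorphic at `s = 1`: the
Euler product `partialPairL S (∧² ∘ α) β` of `L^S(s, Π ⊗ σ, ∧² ⊗ ρ_n)` has a finite limit along
`t ↦ z + t`, `t → 0⁺`, at EVERY `z` with `Re z ≥ 1`, for every finite `S` beyond some finite `S₁`
(module docstring, remark (4): same provenance as the rendering at `z = 1` — the Euler product agrees
with the entire function `L^S` on `Re s > 1`, where it is `∏ⱼ L^S(s, τⱼ × σ)` over Kim's unitary
cuspidal summands `τⱼ` of `∧²Π`, absolutely convergent by Jacquet–Shalika I, Thm. 5.3).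

Proof. Reduce to unitary `π` (`…_of_unitary`) and assume neither (α) nor (β). `hK` gives the weak
lift and cuspidal `σᵢ` on `GL_{mᵢ}` (`∑ mᵢ = 6`) with `∧² t_{π,v} = ⊎ᵢ t_{σᵢ,v}` a.e.; step 1
(`exists_degree_le_three_of_decomposition`) gives an index of degree `1 ≤ mᵢ ≤ 3`. Normalise each
`σᵢ` of positive degree: `t_{σᵢ,w} = q_w^{sᵢ} γᵢ(w)` with `γᵢ` the unitary family of a cuspidal
`σᵢᵘ` (Borel–Jacquet 5.7, `CuspidalAutomorphicRepData.exists_unitary_avatar`), so that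
`∧² α(w) = ∑ᵢ q_w^{sᵢ} γᵢ(w)` off a finite set, and `∑ᵢ mᵢ Re sᵢ = 0` (`‖∏ ∧² α‖ = ‖∏ α‖³ = 1`,
`prod_wedgeTwoParams_of_card_eq_four`; `‖∏ γᵢ‖ = 1`). If some maximiser `i₀` of `Re sᵢ` has degree
`≤ 3` (so `Re s_{i₀} ≥ 0`), `false_of_wedgeTwo_decomposition_of_maximal_slope` applies to `π`, its
finiteness side in degree `m_{i₀}` being Prop. 11 (`m_{i₀} = 1, 3`) or Prop. 12 (`m_{i₀} = 2`) from
`hLS` at every `Re z ≥ 1` (`langlandsShahidi_apply_of_not_selfDual`,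
`langlandsShahidi_apply_of_not_selfTwist`). Otherwise the unique maximiser is the summand of degree
`≥ 4`, every other positive-degree index has degree `≤ 2`, and a minimiser `i₀` (`Re s_{i₀} ≤ 0`) is
one of them; then the same lemma applies to the CONTRAGREDIENT `π̃`
(`CuspidalAutomorphicRepData.exists_contragredient_satake_holds`; unitary family `α⁻¹`,
`∧²(α⁻¹) = (∧² α)⁻¹ = ∑ᵢ q^{-sᵢ} γᵢ⁻¹`, `wedgeTwoParams_map_inv`, the `γᵢ⁻¹` being unitary families
of the contragredients `σ̃ᵢᵘ`; exponents `-sᵢ`, of which `i₀` is a maximiser with `Re (-s_{i₀}) ≥ 0`),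
whose Satake parameters satisfy neither (α) nor (β) either
(`not_eventually_selfDual_of_contragredient`, `not_eventually_selfTwist_of_contragredient`). So the
fact rests on the three named facts `Kim2003_exteriorSquare_GL4`,
`JacquetShalika1981_partialPairL_boundary_repData`, `JacquetShalika1981_partialPairL_pole_repData`
and on ONE unnamed printed input, `hLS`, whose Lean text is this binder.
[cite: AsgariRaghuram2007, §4 (p. 10): Props. 11–12, with §2.3 Prop. 4 ("entire"), Prop. 5, eq. (2), and Thm. 3] [cite: Kim2002, Theorem A (p. 139), Prop. 4.1.6 (p. 155)] [cite: ArthurClozelAMS120, Ch. 3, proof of Thm. 4.2 (d), pp. 206–207] -/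
theorem AsgariRaghuram2007_selfDual_or_selfTwist_of_wedgeTwo_not_cuspidal_of_kim_of_entireLS
    (hK : Kim2003_exteriorSquare_GL4)
    (hJSb : JacquetShalika1981_partialPairL_boundary_repData)
    (hJSp : JacquetShalika1981_partialPairL_pole_repData)
    (hLS : ∀ (F : Type) [Field F] [NumberField F]
      (hF : ∀ m : ℕ, isCompact_glFiniteIntegralLevel m F) (π : CuspidalAutomorphicRepData 4 F (hF 4))
      (Sπ : Set (HeightOneSpectrum (𝓞 F))) (α : SatakeFamily F), Sπ.Finite →
      (∀ w ∉ Sπ, π.1.HasSatakeParamAt w (α w)) → (∀ w ∉ Sπ, ‖(α w).prod‖ = 1) →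
      ∀ (n : ℕ), (n = 1 ∨ n = 2 ∨ n = 3) → ∀ (σ : CuspidalAutomorphicRepData n F (hF n))
        (Sσ : Set (HeightOneSpectrum (𝓞 F))) (β : SatakeFamily F), Sσ.Finite →
        (∀ w ∉ Sσ, σ.1.HasSatakeParamAt w (β w)) → (∀ w ∉ Sσ, ‖(β w).prod‖ = 1) →
        ((n = 1 ∨ n = 3) →
          (¬ ∀ᶠ v : HeightOneSpectrum (𝓞 F) in cofinite, ∀ a : Multiset ℂ,
              π.1.HasSatakeParamAt v a →
                a.map (fun x => x⁻¹) = a.map (fun x => (β v).prod * x)) ∧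
          (¬ ∀ᶠ v : HeightOneSpectrum (𝓞 F) in cofinite, ∀ a : Multiset ℂ,
              π.1.HasSatakeParamAt v a →
                a.map (fun x => x⁻¹) = a.map (fun x => ((β v).prod)⁻¹ * x))) →
        (n = 2 →
          ¬ ∀ᶠ v : HeightOneSpectrum (𝓞 F) in cofinite, ∀ a : Multiset ℂ,
              π.1.HasSatakeParamAt v a → a.map (fun x => (β v).prod * x) = a) →
        ∃ S₁ : Set (HeightOneSpectrum (𝓞 F)), S₁.Finite ∧
          ∀ S : Set (HeightOneSpectrum (𝓞 F)), S.Finite → S₁ ⊆ S → ∀ z : ℂ, 1 ≤ z.re →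
            ∃ d : ℂ, Tendsto (fun t : ℝ => partialPairL S (fun w => wedgeTwoParams (α w)) β (z + t))
              (𝓝[>] (0 : ℝ)) (𝓝 d)) :
    AsgariRaghuram2007_selfDual_or_selfTwist_of_wedgeTwo_not_cuspidal := by
  refine AsgariRaghuram2007_selfDual_or_selfTwist_of_wedgeTwo_not_cuspidal_of_unitary ?_
  intro F _ _ hF π hunit hno
  obtain ⟨Sπ, α, hSπ, hπα, hu⟩ := hunit
  by_contra hcon
  rw [not_or, not_exists, not_exists] at hcon
  obtain ⟨hnα, hnβ⟩ := hcon
  have hnβ' : ∀ χ : HeckeCharacter F, χ ≠ 1 → ¬ ∀ᶠ v : HeightOneSpectrum (𝓞 F) in cofinite,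
      ∀ a : Multiset ℂ, π.1.HasSatakeParamAt v a →
        a.map (fun x => χ.valueAtUniformizer v * x) = a := fun χ hχ h => hnβ χ ⟨hχ, h⟩
  have hq1 : ∀ w : HeightOneSpectrum (𝓞 F), (1 : ℝ) < (w.residueCard : ℝ) := fun w => by
    exact_mod_cast w.one_lt_residueCard
  -- the finiteness side (Props. 11–12 from `hLS`, at every `Re z ≥ 1`) for any cuspidal `π'` on
  -- `GL(4)` with a unitary family and the Satake-level negations of (α) and (β), in degree `n ≤ 3`
  have key : ∀ (π' : CuspidalAutomorphicRepData 4 F (hF 4)) (Sπ' : Set (HeightOneSpectrum (𝓞 F)))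
      (α' : SatakeFamily F), Sπ'.Finite → (∀ w ∉ Sπ', π'.1.HasSatakeParamAt w (α' w)) →
      (∀ w ∉ Sπ', ‖(α' w).prod‖ = 1) →
      (∀ χ : HeckeCharacter F, ¬ ∀ᶠ v : HeightOneSpectrum (𝓞 F) in cofinite, ∀ a : Multiset ℂ,
          π'.1.HasSatakeParamAt v a →
            a.map (fun x => x⁻¹) = a.map (fun x => χ.valueAtUniformizer v * x)) →
      (∀ χ : HeckeCharacter F, χ ≠ 1 → ¬ ∀ᶠ v : HeightOneSpectrum (𝓞 F) in cofinite,
          ∀ a : Multiset ℂ, π'.1.HasSatakeParamAt v a →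
            a.map (fun x => χ.valueAtUniformizer v * x) = a) →
      ∀ n : ℕ, (1 ≤ n ∧ n ≤ 3) → ∀ (τ : CuspidalAutomorphicRepData n F (hF n))
        (Sτ : Set (HeightOneSpectrum (𝓞 F))) (β : SatakeFamily F), Sτ.Finite →
        (∀ w ∉ Sτ, τ.1.HasSatakeParamAt w (β w)) → (∀ w ∉ Sτ, ‖(β w).prod‖ = 1) →
        ∃ S₃ : Set (HeightOneSpectrum (𝓞 F)), S₃.Finite ∧
          ∀ S : Set (HeightOneSpectrum (𝓞 F)), S.Finite → S₃ ⊆ S → ∀ z : ℂ, 1 ≤ z.re →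
            ∃ d : ℂ, Tendsto
              (fun t : ℝ => partialPairL S (fun w => wedgeTwoParams (α' w)) β (z + t))
              (𝓝[>] (0 : ℝ)) (𝓝 d) := by
    intro π' Sπ' α' hSπ' hπα' hu' hnα' hnβ'' n hn τ Sτ β hSτ hτβ huβ
    rcases (show n = 1 ∨ n = 2 ∨ n = 3 by omega) with h1 | h2 | h3
    · exact langlandsShahidi_apply_of_not_selfDual
        (R := fun (τ : CuspidalAutomorphicRepData n F (hF n)) (_Sτ : Set (HeightOneSpectrum (𝓞 F)))
          (β : SatakeFamily F) => ∃ S₃ : Set (HeightOneSpectrum (𝓞 F)), S₃.Finite ∧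
            ∀ S : Set (HeightOneSpectrum (𝓞 F)), S.Finite → S₃ ⊆ S → ∀ z : ℂ, 1 ≤ z.re →
              ∃ d : ℂ, Tendsto
                (fun t : ℝ => partialPairL S (fun w => wedgeTwoParams (α' w)) β (z + t))
                (𝓝[>] (0 : ℝ)) (𝓝 d))
        hnα' (fun τ₁ Sτ₁ β₁ h₁ h₂ h₃ hw0 => hLS F hF π' Sπ' α' hSπ' hπα' hu' n (Or.inl h1)
          τ₁ Sτ₁ β₁ h₁ h₂ h₃ (fun _ => hw0) (fun h2 => False.elim (by omega)))
        τ Sτ β hSτ hτβ huβ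
    · exact langlandsShahidi_apply_of_not_selfTwist hSπ' hπα' hu' hnβ''
        (R := fun L => ∃ S₃ : Set (HeightOneSpectrum (𝓞 F)), S₃.Finite ∧
            ∀ S : Set (HeightOneSpectrum (𝓞 F)), S.Finite → S₃ ⊆ S → ∀ z : ℂ, 1 ≤ z.re →
              ∃ d : ℂ, Tendsto (fun t : ℝ => L S (z + t)) (𝓝[>] (0 : ℝ)) (𝓝 d))
        (fun π'' Sπ'' α'' h₁ h₂ h₃ τ' Sτ' β' h₄ h₅ h₆ hw0 => hLS F hF π'' Sπ'' α'' h₁ h₂ h₃ 2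
          (Or.inr (Or.inl rfl)) τ' Sτ' β' h₄ h₅ h₆ (fun h => False.elim (by omega))
          (fun _ => hw0))
        h2 τ Sτ β hSτ hτβ huβ
    · exact langlandsShahidi_apply_of_not_selfDual
        (R := fun (τ : CuspidalAutomorphicRepData n F (hF n)) (_Sτ : Set (HeightOneSpectrum (𝓞 F)))
          (β : SatakeFamily F) => ∃ S₃ : Set (HeightOneSpectrum (𝓞 F)), S₃.Finite ∧
            ∀ S : Set (HeightOneSpectrum (𝓞 F)), S.Finite → S₃ ⊆ S → ∀ z : ℂ, 1 ≤ z.re →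
              ∃ d : ℂ, Tendsto
                (fun t : ℝ => partialPairL S (fun w => wedgeTwoParams (α' w)) β (z + t))
                (𝓝[>] (0 : ℝ)) (𝓝 d))
        hnα' (fun τ₁ Sτ₁ β₁ h₁ h₂ h₃ hw0 => hLS F hF π' Sπ' α' hSπ' hπα' hu' n
          (Or.inr (Or.inr h3)) τ₁ Sτ₁ β₁ h₁ h₂ h₃ (fun _ => hw0)
          (fun h2 => False.elim (by omega)))
        τ Sτ β hSτ hτβ huβ
  -- Kim's theorem (the weak Satake rendering `hK`) and step 1
  obtain ⟨P, hP, k, m, σ, hsum, hdec⟩ := hK F hF π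
  obtain ⟨i₁, hi₁1, hi₁3⟩ := exists_degree_le_three_of_decomposition hF σ hP hsum hdec hno
  -- Satake families off a finite set
  obtain ⟨S₁, β, hS₁, hSπS₁, hβ, hrel⟩ :=
    exists_finite_families_wedgeTwo_eq_sum hF σ hSπ hπα hP hdec
  -- positive-degree indices and the unitary avatars `σᵢ = σᵢᵘ ⊗ |det|^{sᵢ}` of their `σ i`
  let ι : Type := {i : Fin k // 0 < m i}
  have hav : ∀ i : ι, ∃ (s : ℂ) (S : Set (HeightOneSpectrum (𝓞 F))) (γ : SatakeFamily F)
      (σu : CuspidalAutomorphicRepData (m i.1) F (hF (m i.1))), S.Finite ∧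
      (∀ w ∉ S, ∀ b : Multiset ℂ,
        (σ i.1).1.HasSatakeParamAt w b ↔ b = (γ w).map (((w.residueCard : ℂ) ^ s) * ·)) ∧
      (∀ w ∉ S, σu.1.HasSatakeParamAt w (γ w)) ∧
      (∀ w ∉ S, ‖(γ w).prod‖ = 1) ∧ (∀ w ∉ S, Multiset.card (γ w) = m i.1) := fun i => by
    haveI : NeZero (m i.1) := ⟨(i.2).ne'⟩
    exact (σ i.1).exists_unitary_avatar (hF (m i.1))
  choose s Sa γ σu hSafin hiff hσu huγ hcard using hav
  set S₂ : Set (HeightOneSpectrum (𝓞 F)) := S₁ ∪ ⋃ i, Sa i with hS₂def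
  have hS₂ : S₂.Finite := hS₁.union (Set.finite_iUnion hSafin)
  have hS₂₁ : ∀ w ∉ S₂, w ∉ S₁ := fun w hw h => hw (Or.inl h)
  have hS₂a : ∀ w ∉ S₂, ∀ i, w ∉ Sa i := fun w hw i h =>
    hw (Or.inr (Set.mem_iUnion.mpr ⟨i, h⟩))
  have hS₂π : ∀ w ∉ S₂, w ∉ Sπ := fun w hw h => hS₂₁ w hw (hSπS₁ h)
  have hγ₂ : ∀ i, ∀ w ∉ S₂, (σu i).1.HasSatakeParamAt w (γ i w) := fun i w hw =>
    hσu i w (hS₂a w hw i)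
  have huγ₂ : ∀ i, ∀ w ∉ S₂, ‖(γ i w).prod‖ = 1 := fun i w hw => huγ i w (hS₂a w hw i)
  -- `∧² α(w) = ∑ i, q^{s i} γ i (w)` off `S₂`
  have hdec₂ : ∀ w ∉ S₂, wedgeTwoParams (α w) =
      ∑ i : ι, (γ i w).map ((((w.residueCard : ℂ) ^ (s i))) * ·) := by
    intro w hw
    rw [hrel w (hS₂₁ w hw), sum_eq_sum_subtype_pos_of_card_eq (fun i => β i w)
      fun i => (hβ i w (hS₂₁ w hw)).card_eq]
    exact Finset.sum_congr rfl fun i _ => (hiff i w (hS₂a w hw i) _).1 (hβ i.1 w (hS₂₁ w hw))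
  -- the exponent identity `∑ i, mᵢ Re sᵢ = 0` (`‖∏ ∧² α‖ = ‖∏ α‖³ = 1`, `‖∏ γᵢ‖ = 1`)
  haveI := infinite_heightOneSpectrum' F
  obtain ⟨w₀, -, hw₀⟩ :=
    ((Set.infinite_univ (α := HeightOneSpectrum (𝓞 F))).sdiff hS₂).nonempty
  have hexp : ∑ i : ι, (m i.1 : ℝ) * (s i).re = 0 := by
    have hcardα : Multiset.card (α w₀) = 4 := (hπα w₀ (hS₂π w₀ hw₀)).card_eq
    have h : ‖(wedgeTwoParams (α w₀)).prod‖ =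
        ‖(∑ i : ι, (γ i w₀).map ((((w₀.residueCard : ℂ) ^ (s i))) * ·)).prod‖ :=
      congrArg (fun M : Multiset ℂ => ‖M.prod‖) (hdec₂ w₀ hw₀)
    rw [prod_wedgeTwoParams_of_card_eq_four hcardα, norm_pow, hu w₀ (hS₂π w₀ hw₀), one_pow,
      Multiset.prod_sum, norm_prod] at h
    refine sum_mul_eq_zero_of_prod_rpow_eq_one Finset.univ (fun i : ι => m i.1) _ (hq1 w₀) ?_
    rw [h]
    refine Finset.prod_congr rfl fun i _ => ?_
    rw [prod_map_const_mul_eq, hcard i w₀ (hS₂a w₀ hw₀ i), norm_mul, norm_pow,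
      huγ i w₀ (hS₂a w₀ hw₀ i), mul_one,
      Complex.norm_natCast_cpow_of_pos (zero_lt_one.trans w₀.one_lt_residueCard)]
  -- the index of degree `≤ 3` of step 1, among the positive-degree ones
  let i₁' : ι := ⟨i₁, hi₁1⟩
  by_cases hcase : ∃ i₀ : ι, (∀ j : ι, (s j).re ≤ (s i₀).re) ∧ m i₀.1 ≤ 3
  · -- Case A: a maximiser of `Re sᵢ` of degree `≤ 3` — the device on `π` itself
    obtain ⟨i₀, hi₀, hdeg⟩ := hcase
    have h0 : 0 ≤ (s i₀).re := by
      by_contra hlt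
      push Not at hlt
      have hneg : ∑ i : ι, (m i.1 : ℝ) * (s i).re < 0 := by
        refine Finset.sum_neg (fun i _ => mul_neg_of_pos_of_neg (by exact_mod_cast i.2) ?_)
          ⟨i₀, Finset.mem_univ _⟩
        linarith [hi₀ i]
      exact hneg.ne hexp
    exact false_of_wedgeTwo_decomposition_of_maximal_slope hJSb hJSp
      (A := fun w => wedgeTwoParams (α w)) hS₂ (fun i : ι => i.2) σu hγ₂ huγ₂ hdec₂ i₀ hi₀ h0
      (key π Sπ α hSπ hπα hu hnα hnβ' (m i₀.1) ⟨i₀.2, hdeg⟩)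
  · -- Case B: every maximiser has degree `≥ 4`; then a minimiser has degree `≤ 2`, and the device
    -- runs on the contragredient `π̃` (exponents `-sᵢ`, families `γᵢ⁻¹` of the `σ̃ᵢᵘ`)
    push Not at hcase
    obtain ⟨iM, -, hiM⟩ :=
      Finset.exists_max_image Finset.univ (fun i : ι => (s i).re) ⟨i₁', Finset.mem_univ _⟩
    obtain ⟨im, -, him⟩ :=
      Finset.exists_min_image Finset.univ (fun i : ι => (s i).re) ⟨i₁', Finset.mem_univ _⟩
    have hiM' : ∀ j : ι, (s j).re ≤ (s iM).re := fun j => hiM j (Finset.mem_univ _)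
    have him' : ∀ j : ι, (s im).re ≤ (s j).re := fun j => him j (Finset.mem_univ _)
    have hMdeg : 3 < m iM.1 := hcase iM hiM'
    have hne : im.1 ≠ iM.1 := by
      intro h
      have heq : im = iM := Subtype.ext h
      have h3 : 3 < m i₁ := hcase i₁' fun j => by
        have h1 := him' i₁'
        rw [heq] at h1
        linarith [hiM' j]
      omega
    have hmdeg : m im.1 ≤ 3 := by
      have hle : m im.1 + m iM.1 ≤ ∑ i, m i :=
        Finset.add_le_sum (fun l _ => Nat.zero_le (m l)) (Finset.mem_univ _) (Finset.mem_univ _)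
          hne
      omega
    have h0 : 0 ≤ -(s im).re := by
      by_contra hlt
      push Not at hlt
      have hpos : 0 < ∑ i : ι, (m i.1 : ℝ) * (s i).re := by
        refine Finset.sum_pos (fun i _ => mul_pos (by exact_mod_cast i.2) ?_)
          ⟨im, Finset.mem_univ _⟩
        linarith [him' i]
      exact hpos.ne' hexp
    -- the contragredient data `π̃`, `σ̃ᵢᵘ` and their families
    obtain ⟨πd, hπd⟩ := CuspidalAutomorphicRepData.exists_contragredient_satake_holds (hF 4) π
    set αd : SatakeFamily F := fun w => (α w).map (·⁻¹) with hαddef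
    have hπdα : ∀ w ∉ Sπ, πd.1.HasSatakeParamAt w (αd w) := fun w hw => hπd w _ (hπα w hw)
    have hud : ∀ w ∉ Sπ, ‖(αd w).prod‖ = 1 := fun w hw => by
      simp only [hαddef]
      rw [Multiset.prod_map_inv', norm_inv, hu w hw, inv_one]
    have hσd : ∀ i : ι, ∃ σd : CuspidalAutomorphicRepData (m i.1) F (hF (m i.1)),
        ∀ (v : HeightOneSpectrum (𝓞 F)) (a : Multiset ℂ),
          (σu i).1.HasSatakeParamAt v a → σd.1.HasSatakeParamAt v (a.map (·⁻¹)) := fun i =>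
      CuspidalAutomorphicRepData.exists_contragredient_satake_holds (hF (m i.1)) (σu i)
    choose σd hσd using hσd
    set γd : ι → SatakeFamily F := fun i w => (γ i w).map (·⁻¹) with hγddef
    have hγd₂ : ∀ i, ∀ w ∉ S₂, (σd i).1.HasSatakeParamAt w (γd i w) := fun i w hw =>
      hσd i w _ (hγ₂ i w hw)
    have huγd₂ : ∀ i, ∀ w ∉ S₂, ‖(γd i w).prod‖ = 1 := fun i w hw => by
      simp only [hγddef]
      rw [Multiset.prod_map_inv', norm_inv, huγ₂ i w hw, inv_one]
    have hdecd : ∀ w ∉ S₂, wedgeTwoParams (αd w) =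
        ∑ i : ι, (γd i w).map ((((w.residueCard : ℂ) ^ (-s i))) * ·) := by
      intro w hw
      have hms : (∑ i : ι, (γ i w).map ((((w.residueCard : ℂ) ^ (s i))) * ·)).map (·⁻¹) =
          ∑ i : ι, ((γ i w).map ((((w.residueCard : ℂ) ^ (s i))) * ·)).map (·⁻¹) :=
        map_sum (Multiset.mapAddMonoidHom fun x : ℂ => x⁻¹) _ Finset.univ
      simp only [hαddef, hγddef]
      rw [wedgeTwoParams_map_inv, hdec₂ w hw, hms]
      refine Finset.sum_congr rfl fun i _ => ?_
      rw [Multiset.map_map, Multiset.map_map]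
      refine Multiset.map_congr rfl fun x _ => ?_
      simp only [Function.comp_apply, mul_inv, Complex.cpow_neg]
    have hnαd : ∀ χ : HeckeCharacter F, ¬ ∀ᶠ v : HeightOneSpectrum (𝓞 F) in cofinite,
        ∀ a : Multiset ℂ, πd.1.HasSatakeParamAt v a →
          a.map (fun x => x⁻¹) = a.map (fun x => χ.valueAtUniformizer v * x) := fun χ =>
      not_eventually_selfDual_of_contragredient (π := π.1) (πd := πd.1) hSπ hπα hπdα hnα χ
    have hnβd : ∀ χ : HeckeCharacter F, χ ≠ 1 → ¬ ∀ᶠ v : HeightOneSpectrum (𝓞 F) in cofinite,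
        ∀ a : Multiset ℂ, πd.1.HasSatakeParamAt v a →
          a.map (fun x => χ.valueAtUniformizer v * x) = a := fun χ hχ =>
      not_eventually_selfTwist_of_contragredient (π := π.1) (πd := πd.1) hSπ hπα hπdα hnβ' χ hχ
    exact false_of_wedgeTwo_decomposition_of_maximal_slope hJSb hJSp
      (A := fun w => wedgeTwoParams (αd w)) hS₂ (fun i : ι => i.2) σd hγd₂ huγd₂
      (s := fun i => -s i) hdecd im
      (fun i => by
        show (-s i).re ≤ (-s im).re
        simp only [Complex.neg_re]
        linarith [him' i])
      (by
        show 0 ≤ (-s im).re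
        simpa using h0)
      (key πd Sπ αd hSπ hπdα hud hnαd hnβd (m im.1) ⟨im.2, hmdeg⟩)

/-- **The same for the two other renderings of the printed implication** (`Y` =
`AsgariRaghuram2007_notCuspidal_wedgeTwo_imp`, consumed by the crux `InducedSquareAscent`, and `Z` =
`AsgariRaghuram_wedgeTwo_notCuspidal_GL4`), through the equivalences of this file: both rest on the
same three named facts and the ONE unnamed printed input `hLS` of `…_of_kim_of_entireLS`.
[cite: AsgariRaghuram2007, Theorem 1 (i) ⇒ (iii); §4 Props. 11–12, §2.3 Props. 4–5] -/
theorem notCuspidal_wedgeTwo_imp_and_wedgeTwo_notCuspidal_GL4_of_kim_of_entireLS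
    (hK : Kim2003_exteriorSquare_GL4)
    (hJSb : JacquetShalika1981_partialPairL_boundary_repData)
    (hJSp : JacquetShalika1981_partialPairL_pole_repData)
    (hLS : ∀ (F : Type) [Field F] [NumberField F]
      (hF : ∀ m : ℕ, isCompact_glFiniteIntegralLevel m F) (π : CuspidalAutomorphicRepData 4 F (hF 4))
      (Sπ : Set (HeightOneSpectrum (𝓞 F))) (α : SatakeFamily F), Sπ.Finite →
      (∀ w ∉ Sπ, π.1.HasSatakeParamAt w (α w)) → (∀ w ∉ Sπ, ‖(α w).prod‖ = 1) →
      ∀ (n : ℕ), (n = 1 ∨ n = 2 ∨ n = 3) → ∀ (σ : CuspidalAutomorphicRepData n F (hF n))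
        (Sσ : Set (HeightOneSpectrum (𝓞 F))) (β : SatakeFamily F), Sσ.Finite →
        (∀ w ∉ Sσ, σ.1.HasSatakeParamAt w (β w)) → (∀ w ∉ Sσ, ‖(β w).prod‖ = 1) →
        ((n = 1 ∨ n = 3) →
          (¬ ∀ᶠ v : HeightOneSpectrum (𝓞 F) in cofinite, ∀ a : Multiset ℂ,
              π.1.HasSatakeParamAt v a →
                a.map (fun x => x⁻¹) = a.map (fun x => (β v).prod * x)) ∧
          (¬ ∀ᶠ v : HeightOneSpectrum (𝓞 F) in cofinite, ∀ a : Multiset ℂ,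
              π.1.HasSatakeParamAt v a →
                a.map (fun x => x⁻¹) = a.map (fun x => ((β v).prod)⁻¹ * x))) →
        (n = 2 →
          ¬ ∀ᶠ v : HeightOneSpectrum (𝓞 F) in cofinite, ∀ a : Multiset ℂ,
              π.1.HasSatakeParamAt v a → a.map (fun x => (β v).prod * x) = a) →
        ∃ S₁ : Set (HeightOneSpectrum (𝓞 F)), S₁.Finite ∧
          ∀ S : Set (HeightOneSpectrum (𝓞 F)), S.Finite → S₁ ⊆ S → ∀ z : ℂ, 1 ≤ z.re →
            ∃ d : ℂ, Tendsto (fun t : ℝ => partialPairL S (fun w => wedgeTwoParams (α w)) β (z + t))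
              (𝓝[>] (0 : ℝ)) (𝓝 d)) :
    AsgariRaghuram2007_notCuspidal_wedgeTwo_imp ∧ AsgariRaghuram_wedgeTwo_notCuspidal_GL4 :=
  have hT := AsgariRaghuram2007_selfDual_or_selfTwist_of_wedgeTwo_not_cuspidal_of_kim_of_entireLS
    hK hJSb hJSp hLS
  ⟨AsgariRaghuram2007_selfDual_or_selfTwist_of_wedgeTwo_not_cuspidal_iff_notCuspidal_wedgeTwo_imp.mp hT,
    AsgariRaghuram2007_selfDual_or_selfTwist_of_wedgeTwo_not_cuspidal_iff_wedgeTwo_notCuspidal_GL4.mp hT⟩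

/-- **The "entire" rendering of the Langlands–Shahidi input specialises to the rendering at
`s = 1`**: an input `hLS` as in `…_of_kim_of_entireLS` (finite limits at every `Re z ≥ 1`) gives
the input of `…_of_kim_of_LS` / `…_of_kim_of_unitarySummands_of_LS` (finite limit at `s → 1⁺`),
`z = 1`. So the new assembly asks no more of the Langlands–Shahidi method than Prop. 4 prints, and
strictly less of Kim's theorem than the earlier ones (no unitarity clause). [folklore] -/
theorem langlandsShahidi_at_one_of_entire {α β : SatakeFamily F}
    (h : ∃ S₁ : Set (HeightOneSpectrum (𝓞 F)), S₁.Finite ∧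
      ∀ S : Set (HeightOneSpectrum (𝓞 F)), S.Finite → S₁ ⊆ S → ∀ z : ℂ, 1 ≤ z.re →
        ∃ d : ℂ, Tendsto (fun t : ℝ => partialPairL S (fun w => wedgeTwoParams (α w)) β (z + t))
          (𝓝[>] (0 : ℝ)) (𝓝 d)) :
    ∃ S₁ : Set (HeightOneSpectrum (𝓞 F)), S₁.Finite ∧
      ∀ S : Set (HeightOneSpectrum (𝓞 F)), S.Finite → S₁ ⊆ S →
        ∃ d : ℂ, Tendsto (fun t : ℝ => partialPairL S (fun w => wedgeTwoParams (α w)) β (1 + t))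
          (𝓝[>] (0 : ℝ)) (𝓝 d) := by
  obtain ⟨S₁, hS₁, h⟩ := h
  exact ⟨S₁, hS₁, fun S hS hS₁S => h S hS hS₁S 1 (by simp)⟩

end EntireLS

end Literature.NumberTheory.Automorphic

end
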